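import Mathlib
import Literature.MathematicalPhysics.QuantumFieldTheory.Balaban1983to89.T4ComplexDilation

/-!
# T4CouplingLogLayer — the LOGARITHM LAYER and the VERTEX OF THE COUPLING DISC for node U3 (estimate NE9), kernel-checked
on the model activity `E(z) = log ∫ e^{−z·S} dμ`: `Z(z) = ∫ e^{−z·S} dμ` is ENTIRE with `Z(0) = 1`, ZERO-FREE with `Re Z > 0` on
`‖z‖·S₀ < π/2` (radius ATTAINED by a zero of the two-point model), so `E = log Z` is HOLOMORPHIC ON A FULL DISC ABOUT THE
VERTEX `z = 0`; NORMALISATION `E(0) = 0` gives the LINEAR VERTEX WEIGHT `‖E(z)‖ ≤ (9/4)·S₀·‖z‖` on `‖z‖·S₀ ≤ log(3/2)` FOR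
FREE (order-sharp: `‖E(z)‖ = S₀‖z‖` for the one-point model); and the model inhabits BY NAME the lineage's
`CouplingAnalyticOn ]0, γ]` with a UNIFORM radius (⇒ the g-FORM of NE9 with bounded moduli `3/r` via
`T4CouplingAnalyticity.ne9_of_couplingAnalyticOn`) and the weighted step binder `hlast` of `stepTransfer_of_analyticOnW`
(⇒ `StepTransfer` with last-coupling constant PROPORTIONAL TO THE ACTION BOUND `S₀`) (cell `pub-balaban`, T4-DAG v22 §2 node
U3 / §6 NE9; journal row T4-U3.E-NE9-PROVE-P1i*; a MODEL of the analytic branch of the printed dichotomy with explicit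
constants, NO estimate of the cell's NEW-ESTIMATE kind for Bałaban's activities, NOT summit progress).

HONEST FRAMING (T4-DAG PAGE 1).  The cell's T4 target is rung (B)+1: existence AND uniqueness of the ε → 0 limit of
Bałaban's unit-scale averaged expectations on a FIXED finite torus — strictly beyond ultraviolet stability
([Balaban1988Convergent] Cor. 3 p. 264; [Balaban1989LargeFieldII] Thm 1 p. 355), and NOT infinite volume, NOT a mass gap,
NOT the Clay problem; the hypotheses BetaPertH, (B), (B^μ) of the cell's chain stay explicit and are untouched here (this
module uses none of them).  NE9 is NOT PRINTED (cell NEW ESTIMATE).  This module ASSERTS NOTHING about Bałaban's functionals: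
every declaration is [folklore] — elementary complex analysis and integration against a probability measure on objects
DEFINED here — and the manuscripts under audit are named for STRUCTURE only (ABSOLUTE RULE of the cell: no internally-minted
statement enters as a cited fact; nothing printed in the audited series is used as a hypothesis).

WHY THIS LEAF (the two items generation 8 left open on the analytic-dependence route, record `t4/T4-EST-NE9-P1.md` §15.4(iv),
§15.7 (α)(β)).  The lineage `b2b-balaban-t4-ne9-p1` reduced NE9 (Lipschitz dependence of the step output on the coupling
HISTORY with fading memory, `T4OutputRate.NE9`/`FadingMemory`) to Cauchy constants of the one-step map
(`T4CouplingAnalyticity` §§5–7, §14) and kernel-checked the complex-DILATION mechanism behind the remaining hypothesis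
[H-dil] on ONE normalised block integral `act = invNorm · ∫ f e^{−wS} dμ` BEFORE the logarithm (`T4ComplexDilation`), on the
RELATIVE discs `|z − s| ≤ c·s` of the t-window.  Two things were not modelled.  (α) THE LOGARITHM: the printed activity is
`E^{(k+1)} = log ∫ …` ((2.13) below), and the logarithm of a holomorphic integral is holomorphic only on a ZERO-FREE region —
the model must say where that region is and that it cannot be larger.  (β) THE VERTEX: the printed coupling window is the
CLOSED interval `g_{j−1} ∈ [0, γ]` with *"(or analytic)"* (p. 263), and p. 266 records an alternative choice of the
small-field cut-offs under which *"the functions E^{(j)}, β_j are analytic functions of the effective coupling constants"*; in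
the lineage's currency this is the difference between RELATIVE discs shrinking to the vertex — which yield NE9 only through
an extra linear WEIGHT (`stepTransfer_of_analyticOnW`; without it the g-form FAILS at shape level,
`T4CouplingAnalyticity.vertexModel_not_ne9`, `T4CouplingAnalyticityWitness`) — and FULL discs of a uniform radius about
`]0, γ]` INCLUDING `g = 0`, which give the g-form of NE9 with bounded moduli directly (`ne9_of_couplingAnalyticOn`).  THIS
LEAF MODELS THE ANALYTIC BRANCH: a coupling-FREE reference probability measure `μ` (the point of a cut-off that does not
scale with the coupling) and an exponent LINEAR in the complex coupling `z` with a bounded real density `S`, `|S| ≤ S₀` (the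
first-order truncation in the coupling of an exponent that *"vanishes at g_k = 0"*).  Then (§§1–3) `Z` is entire, `Re Z > 0`
on `‖z‖·S₀ < π/2`, `E = log Z` is holomorphic there with `E(0) = 0` and `‖E(z)‖ ≤ (3/2)‖Z(z) − 1‖ ≤ (9/4)·S₀·‖z‖` on
`‖z‖·S₀ ≤ log(3/2)`: the vertex weight that generation 7 had to ASSUME (as `w(s) = s` in `CouplingAnalyticRelW`, as `M₁·s`
in `stepTransfer_of_analyticOnW`) is a CONSEQUENCE of normalisation, with constant proportional to the action bound; and
(§4) the full discs fire the lineage's g-form machinery BY NAME.  The SMALLNESS CONDITION of the branch is explicit: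
`(γ + r)·S₀ < log(3/2)` for a uniform coupling radius `r` about `]0, γ]` (`< π/2` for bare holomorphy) — the sup `S₀` of the
first-order action on the cut-off support must be `≲ 1/γ`.  [v1.2 CORRECTION (§8): that smallness is an ARTEFACT of bounding
`log Z` through `‖Z − 1‖ < 1` on discs about the vertex.  For a REAL action density the zero-free region is the STRIP
`|Im z|·S₀ < π/2` (sharp) [v1.3: CLASS-UNIFORM over `|S| ≤ S₀`, sharp over the class — XREAD C-ne4p1-27 I2], `log Z` is
holomorphic on the whole strip with `‖log Z(z)‖ ≤ |Re z|·S₀ + log 2 + π/2` for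
`|Im z|·S₀ ≤ 1`, and `CouplingAnalyticOn ]0, γ]` holds with ANY uniform radius `r < 1/S₀` for EVERY `γ`, bound
`M = (γ + 2r)·S₀ + log 2 + π/2`, NE9 moduli `4M/r` (`logModel_couplingAnalyticOn_strip`, `ne9_logModel_strip`,
`ne9_logModel_canonical`): the radius is `≍ 1/S₀`, the moduli `≍ S₀·(1 + γ·S₀)`, and NO condition couples `γ` to `S₀` — the
model's only input is a k-UNIFORM per-unit bound `S₀`.] [v1.3 (§9): the last sentence is a statement about the LINEAR
model.  The exponent of (2.13) depends on the last coupling through the scaled field `g_kB` (p. 267 *"the scaling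
transformation B = g_kB′"*), i.e. NON-LINEARLY; with a second-order term `z²·T` the zero-free region is the LENS
`|Im z|·(S₀ + 2|Re z|·T₀) < π/2` (sharp), the radius about `]0, γ]` is `≍ 1/(S₀ + γ·T₀)` and the moduli grow polynomially
in `γ`: analyticity at EVERY `γ` persists — no smallness condition obstructs it —, uniformity of the radius in `γ` does
not; the model's inputs are k-UNIFORM per-unit bounds `S₀, T₀, …` on the Taylor coefficients of the exponent in the
coupling (for ANY holomorphic family the zero-free region contains `{sup_x |Im A_z(x)| < π/2}`, `re_cpartFn_pos`).]
[v1.4 (§10): conversely, in the model class a radius `ρ` UNIFORM IN THE STEP forces `ρ·S₀(k) ≤ π/2` for all k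
(`radius_mul_actionBound_le_of_couplingAnalyticOn`, two-point member, ANY bound `M`): the k-uniform per-unit action bound
is NECESSARY AND SUFFICIENT for uniform coupling discs — G-ne9p1-13 is two-sided in the currency; class unchanged.]
[v1.5 (§11): and the TARGET SHAPE itself forces it — `NE9 … (Window γ) κ Λ` with `FadingMemory C₉ ω Λ` on the two-point
member gives `S₀ ≤ C₉·ω + 2·log 2/γ` (`actionBound_le_of_ne9_fadingMemory_twoPoint`): k-uniform NE9 constants on the model
class require k-uniform per-unit action bounds under ANY proof technique; MODEL statement, class unchanged.]
[v1.6 (§12): and the node's JOINT shape `NE9 ∧ FadingMemory` is realised on every member from the per-unit bound — memory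
length one, any rate `ω ∈ ]0, 1]`, `C₉ = 8S₀(|γ|S₀ + 1 + log 2 + π/2)/ω` (`ne9_and_fadingMemory_logModel`) —, so with §11 the
exact node shape holds on the model class with step-uniform `(C₉, ω)` IFF the per-unit action bounds are step-uniform
(`ne9_fadingMemory_twoPoint_two_sided`); MODEL statement, class unchanged.]
[v1.7 (§13): and the assigned MECHANISM itself is exhibited two-sidedly on the MEMORY MODEL `log Z(h_k)`,
`h_{k+1} = ω·h_k + g_k`: Cauchy with radii `r·ω^{−(k−1−i)}` (the contraction enlarges the coupling disc in the older
couplings) gives `NE9` with `Λ(k,i) = (4M/r)·ω^{k−1−i}` and `FadingMemory (4M/(rω)) ω Λ` (`ne9_and_fadingMemory_memModel`),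
and NO estimate of the node's shape has a memory rate below the contraction rate (`contractionRate_le_memoryRate`, two-point
member, technique-free); MODEL statement, class unchanged.]  Under the scheme printed on p. 266 — (2.9) is ONE condition
`χ({|B′(b)| < ε₁})` in the PRE-scaling variable `B′` (quoted below), which after *"the scaling transformation B = g_kB′"* of
p. 267 this lineage READS as a support of size `ε₁/g_k` in the Gaussian variable `B` of (2.12)/(2.13) (an INFERENCE,
consistent with the order-0 terms (2.11) and the arguments `g_kB` of (2.12); NOT a quotation) — the support grows as
`g_k → 0`, the corresponding sup is not uniform, and only the relative discs of [H-dil] remain (record §10 no-go;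
`T4CouplingAnalyticity` (L2)/(L5)): this is the printed dichotomy, read in the model.  Whether Bałaban's activities under the
alternative cut-off satisfy such a smallness condition uniformly in k is NOT PRINTED as a theorem (GAPS G-ne9p1-13, new)
[v1.2: read *admit a bound `S₀` on the first-order action per localisation unit, UNIFORM IN k* for *satisfy such a smallness
condition uniformly in k* — G-ne9p1-13 UPDATE 2; the class located-unprinted is unchanged].

PRINTED CONTEXT (STRUCTURE ONLY; renders `b2b-balaban-ref1/pages/1987-cmp109-rg-I-small-field/…-p015-x2.png`, `…-p018-x2.png`,
`…-p020-x2.png` = journal pp. 263, 266, 268 of [Balaban1987RG1], re-read as images by this seat; journal page = render page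
+ 248).  P. 263 (inductive hypothesis on the actions): *"We assume that the function E^{(j)}(X, g_{j−1}, U, J) is defined and
analytic on the space U_j^c(X, α₀, α₁), with some positive, absolute constants α₀, α₁ (i.e., constants independent of X and
j). It depends on the configurations restricted to X, i.e. on (U, J)|_X. It is a C^∞-function of g_{j−1} ∈ [0, γ], (or
analytic), with a positive, absolute γ. There exists a constant E₀ such that |E^{(j)}(X, g_{j−1}, U, J)| ≤ E₀ exp(−κd_j(X))
(1.18) for M ≥ M(κ), γ sufficiently small, and for all configurations (U, J) ∈ U_j^c(X, α₀, α₁)."*  P. 266, the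
small-field characteristic function (2.9): *"χ_k = ∏_{b ∈ T^{(k)}∖{b₀(c): c ∈ T^{(k+1)}} χ({|B′(b)| < ε₁})"* — ONE condition, in
the PRE-scaling variable `B′` (p. 267 then prints *"Next we make the scaling transformation B = g_kB′."*; v1 of this header
paraphrased (2.9) UNQUOTED with an inferred factor `1/g_k` and a clause `|∂U′ − 1| < (1/g_k)ε₁` that is NOT on pp. 265–268 —
DOCFIX D1 of XREAD C-adv8-78, renders p017/p018/p019 re-read as images by this seat) — and immediately after it:
*"Another possibility is to take g_k/γ_kε₁ instead of ε₁,
where γ_k = C log(L^kε)^{−1} with C sufficiently large. It has the advantage that the functions E^{(j)}, β_j are analytic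
functions of the effective coupling constants, but it has some disadvantages in perturbative calculations also. We have
formulated the implications of both possibilities in the inductive description."*  P. 268: *"E^{(k+1)}(g_k, U_{k+1}) =
log ∫ dμ_{C^{(k)}}(B)χ_k exp[P^{(k)}(g_k, U_{k+1}, B) + {…}]. (2.13) Let us remark that the expression under the exponential
above vanishes at g_k = 0, and log N_k″ = E^{(k+1)}(g_k, 1). (2.14)"*; *"Let us notice that the normalization constant N_k″ is
equal to the integral above at U_{k+1} = 1."*  PARSE CAVEAT: the typographical grouping of *"g_k/γ_kε₁"* on p. 266 (whether
the threshold of the rescaled variables becomes coupling-free up to the logarithmic factor `γ_k`) is NOT resolved by this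
seat and nothing below depends on it; the model only fixes what "a cut-off that does not scale with the coupling" buys.
DICTIONARY (model ↦ print; an ANALOGY fixing what is modelled, NOT an identification): `μ` ↦ the Gaussian measure
`dμ_{C^{(k)}}(B)` with COUPLING-FREE restrictions `χ`, normalised to mass one (normalising subtracts the coupling-free constant
`log ∫ dμ χ`, which changes no Lipschitz modulus in the coupling); `z` ↦ the last coupling `g_k` of the g-window `]0, γ]`
(`T4OutputRate.Window γ`; NOT the t-coordinate `t = 1/g²` of [H-dil]); `S` ↦ the first-order coefficient in `g_k` of the
exponent of (2.13), `S₀` ↦ its sup on the support of `χ`; `E = log Z` ↦ `E^{(k+1)}(g_k, U_{k+1})` minus the coupling-free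
constant, BEFORE localisation; the prefactor `e^{−κ d(X)}` of `logModel` is PUT IN BY HAND (the printed (1.18) shape), not
derived.  The (2.13)/(2.14) activities of Bałaban are NOT instances of `logPartFn` — see WHAT THIS DOES NOT SHOW.

## What is typed and proved (all [folklore])

§1 THE PARTITION FUNCTION `partFn μ S z = ∫ e^{−z·S} dμ` (`S` measurable, `|S| ≤ S₀`, `μ` a probability measure):
   `partFn_eq_blockInt` (= `T4ComplexDilation.blockInt` with unit density), `partFn_zero` (`Z(0) = 1`), `differentiable_partFn`
   (ENTIRE, `differentiable_blockInt` BY NAME), `actionBound_nonneg`, **`norm_partFn_sub_one_le`** `‖Z(z) − 1‖ ≤ e^{‖z‖S₀} − 1`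
   (Mathlib `Complex.norm_exp_sub_sum_le_exp_norm_sub_sum`), `norm_partFn_sub_one_le_mul` `≤ ‖z‖·S₀·e^{‖z‖S₀}`; the real
   partition function `partFnR` (`partFn_ofReal`, `partFnR_pos`).
§2 THE LOG LAYER `logPartFn μ S = log ∘ partFn μ S` (principal branch): `logPartFn_zero` (`E(0) = 0`), the domains
   `holDom S₀ = {‖z‖·S₀ < π/2} ⊇ bndDom S₀ = {‖z‖·S₀ < log(3/2)} ∋ 0` (open), **`re_partFn_pos`** (`Re Z > 0` on `holDom`: every
   Boltzmann factor has argument `< π/2` in modulus; Mathlib `integral_pos_iff_support_of_nonneg`), `partFn_mem_slitPlane`,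
   `partFn_ne_zero`, **`differentiableOn_logPartFn`** (`E` HOLOMORPHIC on `holDom S₀`, Mathlib `DifferentiableOn.clog`),
   `exp_logPartFn`, `logPartFn_ofReal` (`E(s) = Real.log (partFnR s)` at real `s`).
§3 BOUNDS on `‖z‖·S₀ ≤ log(3/2)`: `norm_partFn_sub_one_le_half` (`‖Z − 1‖ ≤ 1/2`), **`norm_logPartFn_le`** `‖E‖ ≤ (3/2)‖Z − 1‖`
   (Mathlib `Complex.norm_log_one_add_half_le_self` — the WHOLE COST OF THE LOGARITHM is the factor 3/2 and the restriction to
   the zero-free region), `norm_logPartFn_le_exp`, `norm_logPartFn_le_three_quarters` (uniform bound `3/4`), **THE VERTEX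
   WEIGHT `norm_logPartFn_le_weight`** `‖E(z)‖ ≤ (9/4)·S₀·‖z‖`, and its Schwarz-lemma form `norm_logPartFn_le_schwarz`
   `‖E(z)‖ ≤ ((3/2)(e^p − 1)/R)·‖z‖` on `‖z‖ < R`, `R·S₀ ≤ p ≤ log(3/2)` (Mathlib `Complex.dist_le_div_mul_dist_of_mapsTo_ball`).
§4 CURRENCY (lineage shapes BY NAME).  `logModel C Bg κ μ S : Functional C Bg` (= `e^{−κd(X)}·Real.log (partFnR (g_{j−1}))` on
   scale-j domains, j ≥ 1): `logModel_prefix` (`PrefixDependenceOn`), `logModel_ofReal`, `logModel_decay` (`DecayBound … (3/4) κ`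
   on `Window γ`, `γ·S₀ ≤ log(3/2)`), **`logModel_couplingAnalyticOn`**: `CouplingAnalyticOn ]0, γ] (logModel …) κ (3/4) (fun _ _
   => r)` for `(γ + r)·S₀ < log(3/2)` — FULL discs of UNIFORM radius `r` about the g-window, the vertex inside —, hence
   **`ne9_logModel`**: `NE9 (logModel …) (Window γ) κ (fun _ _ => 4·(3/4)/r)` by `ne9_of_couplingAnalyticOn` BY NAME; the
   memoryless hierarchy `logModelV` (`V (j+1) g = E(g_j)`): **`stepTransfer_logModelV_weighted`** — `hlast` of
   `stepTransfer_of_analyticOnW` inhabited on the relative discs `|z − s| ≤ c·s` with the DERIVED weight `M₁·s`,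
   `M₁ = (9/4)·S₀·(1 + c)`, giving `StepTransfer (logModelV μ S) (Window γ) (8M₁/min(c,1)) 3 0` for `(1 + c)γ·S₀ ≤ log(3/2)`;
   `stepTransfer_logModelV_full` — `hlast` of `stepTransfer_of_analyticOn` with the constant radius `r`, `StepTransfer … (3/r) 3 0`.
§5 SHARPNESS.  Two-point model (`twoPoint` = ½δ_true + ½δ_false on `Bool`, action `±S₀`): `partFn_twoPoint` `Z(z) = cosh(z·S₀)`,
   **`partFn_twoPoint_zero`**: at `z₀ = iπ/(2S₀)`, `‖z₀‖·S₀ = π/2` and `Z(z₀) = 0` — a zero ON THE BOUNDARY of `holDom S₀`, so the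
   holomorphy radius `π/(2S₀)` of §2 is EXACT at this generality —, `no_log_on_closed_region` (no logarithm of `Z` exists on
   `‖z‖·S₀ ≤ π/2`).  One-point model (`δ` on `Unit`, constant action `S₀`): `partFn_onePoint` `Z = e^{−zS₀}`, `logPartFn_onePoint`
   `E(z) = −z·S₀`, `‖E(z)‖ = S₀·‖z‖` on `holDom` — the vertex weight is proportional to `S₀` with the optimal order (constant `9/4`
   against `≥ 1`).
§6 `shapes_nonvacuous`: the hypotheses of §4 are met (one-point model, `S₀ = 1/8`, `γ = r = 1`; `e^{1/4} < 4/3 < 3/2`).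
§7 (v1.1, APPEND-ONLY) ADDITIVITY OVER INDEPENDENT BLOCKS — the logarithm taken AFTER localisation: for `Measure.pi μ` and
   the total action `blockSum S = ∑ i, S i` (block bounds `S₀ i`), `partFn_pi` (`Z = ∏ i, Z_i`, Fubini), `partFn_pi_ne_zero`, the
   BLOCKWISE logarithm `blockLog μ S = ∑ i, logPartFn (μ i) (S i)` with `blockLog_zero`, **`exp_blockLog`** /
   **`differentiableOn_blockLog`** (a holomorphic logarithm of `Z` on `⋂ i, holDom (S₀ i)` ⊇ `holDom M` for `S₀ i ≤ M`,
   `holDom_subset_iInter`: region set by the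
   LARGEST block, INDEPENDENT of the number of blocks), **`norm_blockLog_le_weight`** (`‖blockLog z‖ ≤ (9/4)·(∑ i, S₀ i)·‖z‖`:
   EXTENSIVE weight on a volume-independent region); CONTRAST `differentiableOn_logPartFn_pi_apriori` (§2 on the total action,
   bound `∑ i, S₀ i` by `abs_blockSum_le`: principal log certified only on `holDom (∑ i, S₀ i)`, shrinking like `1/#blocks`);
   SHARPNESS `partFn_pi_twoPoint_zero` (one two-point block of bound `S₀ i₀` kills every logarithm of the TOTAL beyond
   `‖z‖·S₀ i₀ < π/2`) and `logPartFn_pi_ne_blockLog` (three aligned one-point blocks: at `z₀ = (2π/(5S₀))·I` inside the common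
   region the principal log of the total differs from the blockwise sum — imaginary parts `> −π` versus `−6π/5`).
§8 (v1.2, APPEND-ONLY) THE STRIP: `stripDom S₀ = {|Im z|·S₀ < π/2}` ⊇ `holDom S₀` (open; every real coupling inside),
   **`re_partFn_pos_strip`** (`Re Z > 0` on the strip, for EVERY `Re z`), `partFn_ne_zero_strip`,
   **`differentiableOn_logPartFn_strip`** (`log Z` holomorphic on the whole strip), `exp_logPartFn_strip`; bounds
   `norm_partFn_le_exp_re` (`‖Z‖ ≤ e^{|Re z|S₀}`), `exp_neg_half_le_re_partFn` (`e^{−|Re z|S₀}/2 ≤ Re Z` for `|Im z|·S₀ ≤ 1`,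
   `half_le_cos_one`), **`norm_logPartFn_le_strip`** (`‖log Z(z)‖ ≤ |Re z|·S₀ + log 2 + π/2` for `|Im z|·S₀ ≤ 1`); SHARPNESS
   `twoPoint_zero_on_strip_boundary` (the two-point zero has `|Im z₀|·S₀ = π/2`); CURRENCY BY NAME for EVERY window length:
   `logModel_decay_strip` (`DecayBound … (Window γ) (γS₀ + log 2 + π/2) κ`), **`logModel_couplingAnalyticOn_strip`**
   (`CouplingAnalyticOn ]0, γ] (logModel …) κ ((γ + 2r)S₀ + log 2 + π/2) (fun _ _ => r)` for ANY `0 < r`, `r·S₀ < 1`, ANY `γ`),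
   **`ne9_logModel_strip`** (`ne9_of_couplingAnalyticOn` FIRED BY NAME: NE9 on `Window γ` with moduli `4M/r`) and
   `ne9_logModel_canonical` (`r = 1/(2S₀)`: moduli `8S₀(γS₀ + 1 + log 2 + π/2)`) — the smallness `(γ + r)·S₀ < log(3/2)` of §4
   is WITHDRAWN as a proof artefact (see the §8 docstring and the bracketed v1.2 corrections above and below).
§9 (v1.3, APPEND-ONLY) NON-LINEAR COUPLING DEPENDENCE IN THE EXPONENT: static lemmas for a COMPLEX action density `A`
   (`cpartFn μ A = ∫e^{−A}dμ`; **`re_cpartFn_pos`** `Re > 0` whenever `|Im A| ≤ θ < π/2`; `norm_cpartFn_le`,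
   `exp_neg_half_le_re_cpartFn`, **`norm_log_cpartFn_le`** `‖log ∫e^{−A}dμ‖ ≤ a + log 2 + π/2` for `|Re A| ≤ a`, `|Im A| ≤ 1`)
   — the zero-free region of ANY holomorphic family `z ↦ A_z` contains `{sup |Im A_z| < π/2}`; the SECOND-ORDER family
   `partFn₂ μ S T z = ∫e^{−(zS + z²T)}dμ` (`|S| ≤ S₀`, `|T| ≤ T₀`): `hasDerivAt_partFn₂` / `differentiable_partFn₂` (ENTIRE),
   `quadAction_re_im` (`Im = Im z·(S + 2Re z·T)`), the LENS `lensDom S₀ T₀ = {|Im z|·(S₀ + 2|Re z|·T₀) < π/2}` (open, reals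
   inside, `lensDom_zero_right = stripDom`), **`re_partFn₂_pos`**, `partFn₂_ne_zero`, **`differentiableOn_logPartFn₂`**,
   **`norm_logPartFn₂_le`** (`‖log Z₂‖ ≤ |Re z|·S₀ + (Re z² + Im z²)·T₀ + log 2 + π/2` on `|Im z|·(S₀ + 2|Re z|·T₀) ≤ 1`),
   SHARPNESS **`partFn₂_twoPoint_zero`** (`S = 0`, two-point `T`: `Z₂ = cosh(z²T₀)` vanishes at `(1 + i)√(π/(4T₀))`, ON the
   lens boundary); CURRENCY `logModel₂`, `logModel₂_prefix`, `logModel₂_ofReal`, **`logModel₂_couplingAnalyticOn`**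
   (`CouplingAnalyticOn ]0, γ] … (fun _ _ => r)` for EVERY `γ` and every `r` with `2r·(S₀ + 2(γ + 2r)·T₀) ≤ 1`, bound
   `(γ + 2r)S₀ + ((γ + 2r)² + 4r²)T₀ + log 2 + π/2`), **`ne9_logModel₂`** (BY NAME) — at second order the radius about `]0, γ]`
   is `≍ 1/(S₀ + γT₀)`: analyticity at EVERY `γ` persists, UNIFORMITY of the radius in `γ` does not.
§10 (v1.4, APPEND-ONLY) NECESSITY IN THE CURRENCY: `partFnR_twoPoint`, `logModel_twoPoint_apply`,
   **`radius_mul_actionBound_le_of_couplingAnalyticOn`** (if the two-point log-layer model — a member of the class `|S| ≤ S₀` —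
   is `CouplingAnalyticOn ]0, γ] … κ M r` for ANY bound `M`, then `r k (k−1)·S₀ ≤ π/2` at every domain of positive scale `k`;
   identity theorem `AnalyticOnNhd.eqOn_of_preconnected_of_frequently_eq` + the Lee–Yang zero `iπ/(2S₀)` of §5),
   **`not_couplingAnalyticOn_twoPoint`** (no `M` rescues a radius `> π/(2S₀)`), `couplingAnalyticOn_twoPoint_iff_side` (uniform
   radius `ρ`: IF `ρ·S₀ < 1` (§8) and ONLY IF `ρ·S₀ ≤ π/2`) — in the model class the located-unprinted input of G-ne9p1-13
   (k-uniform per-unit action bounds) is NECESSARY AND SUFFICIENT for coupling discs of radius uniform in the step.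
§11 (v1.5, APPEND-ONLY) NECESSITY FOR THE TARGET ESTIMATE ITSELF (technique-neutral): `log_cosh_ge_sub_log_two`,
   `log_cosh_le_abs`, **`actionBound_le_of_ne9_twoPoint`** (the g-form `NE9 … (Window γ) κ Λ` on the two-point member forces
   `S₀ − 2·log 2/γ ≤ Λ k (k−1)` at every positive-scale domain — test histories `γ` and `γ` with the last coupling halved),
   **`actionBound_le_of_ne9_fadingMemory_twoPoint`** (with `FadingMemory C₉ ω Λ`: `S₀ ≤ C₉·ω + 2·log 2/γ`),
   `not_ne9_fadingMemory_twoPoint` — k-uniform NE9-with-fading-memory constants exist on the model class ONLY IF the per-unit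
   action bounds are k-uniform: the located-unprinted input is necessary for the ESTIMATE, under any proof technique.
§12 (v1.6, APPEND-ONLY) THE NODE'S JOINT SHAPE `NE9 ∧ FadingMemory` ON THE MODEL CLASS: `lastOnly`, `LastCouplingOnly`,
   `logModel_lastCouplingOnly`, **`ne9_lastCoupling_of_ne9`** (a functional reading only its last coupling: `NE9 … Λ` ⇒
   `NE9 … (lastOnly Λ)`), `fadingMemory_lastOnly_const` (rate `ω ∈ ]0, 1]`, constant `Λ₀/ω`),
   **`ne9_and_fadingMemory_logModel`** (every member, every `κ, γ`, every `ω ∈ ]0, 1]`: `∃ Λ, NE9 … (Window γ) κ Λ ∧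
   FadingMemory (8S₀(|γ|S₀ + 1 + log 2 + π/2)/ω) ω Λ` — §8 BY NAME + last-coupling transfer),
   **`ne9_fadingMemory_twoPoint_two_sided`** (two-point member: the joint shape HOLDS with `C₉ = 8S₀(γS₀ + 1 + log 2 + π/2)/ω`
   and FAILS for every `C₉ < (S₀ − 2log 2/γ)/ω`) — the node's exact target shape is realised on the model class with
   step-uniform `(C₉, ω)` iff the per-unit action bounds are step-uniform.
§13 (v1.7, APPEND-ONLY) FADING MEMORY FROM THE CONTRACTION, BY CAUCHY — the MEMORY MODEL `memModel` (activity
   `e^{−κd}·log Z(h_k)`, effective coupling `effCoupling`: `h_{k+1} = ω·h_k + g_k`, `h_0 = 0`; `effCoupling_eq_sum`,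
   `effCoupling_update_sub`, `abs_effCoupling_le`, `memModel_zero` = §2 at `ω = 0`, `memModel_prefix`, `memModel_ofReal`):
   **`memModel_couplingAnalyticOn`** (radius `r·ω^{−(k−1−i)}` in `g_i`, bound `(γ/(1−ω) + 2r)·S₀ + log 2 + π/2`),
   **`ne9_and_fadingMemory_memModel`** (`NE9` with `Λ(k,i) = (4M/r)·ω^{k−1−i}` BY NAME ∧ `FadingMemory (4M/(rω)) ω Λ` —
   the memory fades at the contraction rate, produced by Cauchy radii growing into the past); technique-free converse on
   the two-point member: `tanh_mul_sub_le_log_cosh_sub` (mean value), **`rate_bound_of_ne9_fadingMemory_memModel_twoPoint`**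
   (`S₀·tanh(γS₀/2)·ω^m ≤ C₉·ω₉^{m+1}` for every lag `m < scale X`), **`contractionRate_le_memoryRate`** (`ω ≤ ω₉` on
   carriers of unbounded scale), `memoryRate_twoPoint_two_sided`.

WHAT THIS SHOWS AND WHAT IT DOES NOT.  Shows (kernel): on the analytic branch the logarithm costs exactly a zero-free region
(`‖z‖·S₀ < π/2`, sharp) and a factor `3/2` in the bounds; the vertex is an INTERIOR point of the coupling disc as soon as the
reference measure is coupling-free; the linear vanishing at the vertex with constant `∝ S₀` is automatic from `Z(0) = 1`; and
full discs of uniform radius deliver the g-form of NE9 for the model BY NAME with moduli `3/r`, `r < log(3/2)/S₀ − γ` — so on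
this branch the fading-memory / Lipschitz constants of NE9 are governed by ONE number, the sup `S₀` of the first-order action
on the cut-off support, which must be `O(1/γ)` uniformly in the step [v1.2 CORRECTION (§8): `r < 1/S₀` suffices for EVERY
`γ`, with moduli `4((γ + 2r)·S₀ + log 2 + π/2)/r`; `S₀` need only be UNIFORM IN THE STEP, not `O(1/γ)` — the zero-free region
is the strip `|Im z|·S₀ < π/2`, not a disc] [v1.3 (§9): at second order in the coupling (`z·S + z²·T`) the region is the lens
`|Im z|·(S₀ + 2|Re z|·T₀) < π/2` and the radius `≍ 1/(S₀ + γT₀)` — still no obstruction at any `γ`, the inputs being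
k-uniform bounds on the Taylor coefficients of the exponent] [v1.4 (§10): and CONVERSELY, over the class `|S| ≤ S₀` a
coupling-analyticity radius `ρ` uniform in the step FORCES `ρ·S₀(k) ≤ π/2` for every k (two-point member, identity theorem
+ Lee–Yang zero) — the k-uniform per-unit action bound is NECESSARY as well as sufficient for uniform discs] [v1.5 (§11):
and necessary for the TARGET ESTIMATE itself — `NE9` with `FadingMemory C₉ ω` on `Window γ` forces `S₀ ≤ C₉ω + 2log 2/γ` on
the two-point member, by two test histories, with no analyticity anywhere] [v1.6 (§12): and the JOINT node shape
`NE9 ∧ FadingMemory` holds on every member from the per-unit bound (memory length one), two-sided with §11] [v1.7 (§13):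
and on the MEMORY MODEL (activity of the effective coupling of the contracting flow `h_{k+1} = ω·h_k + g_k`) Cauchy radii
growing into the past give fading memory AT the contraction rate, which no estimate can beat]; and (§7) for INDEPENDENT units the relevant `S₀` is
the largest SINGLE-UNIT bound, uniformly in the number of units, PROVIDED the logarithm is taken unit by unit (the blockwise
sum is a holomorphic logarithm of the total on the intersection of the unit regions, while the principal logarithm of the
total is certified only on a region shrinking with the volume and is not the blockwise sum beyond two units).  Does NOT
show: anything for Bałaban's 𝐑-operation — the model has NO localisation or polymer expansion (the factor `e^{−κ·d(X)}`
is a prefactor by fiat; §7's independent blocks are a product measure, whereas Bałaban's localisation is a cluster expansion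
with overlapping units), keeps only the
FIRST-ORDER term of the exponent in the coupling (the printed `P^{(k)}` carries all orders and the `1/g_k²`-structure of (2.12)
treated in `T4ComplexDilation`), ignores the background field, the Haar density and the δ-functions, has NO uniformity in k
beyond the explicit `S₀`, and does not decide which cut-off scheme the later papers of the series actually run; nor NE9
(cell NEW ESTIMATE, node U3).  The wall of node U3 on this route is unchanged and typed: the binder `hlast` of
`T4CouplingAnalyticity.stepTransferV_of_analyticOn` for Bałaban's step with `M₁ j = M·exp(−A₀ (log t_j)^{p₀})` ([H-dil-N];
record §9, §13, §15; GAPS G-ne9p1-1 … 12), now accompanied on the g-window side by the smallness condition `(γ + r)·S₀ <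
log(3/2)` of this leaf (G-ne9p1-13) as the precise analytic-branch alternative [v1.2 (§8): superseded — the g-window side
needs only a k-UNIFORM per-unit bound `S₀`, coupling radius `r < 1/S₀`, moduli `≍ S₀(1 + γS₀)`; the `log(3/2)` smallness is
WITHDRAWN as a proof artefact; v1.3 (§9): with non-linear coupling dependence, k-uniform bounds `S₀, T₀, …` on the Taylor
coefficients of the exponent, radius `≍ 1/(S₀ + γT₀)` at second order].

CITATION HEADER (lean-in-tree rule 2026-08-18).  Source quoted (STRUCTURE/CONTEXT only, pp. 263, 266, 268 as above):
T. Bałaban, *Renormalization group approach to lattice gauge field theories. I.*, Commun. Math. Phys. **109**, 249–301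
(1987) [Balaban1987RG1] (cell paper B12; held `paper:balaban1987-cmp109-rg-i-small-field`).  Named for framing only:
[Balaban1988Convergent] (B14), [Balaban1989LargeFieldII] (B16).  The Bałaban papers are manuscripts UNDER ADJUDICATION by the
audit cell `pub-balaban`: NOTHING printed in them is asserted here.  Kernel inputs imported BY NAME: `T4ComplexDilation` v1.1
(this lineage, p189052: `blockInt`, `integrable_boltzmann`, `differentiable_blockInt`), through it `T4CouplingAnalyticity` v1.6
(p187391: `CouplingAnalyticOn`, `ne9_of_couplingAnalyticOn`, `window_eq_boxWindow`, `StepTransfer`,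
`stepTransfer_of_analyticOnW`, `stepTransfer_of_analyticOn`, themselves resting on `Dimock2015.AnalyticLipschitz`, p179421 —
J. Dimock's printed "analyticity ⇒ Lipschitz continuity" mechanism [Dimock2015], PUBLISHED and outside the audited series),
`T4OutputRate` (pv05, p179034: `Carriers`, `Functional`, `Window`, `DecayBound`, `PrefixDependenceOn`, `NE9`) and Mathlib
(`DifferentiableOn.clog`, `Complex.norm_log_one_add_half_le_self`, `Complex.dist_le_div_mul_dist_of_mapsTo_ball`,
`Complex.norm_exp_sub_sum_le_exp_norm_sub_sum`, `integral_pos_iff_support_of_nonneg`, `Complex.cosh_mul_I`); it modifies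
nothing.  NEW LEAF of unit `b2b-balaban-t4-ne9-p1-g9` (NE9 prover P1, analytic-dependence route, generation 9; journal ONLINE
+ CLAIM T4-U3.E-NE9-PROVE-P1i* 2026-08-19T14:50:48Z).  v1 = p189722 (commit b2b0640a0b1b); v1.1 (same unit): DOCSTRING fixes
D1 (the (2.9) sentence above and the p. 266/267 reading in WHY THIS LEAF), I1 (`Carriers` in the input list), I2 (note on the
unused binder `hr` of `logModel_couplingAnalyticOn`) of the cross-read C-adv8-78 (unit `b2b-balaban-adv8-g59`, verdict
ok/CONSISTENT, ABSOLUTE-RULE 0), plus the APPEND-ONLY §7 (independent blocks: factorisation, blockwise logarithm, volume-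
independent region, extensive weight, sharpness; Mathlib `integral_fintype_prod_eq_prod`, `Complex.exp_sum`,
`DifferentiableOn.fun_sum`, `Complex.neg_pi_lt_log_im`); §§1–6 declarations byte-identical.  v1.2 (same unit): APPEND-ONLY §8
(the STRIP: zero-free region `|Im z|·S₀ < π/2`, `log Z` holomorphic on the whole strip with a bound linear in `|Re z|·S₀`,
`CouplingAnalyticOn ]0, γ]` and the g-form of NE9 for EVERY `γ` with any radius `r < 1/S₀`; Mathlib `Complex.abs_arg_lt_pi_div_two_iff`,
`Complex.norm_le_abs_re_add_abs_im`, `Real.one_sub_sq_div_two_le_cos`) and the bracketed *[v1.2 CORRECTION]* sentences of this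
header WITHDRAWING the smallness `(γ + r)·S₀ < log(3/2)` / *"S₀ ≲ 1/γ"* as a proof artefact; §§1–7 declarations byte-identical.
v1.3 (same unit): APPEND-ONLY §9 (non-linear coupling dependence in the exponent: static complex-action lemmas, the
second-order family `∫e^{−(zS + z²T)}dμ` — entire by dominated differentiation, zero-free on the LENS
`|Im z|·(S₀ + 2|Re z|·T₀) < π/2` (sharp), `‖log Z₂‖` bound, `CouplingAnalyticOn ]0, γ]` and NE9 BY NAME for every `γ` with
radius `≍ 1/(S₀ + γT₀)`; Mathlib `hasDerivAt_integral_of_dominated_loc_of_deriv_le`, `HasDerivAt.cexp`, `hasDerivAt_pow`)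
and the bracketed *[v1.3]* header sentences qualifying *"NO condition couples γ to S₀"* as a statement about the LINEAR
model, plus the three cosmetic INFO items I1–I3 of the cross-read C-ne4p1-27 of v1.2 (unit `b2b-balaban-t4-ne4-p1-g13`,
verdict ok/CONSISTENT, DOCFIX 0, ABSOLUTE-RULE 0) in bracketed form; §§1–8 declarations byte-identical.  v1.4 (same
unit): APPEND-ONLY §10 (NECESSITY in the currency: for the two-point member of the class, `CouplingAnalyticOn ]0, γ] … κ M r`
with ANY `M` forces `r k (k−1)·S₀ ≤ π/2` at every positive-scale domain — identity theorem, Mathlib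
`AnalyticOnNhd.eqOn_of_preconnected_of_frequently_eq`, `DifferentiableOn.analyticOnNhd`, plus the Lee–Yang zero of §5;
`not_couplingAnalyticOn_twoPoint`, `couplingAnalyticOn_twoPoint_iff_side`) and the bracketed *[v1.4]* header sentences;
§§1–9 declarations byte-identical.  v1.5 (same unit): APPEND-ONLY §11 (NECESSITY for the target estimate, technique-neutral:
`NE9 … (Window γ) κ Λ` on the two-point member forces `S₀ − 2·log 2/γ ≤ Λ k (k−1)`, and with `FadingMemory C₉ ω Λ`
`S₀ ≤ C₉·ω + 2·log 2/γ`; elementary — `x − log 2 ≤ log cosh x ≤ |x|`, `Finset.sum_eq_single`) and the bracketed *[v1.5]*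
header sentences; §§1–10 declarations byte-identical.  v1.6 (same unit): APPEND-ONLY §12 (the node's JOINT shape on the
model class: `ne9_lastCoupling_of_ne9` moves the NE9 charge onto the last coupling for functionals reading only it,
`fadingMemory_lastOnly_const`, `ne9_and_fadingMemory_logModel` — `∃ Λ, NE9 ∧ FadingMemory (Λ₀/ω) ω Λ` for every member and
every `ω ∈ ]0, 1]` —, `ne9_fadingMemory_twoPoint_two_sided`) and the bracketed *[v1.6]* header sentences; §§1–11 declarations
byte-identical.  v1.7 (same unit): APPEND-ONLY §13 (the MEMORY MODEL: `effCoupling`, `memModel`,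
`memModel_couplingAnalyticOn`, `ne9_and_fadingMemory_memModel`, `rate_bound_of_ne9_fadingMemory_memModel_twoPoint`,
`contractionRate_le_memoryRate`, `memoryRate_twoPoint_two_sided` — fading memory FROM THE CONTRACTION by Cauchy, and its
rate is sharp) and the bracketed *[v1.7]* header sentences; §§1–12 declarations byte-identical.  v1.8 (same unit): DOCFIX D1 of
XREAD C-ne9p1g9-7 (`|γ|` for `γ` in the two §12 docstrings of `ne9_and_fadingMemory_logModel`; XREADs C-ne9p1g9-4, -5, -6 returned
DOCFIX 0); NO declaration changes — every `def`/`theorem` line and proof of v1.7 byte-identical.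
-/

noncomputable section

open Complex Metric Set MeasureTheory
open scoped BigOperators
open Literature.MathematicalPhysics.QuantumFieldTheory.Balaban1983to89.T4OutputRate
open Literature.MathematicalPhysics.QuantumFieldTheory.Balaban1983to89.T4CouplingAnalyticity
open Literature.MathematicalPhysics.QuantumFieldTheory.Balaban1983to89.T4ComplexDilation

namespace Literature.MathematicalPhysics.QuantumFieldTheory.Balaban1983to89.T4CouplingLogLayer

/-! ## §1  The normalised partition function `Z(z) = ∫ e^{−z·S} dμ`: entire, `Z(0) = 1`, `‖Z(z) − 1‖ ≤ e^{‖z‖S₀} − 1` -/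

section PartFn

variable {Ω : Type*} [MeasurableSpace Ω] (μ : Measure Ω)

/-- The PARTITION FUNCTION of the model at complex coupling `z`: `Z(z) = ∫ e^{−z·S(x)} dμ(x)` (`μ` the coupling-free
reference measure — a probability measure in all normalised statements —, `S` the real action density carrying the
coupling). [folklore] -/
def partFn (S : Ω → ℝ) (z : ℂ) : ℂ := ∫ x, cexp (-(z * S x)) ∂μ

/-- `Z` is the cut-off block integral of `T4ComplexDilation` with unit density. [folklore] -/
theorem partFn_eq_blockInt (S : Ω → ℝ) : partFn μ S = blockInt μ (fun _ => 1) S := by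
  funext z
  simp [partFn, blockInt]

/-- NORMALISATION: `Z(0) = 1` for a probability measure. [folklore] -/
theorem partFn_zero [IsProbabilityMeasure μ] (S : Ω → ℝ) : partFn μ S 0 = 1 := by
  simp [partFn]

/-- The Boltzmann factor is integrable at every complex coupling (`S` measurable, `|S| ≤ S₀`, finite measure). [folklore] -/
theorem integrable_expAction [IsFiniteMeasure μ] {S : Ω → ℝ} (hS : Measurable S) {S₀ : ℝ} (hS₀ : ∀ x, |S x| ≤ S₀)
    (z : ℂ) : Integrable (fun x => cexp (-(z * S x))) μ := by
  simpa using integrable_boltzmann μ (integrable_const (1 : ℂ)) hS hS₀ z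

/-- `Z` is ENTIRE in the complex coupling (`T4ComplexDilation.differentiable_blockInt` BY NAME). [folklore] -/
theorem differentiable_partFn [IsFiniteMeasure μ] {S : Ω → ℝ} (hS : Measurable S) {S₀ : ℝ} (hS₀ : ∀ x, |S x| ≤ S₀) :
    Differentiable ℂ (partFn μ S) := by
  rw [partFn_eq_blockInt]
  exact differentiable_blockInt μ (integrable_const _) hS hS₀

/-- A probability space is non-empty, so an action bound is non-negative. [folklore] -/
theorem actionBound_nonneg [IsProbabilityMeasure μ] {S : Ω → ℝ} {S₀ : ℝ} (hS₀ : ∀ x, |S x| ≤ S₀) : 0 ≤ S₀ := by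
  rcases isEmpty_or_nonempty Ω with hΩ | ⟨⟨x⟩⟩
  · exact absurd (Measure.eq_zero_of_isEmpty μ) (IsProbabilityMeasure.ne_zero μ)
  · exact (abs_nonneg _).trans (hS₀ x)

/-- **`‖Z(z) − 1‖ ≤ e^{‖z‖·S₀} − 1`** (probability measure; pointwise `‖e^w − 1‖ ≤ e^{‖w‖} − 1`, Mathlib
`Complex.norm_exp_sub_sum_le_exp_norm_sub_sum` with one Taylor term). [folklore] -/
theorem norm_partFn_sub_one_le [IsProbabilityMeasure μ] {S : Ω → ℝ} (hS : Measurable S) {S₀ : ℝ}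
    (hS₀ : ∀ x, |S x| ≤ S₀) (z : ℂ) : ‖partFn μ S z - 1‖ ≤ Real.exp (‖z‖ * S₀) - 1 := by
  have hint := integrable_expAction μ hS hS₀ z
  have hsub : partFn μ S z - 1 = ∫ x, (cexp (-(z * S x)) - 1) ∂μ := by
    rw [integral_sub hint (integrable_const (1 : ℂ)), partFn]
    simp
  rw [hsub]
  refine (norm_integral_le_of_norm_le (integrable_const (Real.exp (‖z‖ * S₀) - 1)) ?_).trans (le_of_eq ?_)
  · refine Filter.Eventually.of_forall fun x => ?_
    have h1 := Complex.norm_exp_sub_sum_le_exp_norm_sub_sum (-(z * S x)) 1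
    simp only [Finset.sum_range_one, pow_zero, Nat.factorial_zero, Nat.cast_one, div_one] at h1
    refine h1.trans ?_
    have h2 : ‖-(z * (S x : ℂ))‖ ≤ ‖z‖ * S₀ := by
      rw [norm_neg, norm_mul, Complex.norm_real, Real.norm_eq_abs]
      exact mul_le_mul_of_nonneg_left (hS₀ x) (norm_nonneg _)
    linarith [Real.exp_le_exp.2 h2]
  · simp

/-- The LINEAR form `‖Z(z) − 1‖ ≤ ‖z‖·S₀·e^{‖z‖·S₀}` (from `e^t − 1 ≤ t·e^t`, `t ≥ 0`) — the source of the VERTEX WEIGHT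
of §3. [folklore] -/
theorem norm_partFn_sub_one_le_mul [IsProbabilityMeasure μ] {S : Ω → ℝ} (hS : Measurable S) {S₀ : ℝ}
    (hS₀ : ∀ x, |S x| ≤ S₀) (z : ℂ) : ‖partFn μ S z - 1‖ ≤ ‖z‖ * S₀ * Real.exp (‖z‖ * S₀) := by
  refine (norm_partFn_sub_one_le μ hS hS₀ z).trans ?_
  have hpos := Real.exp_pos (‖z‖ * S₀)
  have h := Real.one_sub_le_exp_neg (‖z‖ * S₀)
  rw [Real.exp_neg] at h
  have h1 : (1 - ‖z‖ * S₀) * Real.exp (‖z‖ * S₀) ≤ 1 := by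
    have := mul_le_mul_of_nonneg_right h hpos.le
    rwa [inv_mul_cancel₀ hpos.ne'] at this
  have h2 : Real.exp (‖z‖ * S₀) - 1 - ‖z‖ * S₀ * Real.exp (‖z‖ * S₀)
      = (1 - ‖z‖ * S₀) * Real.exp (‖z‖ * S₀) - 1 := by ring
  linarith [h1, h2]

/-- The REAL partition function `Z(s) = ∫ e^{−s·S} dμ`, `s ∈ ℝ`. [folklore] -/
def partFnR (S : Ω → ℝ) (s : ℝ) : ℝ := ∫ x, Real.exp (-(s * S x)) ∂μ

/-- At real couplings `Z` is the real partition function. [folklore] -/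
theorem partFn_ofReal (S : Ω → ℝ) (s : ℝ) : partFn μ S (s : ℂ) = (partFnR μ S s : ℂ) := by
  rw [partFn, partFnR, ← integral_complex_ofReal]
  congr 1
  funext x
  push_cast
  rfl

/-- The real Boltzmann factor is integrable. [folklore] -/
theorem integrable_expActionR [IsFiniteMeasure μ] {S : Ω → ℝ} (hS : Measurable S) {S₀ : ℝ} (hS₀ : ∀ x, |S x| ≤ S₀)
    (s : ℝ) : Integrable (fun x => Real.exp (-(s * S x))) μ := by
  refine Integrable.mono' (integrable_const (Real.exp (|s| * S₀))) ?_ (Filter.Eventually.of_forall fun x => ?_)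
  · have hc : Continuous fun a : ℝ => Real.exp (-(s * a)) := by fun_prop
    exact (hc.measurable.comp hS).aestronglyMeasurable
  · rw [Real.norm_eq_abs, abs_of_pos (Real.exp_pos _)]
    refine Real.exp_le_exp.2 ?_
    have h1 : -(s * S x) ≤ |s| * |S x| := by rw [← abs_mul]; exact neg_le_abs _
    exact h1.trans (mul_le_mul_of_nonneg_left (hS₀ x) (abs_nonneg _))

/-- The real partition function is POSITIVE (probability measure). [folklore] -/
theorem partFnR_pos [IsProbabilityMeasure μ] {S : Ω → ℝ} (hS : Measurable S) {S₀ : ℝ} (hS₀ : ∀ x, |S x| ≤ S₀)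
    (s : ℝ) : 0 < partFnR μ S s :=
  integral_exp_pos (integrable_expActionR μ hS hS₀ s)

end PartFn

/-! ## §2  The log layer: `E = log Z` is HOLOMORPHIC on `‖z‖·S₀ < π/2` (where `Re Z > 0`), with `E(0) = 0` -/

section LogLayer

variable {Ω : Type*} [MeasurableSpace Ω] {μ : Measure Ω}

/-- THE MODEL ACTIVITY `E(z) = log Z(z)` (principal branch). [folklore] -/
def logPartFn (μ : Measure Ω) (S : Ω → ℝ) (z : ℂ) : ℂ := Complex.log (partFn μ S z)

/-- NORMALISATION AT THE VERTEX: `E(0) = 0` (the structure of the printed remark before (2.14): the exponent of (2.13)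
vanishes at zero coupling; here up to the coupling-free additive constant removed by normalising `μ`). [folklore] -/
theorem logPartFn_zero [IsProbabilityMeasure μ] (S : Ω → ℝ) : logPartFn μ S 0 = 0 := by
  simp [logPartFn, partFn_zero]

/-- The HOLOMORPHY DOMAIN of the log layer: `‖z‖·S₀ < π/2`. [folklore] -/
def holDom (S₀ : ℝ) : Set ℂ := {z | ‖z‖ * S₀ < Real.pi / 2}

/-- The BOUND DOMAIN: `‖z‖·S₀ < log(3/2)` (there `‖Z − 1‖ < 1/2`). [folklore] -/
def bndDom (S₀ : ℝ) : Set ℂ := {z | ‖z‖ * S₀ < Real.log (3 / 2)}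

/-- Membership in the holomorphy domain. [folklore] -/
theorem mem_holDom {S₀ : ℝ} {z : ℂ} : z ∈ holDom S₀ ↔ ‖z‖ * S₀ < Real.pi / 2 := Iff.rfl

/-- Membership in the bound domain. [folklore] -/
theorem mem_bndDom {S₀ : ℝ} {z : ℂ} : z ∈ bndDom S₀ ↔ ‖z‖ * S₀ < Real.log (3 / 2) := Iff.rfl

/-- The holomorphy domain is open. [folklore] -/
theorem isOpen_holDom (S₀ : ℝ) : IsOpen (holDom S₀) :=
  isOpen_lt (continuous_norm.mul continuous_const) continuous_const

/-- The bound domain is open. [folklore] -/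
theorem isOpen_bndDom (S₀ : ℝ) : IsOpen (bndDom S₀) :=
  isOpen_lt (continuous_norm.mul continuous_const) continuous_const

/-- `log(3/2) < 1/2 < π/2`. [folklore] -/
theorem log_three_halves_lt_pi_div_two : Real.log (3 / 2) < Real.pi / 2 := by
  have h1 : Real.log (3 / 2) < 3 / 2 - 1 := Real.log_lt_sub_one_of_pos (by norm_num) (by norm_num)
  linarith [Real.pi_gt_three]

/-- The bound domain lies in the holomorphy domain. [folklore] -/
theorem bndDom_subset_holDom (S₀ : ℝ) : bndDom S₀ ⊆ holDom S₀ :=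
  fun _ hz => lt_trans hz log_three_halves_lt_pi_div_two

/-- The vertex lies in the bound domain. [folklore] -/
theorem zero_mem_bndDom (S₀ : ℝ) : (0 : ℂ) ∈ bndDom S₀ := by
  rw [mem_bndDom, norm_zero, zero_mul]
  exact Real.log_pos (by norm_num)

/-- **`Re Z(z) > 0` on `‖z‖·S₀ < π/2`**: the integrand `e^{−z·S(x)}` has argument `|Im(z·S(x))| ≤ ‖z‖·S₀ < π/2`, hence
positive real part, and `μ` is a probability measure. [folklore] -/
theorem re_partFn_pos [IsProbabilityMeasure μ] {S : Ω → ℝ} (hS : Measurable S) {S₀ : ℝ} (hS₀ : ∀ x, |S x| ≤ S₀)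
    {z : ℂ} (hz : ‖z‖ * S₀ < Real.pi / 2) : 0 < (partFn μ S z).re := by
  have hint := integrable_expAction μ hS hS₀ z
  have hre : (partFn μ S z).re = ∫ x, (cexp (-(z * S x))).re ∂μ := by
    rw [partFn]
    simpa using (integral_re hint).symm
  have hpt : ∀ x, 0 < (cexp (-(z * S x))).re := by
    intro x
    rw [Complex.exp_re]
    have h1 : |(-(z * (S x : ℂ))).im| ≤ ‖z‖ * S₀ := by
      refine (Complex.abs_im_le_norm _).trans ?_
      rw [norm_neg, norm_mul, Complex.norm_real, Real.norm_eq_abs]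
      exact mul_le_mul_of_nonneg_left (hS₀ x) (norm_nonneg _)
    obtain ⟨hl, hu⟩ := abs_le.1 h1
    exact mul_pos (Real.exp_pos _) (Real.cos_pos_of_mem_Ioo ⟨by linarith, by linarith⟩)
  rw [hre, integral_pos_iff_support_of_nonneg (fun x => (hpt x).le) (by simpa using hint.re)]
  have hsupp : Function.support (fun x => (cexp (-(z * S x))).re) = univ := by
    ext x
    simp [(hpt x).ne']
  rw [hsupp, measure_univ]
  exact one_pos

/-- `Z(z)` lies in the slit plane on the holomorphy domain. [folklore] -/
theorem partFn_mem_slitPlane [IsProbabilityMeasure μ] {S : Ω → ℝ} (hS : Measurable S) {S₀ : ℝ}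
    (hS₀ : ∀ x, |S x| ≤ S₀) {z : ℂ} (hz : ‖z‖ * S₀ < Real.pi / 2) : partFn μ S z ∈ slitPlane :=
  Complex.mem_slitPlane_iff.2 (Or.inl (re_partFn_pos hS hS₀ hz))

/-- `Z(z) ≠ 0` on the holomorphy domain (no Lee–Yang zero inside `‖z‖·S₀ < π/2`). [folklore] -/
theorem partFn_ne_zero [IsProbabilityMeasure μ] {S : Ω → ℝ} (hS : Measurable S) {S₀ : ℝ}
    (hS₀ : ∀ x, |S x| ≤ S₀) {z : ℂ} (hz : ‖z‖ * S₀ < Real.pi / 2) : partFn μ S z ≠ 0 :=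
  Complex.slitPlane_ne_zero (partFn_mem_slitPlane hS hS₀ hz)

/-- **HOLOMORPHY OF THE LOG LAYER**: `E = log Z` is holomorphic on `‖z‖·S₀ < π/2` (Mathlib `DifferentiableOn.clog`).
[folklore] -/
theorem differentiableOn_logPartFn [IsProbabilityMeasure μ] {S : Ω → ℝ} (hS : Measurable S) {S₀ : ℝ}
    (hS₀ : ∀ x, |S x| ≤ S₀) : DifferentiableOn ℂ (logPartFn μ S) (holDom S₀) :=
  (differentiable_partFn μ hS hS₀).differentiableOn.clog fun _ hz => partFn_mem_slitPlane hS hS₀ hz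

/-- `exp E = Z` on the holomorphy domain. [folklore] -/
theorem exp_logPartFn [IsProbabilityMeasure μ] {S : Ω → ℝ} (hS : Measurable S) {S₀ : ℝ} (hS₀ : ∀ x, |S x| ≤ S₀)
    {z : ℂ} (hz : ‖z‖ * S₀ < Real.pi / 2) : cexp (logPartFn μ S z) = partFn μ S z :=
  Complex.exp_log (partFn_ne_zero hS hS₀ hz)

/-- At REAL couplings the activity is the real logarithm of the real partition function. [folklore] -/
theorem logPartFn_ofReal [IsProbabilityMeasure μ] {S : Ω → ℝ} (hS : Measurable S) {S₀ : ℝ} (hS₀ : ∀ x, |S x| ≤ S₀)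
    (s : ℝ) : logPartFn μ S (s : ℂ) = (Real.log (partFnR μ S s) : ℂ) := by
  rw [logPartFn, partFn_ofReal, Complex.ofReal_log (partFnR_pos μ hS hS₀ s).le]

end LogLayer

/-! ## §3  Bounds on `‖z‖·S₀ ≤ log(3/2)`: `‖Z − 1‖ ≤ 1/2`, `‖E‖ ≤ (3/2)‖Z − 1‖ ≤ 3/4`, and the VERTEX WEIGHT
`‖E(z)‖ ≤ (9/4)·S₀·‖z‖` -/

section Bounds

variable {Ω : Type*} [MeasurableSpace Ω] {μ : Measure Ω} [IsProbabilityMeasure μ] {S : Ω → ℝ} {S₀ : ℝ}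

/-- `e^{‖z‖S₀} ≤ 3/2` on the closed bound region. [folklore] -/
theorem exp_le_three_halves_of_le {z : ℂ} (hz : ‖z‖ * S₀ ≤ Real.log (3 / 2)) : Real.exp (‖z‖ * S₀) ≤ 3 / 2 :=
  calc Real.exp (‖z‖ * S₀) ≤ Real.exp (Real.log (3 / 2)) := Real.exp_le_exp.2 hz
    _ = 3 / 2 := Real.exp_log (by norm_num)

/-- `‖Z(z) − 1‖ ≤ 1/2` for `‖z‖·S₀ ≤ log(3/2)`. [folklore] -/
theorem norm_partFn_sub_one_le_half (hS : Measurable S) (hS₀ : ∀ x, |S x| ≤ S₀) {z : ℂ}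
    (hz : ‖z‖ * S₀ ≤ Real.log (3 / 2)) : ‖partFn μ S z - 1‖ ≤ 1 / 2 := by
  have := norm_partFn_sub_one_le μ hS hS₀ z
  linarith [exp_le_three_halves_of_le hz]

/-- **THE LOG LAYER COSTS A FACTOR 3/2**: `‖E(z)‖ ≤ (3/2)·‖Z(z) − 1‖` for `‖z‖·S₀ ≤ log(3/2)` (Mathlib
`Complex.norm_log_one_add_half_le_self`). [folklore] -/
theorem norm_logPartFn_le (hS : Measurable S) (hS₀ : ∀ x, |S x| ≤ S₀) {z : ℂ} (hz : ‖z‖ * S₀ ≤ Real.log (3 / 2)) :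
    ‖logPartFn μ S z‖ ≤ 3 / 2 * ‖partFn μ S z - 1‖ := by
  have h := Complex.norm_log_one_add_half_le_self (norm_partFn_sub_one_le_half (μ := μ) hS hS₀ hz)
  rwa [add_sub_cancel] at h

/-- `‖E(z)‖ ≤ (3/2)(e^{‖z‖S₀} − 1)` for `‖z‖·S₀ ≤ log(3/2)`. [folklore] -/
theorem norm_logPartFn_le_exp (hS : Measurable S) (hS₀ : ∀ x, |S x| ≤ S₀) {z : ℂ}
    (hz : ‖z‖ * S₀ ≤ Real.log (3 / 2)) : ‖logPartFn μ S z‖ ≤ 3 / 2 * (Real.exp (‖z‖ * S₀) - 1) :=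
  (norm_logPartFn_le hS hS₀ hz).trans
    (mul_le_mul_of_nonneg_left (norm_partFn_sub_one_le μ hS hS₀ z) (by norm_num))

/-- UNIFORM BOUND `‖E(z)‖ ≤ 3/4` on `‖z‖·S₀ ≤ log(3/2)`. [folklore] -/
theorem norm_logPartFn_le_three_quarters (hS : Measurable S) (hS₀ : ∀ x, |S x| ≤ S₀) {z : ℂ}
    (hz : ‖z‖ * S₀ ≤ Real.log (3 / 2)) : ‖logPartFn μ S z‖ ≤ 3 / 4 := by
  have h1 := norm_logPartFn_le (μ := μ) hS hS₀ hz
  have h2 := norm_partFn_sub_one_le_half (μ := μ) hS hS₀ hz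
  linarith

/-- **THE VERTEX WEIGHT** (LINEAR vanishing of the activity at zero coupling, with constant PROPORTIONAL TO THE ACTION
BOUND): `‖E(z)‖ ≤ (9/4)·S₀·‖z‖` for `‖z‖·S₀ ≤ log(3/2)`.  This is the `w(s) = s` weight of
`T4CouplingAnalyticity.CouplingAnalyticRelW` / the `M₁·s` bound of `stepTransfer_of_analyticOnW`, here DERIVED from the
normalisation `Z(0) = 1` — not assumed. [folklore] -/
theorem norm_logPartFn_le_weight (hS : Measurable S) (hS₀ : ∀ x, |S x| ≤ S₀) {z : ℂ}
    (hz : ‖z‖ * S₀ ≤ Real.log (3 / 2)) : ‖logPartFn μ S z‖ ≤ 9 / 4 * S₀ * ‖z‖ := by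
  have h0 : 0 ≤ ‖z‖ * S₀ := mul_nonneg (norm_nonneg _) (actionBound_nonneg μ hS₀)
  have h1 := norm_logPartFn_le (μ := μ) hS hS₀ hz
  have h2 := norm_partFn_sub_one_le_mul μ hS hS₀ z
  have h3 : ‖z‖ * S₀ * Real.exp (‖z‖ * S₀) ≤ ‖z‖ * S₀ * (3 / 2) :=
    mul_le_mul_of_nonneg_left (exp_le_three_halves_of_le hz) h0
  calc ‖logPartFn μ S z‖ ≤ 3 / 2 * ‖partFn μ S z - 1‖ := h1
    _ ≤ 3 / 2 * (‖z‖ * S₀ * (3 / 2)) := mul_le_mul_of_nonneg_left (h2.trans h3) (by norm_num)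
    _ = 9 / 4 * S₀ * ‖z‖ := by ring

/-- **THE VERTEX WEIGHT BY THE SCHWARZ LEMMA** (sharper constant): on the disc `‖z‖ < R` with `R·S₀ ≤ p ≤ log(3/2)`,
`E(0) = 0` and `‖E‖ ≤ (3/2)(e^p − 1)` give `‖E(z)‖ ≤ ((3/2)(e^p − 1)/R)·‖z‖` (Mathlib
`Complex.dist_le_div_mul_dist_of_mapsTo_ball`). [folklore] -/
theorem norm_logPartFn_le_schwarz (hS : Measurable S) (hS₀ : ∀ x, |S x| ≤ S₀) {R p : ℝ} (hRp : R * S₀ ≤ p)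
    (hp : p ≤ Real.log (3 / 2)) {z : ℂ} (hz : ‖z‖ < R) :
    ‖logPartFn μ S z‖ ≤ 3 / 2 * (Real.exp p - 1) / R * ‖z‖ := by
  have hS0 : 0 ≤ S₀ := actionBound_nonneg μ hS₀
  have hball : ∀ w : ℂ, ‖w‖ < R → ‖w‖ * S₀ ≤ p := fun w hw =>
    (mul_le_mul_of_nonneg_right hw.le hS0).trans hRp
  have hd : DifferentiableOn ℂ (logPartFn μ S) (ball (0 : ℂ) R) := by
    refine (differentiableOn_logPartFn hS hS₀).mono fun w hw => ?_
    rw [mem_ball_zero_iff] at hw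
    exact lt_of_le_of_lt ((hball w hw).trans hp) log_three_halves_lt_pi_div_two
  have hmaps : MapsTo (logPartFn μ S) (ball (0 : ℂ) R) (closedBall (logPartFn μ S 0) (3 / 2 * (Real.exp p - 1))) := by
    intro w hw
    rw [mem_ball_zero_iff] at hw
    rw [mem_closedBall, logPartFn_zero, dist_zero_right]
    refine (norm_logPartFn_le_exp hS hS₀ ((hball w hw).trans hp)).trans ?_
    exact mul_le_mul_of_nonneg_left (by linarith [Real.exp_le_exp.2 (hball w hw)]) (by norm_num)
  have key := Complex.dist_le_div_mul_dist_of_mapsTo_ball hd hmaps (mem_ball_zero_iff.2 hz)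
  rwa [logPartFn_zero, dist_zero_right, dist_zero_right] at key

end Bounds

/-! ## §4  CURRENCY: the log-layer model inhabits the lineage's hypothesis shapes BY NAME — FULL coupling discs about the
window `]0, γ]` INCLUDING THE VERTEX (`CouplingAnalyticOn` ⇒ the g-form of NE9 with bounded moduli), and the weighted
relative-disc step shape (`stepTransfer_of_analyticOnW`) -/

section Currency

variable {Ω : Type*} [MeasurableSpace Ω] (C : Carriers) (Bg : Type)

/-- THE LOG-LAYER MODEL FUNCTIONAL on the carriers: on domains of positive scale `j`,
`e^{−κ d(X)} · log Z(g_{j−1})` — the activity of the step reads its OWN (last) coupling through the log layer; `0` on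
scale-0 domains. [folklore] -/
def logModel (κ : ℝ) (μ : Measure Ω) (S : Ω → ℝ) : Functional C Bg :=
  fun g _ X => if 0 < C.scale X then Real.exp (-(κ * C.d X)) * Real.log (partFnR μ S (g (C.scale X - 1))) else 0

/-- The model is prefix-dependent on any window. [folklore] -/
theorem logModel_prefix (κ : ℝ) (μ : Measure Ω) (S : Ω → ℝ) (W : Set (ℕ → ℝ)) :
    PrefixDependenceOn (logModel C Bg κ μ S) W := by
  intro g _ g' _ U X hagree
  by_cases hX : 0 < C.scale X
  · simp only [logModel, if_pos hX, hagree (C.scale X - 1) (Nat.sub_lt hX one_pos)]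
  · simp only [logModel, if_neg hX]

variable {C Bg}

/-- The model at a history, complexified: `e^{−κd(X)} · E(g_{j−1})` on positive scale. [folklore] -/
theorem logModel_ofReal {μ : Measure Ω} [IsProbabilityMeasure μ] {S : Ω → ℝ} (hS : Measurable S) {S₀ : ℝ}
    (hS₀ : ∀ x, |S x| ≤ S₀) (κ : ℝ) (g : ℕ → ℝ) (U : Bg) {X : C.Dom} (hX : 0 < C.scale X) :
    (logModel C Bg κ μ S g U X : ℂ) = (Real.exp (-(κ * C.d X)) : ℂ) * logPartFn μ S (g (C.scale X - 1) : ℝ) := by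
  rw [logPartFn_ofReal hS hS₀]
  simp only [logModel, if_pos hX]
  push_cast
  rfl

/-- The model obeys the PRINTED decay shape (1.18) with `E₀ = 3/4` on the window `]0, γ]`, `γ·S₀ ≤ log(3/2)`. [folklore] -/
theorem logModel_decay {μ : Measure Ω} [IsProbabilityMeasure μ] {S : Ω → ℝ} (hS : Measurable S) {S₀ : ℝ}
    (hS₀ : ∀ x, |S x| ≤ S₀) (κ : ℝ) {γ : ℝ} (hγ : γ * S₀ ≤ Real.log (3 / 2)) :
    DecayBound (logModel C Bg κ μ S) (Window γ) (3 / 4) κ := by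
  intro g hg U X
  by_cases hX : 0 < C.scale X
  · have hs := hg (C.scale X - 1)
    have hzs : ‖((g (C.scale X - 1) : ℝ) : ℂ)‖ * S₀ ≤ Real.log (3 / 2) := by
      rw [Complex.norm_real, Real.norm_eq_abs, abs_of_pos hs.1]
      exact (mul_le_mul_of_nonneg_right hs.2 (actionBound_nonneg μ hS₀)).trans hγ
    have h := norm_logPartFn_le_three_quarters (μ := μ) hS hS₀ hzs
    have hnorm : |logModel C Bg κ μ S g U X| = Real.exp (-(κ * C.d X)) * ‖logPartFn μ S (g (C.scale X - 1) : ℝ)‖ := by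
      rw [← Real.norm_eq_abs, ← Complex.norm_real, logModel_ofReal hS hS₀ κ g U hX, norm_mul, Complex.norm_real,
        Real.norm_eq_abs, abs_of_pos (Real.exp_pos _)]
    rw [hnorm, mul_comm]
    exact mul_le_mul_of_nonneg_right h (Real.exp_pos _).le
  · simp only [logModel, if_neg hX, abs_zero]
    positivity

/-- **FULL COUPLING DISCS ABOUT `]0, γ]`, UNIFORM RADIUS, INCLUDING THE VERTEX**: with `(γ + r)·S₀ < log(3/2)` the model
satisfies `CouplingAnalyticOn ]0, γ]` with the constant radius `r` and bound `3/4` — the analytic branch of the printed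
dichotomy (p. 263 *"(or analytic)"*, p. 266 alternative cut-off) in the lineage's currency.  (The binder `hr : 0 < r` is not
used by the proof — for `r ≤ 0` the discs degenerate and the shape holds trivially — and is kept for by-name stability of the
landed signature; XREAD C-adv8-78 INFO I2.) [folklore] -/
theorem logModel_couplingAnalyticOn {μ : Measure Ω} [IsProbabilityMeasure μ] {S : Ω → ℝ} (hS : Measurable S)
    {S₀ : ℝ} (hS₀ : ∀ x, |S x| ≤ S₀) (κ : ℝ) {γ r : ℝ} (hr : 0 < r) (hγr : (γ + r) * S₀ < Real.log (3 / 2)) :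
    CouplingAnalyticOn (Set.Ioc 0 γ) (logModel C Bg κ μ S) κ (3 / 4) (fun _ _ => r) := by
  have hS0 : 0 ≤ S₀ := actionBound_nonneg μ hS₀
  intro U X h hh i hi
  have hX : 0 < C.scale X := lt_of_le_of_lt (Nat.zero_le i) hi
  by_cases hlast : i = C.scale X - 1
  · subst hlast
    refine ⟨fun z => (Real.exp (-(κ * C.d X)) : ℂ) * logPartFn μ S z, bndDom S₀, ?_, ?_, ?_, ?_⟩
    · exact (differentiableOn_const _).mul ((differentiableOn_logPartFn hS hS₀).mono (bndDom_subset_holDom S₀))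
    · intro z hz
      rw [norm_mul, Complex.norm_real, Real.norm_eq_abs, abs_of_pos (Real.exp_pos _), mul_comm]
      exact mul_le_mul_of_nonneg_right (norm_logPartFn_le_three_quarters hS hS₀ (le_of_lt hz)) (Real.exp_pos _).le
    · intro s hs z hz
      rw [mem_bndDom]
      rw [mem_closedBall, dist_eq_norm] at hz
      have hzn : ‖z‖ ≤ γ + r := by
        calc ‖z‖ = ‖(z - s) + s‖ := by rw [sub_add_cancel]
          _ ≤ ‖z - (s : ℂ)‖ + ‖(s : ℂ)‖ := norm_add_le _ _
          _ ≤ r + γ := by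
              rw [Complex.norm_real, Real.norm_eq_abs, abs_of_pos hs.1]
              exact add_le_add hz hs.2
          _ = γ + r := add_comm _ _
      exact lt_of_le_of_lt (mul_le_mul_of_nonneg_right hzn hS0) hγr
    · intro s hs
      rw [logModel_ofReal hS hS₀ κ _ U hX, Function.update_self]
  · refine ⟨fun _ => (logModel C Bg κ μ S h U X : ℂ), univ, differentiableOn_const _, ?_, fun _ _ => subset_univ _, ?_⟩
    · intro z _
      have hγ : γ * S₀ ≤ Real.log (3 / 2) := by
        have : γ * S₀ ≤ (γ + r) * S₀ := mul_le_mul_of_nonneg_right (by linarith) hS0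
        exact this.trans hγr.le
      have hdec := logModel_decay (μ := μ) hS hS₀ κ hγ h hh U X
      rwa [Complex.norm_real, Real.norm_eq_abs]
    · intro s hs
      have hne : C.scale X - 1 ≠ i := fun h' => hlast h'.symm
      simp only [logModel, if_pos hX, Function.update_of_ne hne]

/-- **THE g-FORM OF NE9 WITH BOUNDED MODULI FOR THE LOG-LAYER MODEL, BY NAME** (`ne9_of_couplingAnalyticOn` of the lineage,
uniform radius `r`, moduli `4·(3/4)/r = 3/r`): full discs including the vertex give what UNWEIGHTED relative discs cannot
(`T4CouplingAnalyticity.vertexModel_not_ne9`). [folklore] -/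
theorem ne9_logModel {μ : Measure Ω} [IsProbabilityMeasure μ] {S : Ω → ℝ} (hS : Measurable S) {S₀ : ℝ}
    (hS₀ : ∀ x, |S x| ≤ S₀) (κ : ℝ) {γ r : ℝ} (hr : 0 < r) (hγr : (γ + r) * S₀ < Real.log (3 / 2)) :
    NE9 (logModel C Bg κ μ S) (Window γ) κ (fun _ _ => 4 * (3 / 4) / r) := by
  rw [window_eq_boxWindow]
  exact ne9_of_couplingAnalyticOn Set.ordConnected_Ioc (fun _ _ _ => hr) (logModel_prefix C Bg κ μ S _)
    (logModel_couplingAnalyticOn hS hS₀ κ hr hγr)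

/-- THE MEMORYLESS LOG-LAYER HIERARCHY: `V 0 = 0`, `V (j+1) g = E(g_j)` — each step's activity is the log layer at the
step's own coupling; old data ignored. [folklore] -/
def logModelV (μ : Measure Ω) (S : Ω → ℝ) : ℕ → (ℕ → ℝ) → ℂ
  | 0, _ => 0
  | j + 1, g => logPartFn μ S (g j : ℂ)

/-- **`hlast` OF `stepTransfer_of_analyticOnW` INHABITED BY THE LOG LAYER, BY NAME** (relative discs `|z − s| ≤ c·s` about
the g-window `]0, γ]`, LINEARLY WEIGHTED bound `M₁·s` with `M₁ = (9/4)·S₀·(1 + c)` from the vertex weight, `(1 + c)γ·S₀ ≤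
log(3/2)`; old data `T ≡ 0`, `ϱ = 1`, `ω₀ = 0`, `M₂ = 3/4`): `StepTransfer` for the memoryless log-layer hierarchy with
last-coupling constant `8M₁/min(c,1)` — PROPORTIONAL TO THE ACTION BOUND `S₀`. [folklore] -/
theorem stepTransfer_logModelV_weighted {μ : Measure Ω} [IsProbabilityMeasure μ] {S : Ω → ℝ} (hS : Measurable S)
    {S₀ : ℝ} (hS₀ : ∀ x, |S x| ≤ S₀) {γ c : ℝ} (hc : 0 < c) (hγc : (1 + c) * γ * S₀ ≤ Real.log (3 / 2)) :
    StepTransfer (logModelV μ S) (Window γ) (8 * (9 / 4 * S₀ * (1 + c)) / min c 1) (4 * (3 / 4) / 1) 0 := by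
  have hS0 : 0 ≤ S₀ := actionBound_nonneg μ hS₀
  have hdisc : ∀ s ∈ Set.Ioc (0 : ℝ) γ, ∀ z ∈ closedBall (s : ℂ) (c * s), ‖z‖ ≤ (1 + c) * s := by
    intro s hs z hz
    rw [mem_closedBall, dist_eq_norm] at hz
    calc ‖z‖ = ‖(z - s) + s‖ := by rw [sub_add_cancel]
      _ ≤ ‖z - (s : ℂ)‖ + ‖(s : ℂ)‖ := norm_add_le _ _
      _ ≤ c * s + s := by
          rw [Complex.norm_real, Real.norm_eq_abs, abs_of_pos hs.1]
          exact add_le_add hz le_rfl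
      _ = (1 + c) * s := by ring
  have hreg : ∀ s ∈ Set.Ioc (0 : ℝ) γ, ∀ z ∈ closedBall (s : ℂ) (c * s), ‖z‖ * S₀ ≤ Real.log (3 / 2) := by
    intro s hs z hz
    have h1 : ‖z‖ * S₀ ≤ (1 + c) * s * S₀ := mul_le_mul_of_nonneg_right (hdisc s hs z hz) hS0
    have h2 : (1 + c) * s * S₀ ≤ (1 + c) * γ * S₀ :=
      mul_le_mul_of_nonneg_right (mul_le_mul_of_nonneg_left hs.2 (by linarith)) hS0
    exact h1.trans (h2.trans hγc)
  have hγ : ∀ s ∈ Set.Ioc (0 : ℝ) γ, ‖(s : ℂ)‖ * S₀ ≤ Real.log (3 / 2) := fun s hs =>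
    hreg s hs s (mem_closedBall_self (mul_nonneg hc.le hs.1.le))
  rw [window_eq_boxWindow]
  refine stepTransfer_of_analyticOnW (V := logModelV μ S) (I := Set.Ioc 0 γ) Set.ordConnected_Ioc (fun _ hs => hs.1)
    (fun _ _ => (0 : ℂ)) (fun _ z _ => logPartFn μ S z) hc one_pos ?_ ?_ ?_ ?_
  · intro j g _
    rfl
  · intro j g _
    refine ⟨holDom S₀, differentiableOn_logPartFn hS hS₀, fun s hs z hz => ?_, fun s hs z hz => ?_⟩
    · exact lt_of_le_of_lt (hreg s hs z hz) log_three_halves_lt_pi_div_two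
    · calc ‖logPartFn μ S z‖ ≤ 9 / 4 * S₀ * ‖z‖ := norm_logPartFn_le_weight hS hS₀ (hreg s hs z hz)
        _ ≤ 9 / 4 * S₀ * ((1 + c) * s) := mul_le_mul_of_nonneg_left (hdisc s hs z hz) (by positivity)
        _ = 9 / 4 * S₀ * (1 + c) * s := by ring
  · intro j s hs
    exact ⟨univ, differentiableOn_const _, fun w _ => norm_logPartFn_le_three_quarters hS hS₀ (hγ s hs),
      fun g _ => subset_univ _⟩
  · intro j g _ g' _
    simp only [sub_self, norm_zero]
    exact Finset.sum_nonneg fun m _ => mul_nonneg (pow_nonneg le_rfl _) (norm_nonneg _)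

/-- **`hlast` OF `stepTransfer_of_analyticOn` WITH A UNIFORM RADIUS DOWN TO THE VERTEX, BY NAME** (full discs of radius `r`
about `]0, γ]`, `(γ + r)·S₀ ≤ log(3/2)`, bound `M₁ = 3/4`): `StepTransfer` for the memoryless log-layer hierarchy with
last-coupling constant `4·(3/4)/r`. [folklore] -/
theorem stepTransfer_logModelV_full {μ : Measure Ω} [IsProbabilityMeasure μ] {S : Ω → ℝ} (hS : Measurable S)
    {S₀ : ℝ} (hS₀ : ∀ x, |S x| ≤ S₀) {γ r : ℝ} (hr : 0 < r) (hγr : (γ + r) * S₀ ≤ Real.log (3 / 2)) :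
    StepTransfer (logModelV μ S) (Window γ) (4 * (3 / 4) / r) (4 * (3 / 4) / 1) 0 := by
  have hS0 : 0 ≤ S₀ := actionBound_nonneg μ hS₀
  have hreg : ∀ s ∈ Set.Ioc (0 : ℝ) γ, ∀ z ∈ closedBall (s : ℂ) r, ‖z‖ * S₀ ≤ Real.log (3 / 2) := by
    intro s hs z hz
    rw [mem_closedBall, dist_eq_norm] at hz
    have hzn : ‖z‖ ≤ γ + r := by
      calc ‖z‖ = ‖(z - s) + s‖ := by rw [sub_add_cancel]
        _ ≤ ‖z - (s : ℂ)‖ + ‖(s : ℂ)‖ := norm_add_le _ _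
        _ ≤ r + γ := by
            rw [Complex.norm_real, Real.norm_eq_abs, abs_of_pos hs.1]
            exact add_le_add hz hs.2
        _ = γ + r := add_comm _ _
    exact (mul_le_mul_of_nonneg_right hzn hS0).trans hγr
  have hγ : ∀ s ∈ Set.Ioc (0 : ℝ) γ, ‖(s : ℂ)‖ * S₀ ≤ Real.log (3 / 2) := fun s hs =>
    hreg s hs s (mem_closedBall_self hr.le)
  rw [window_eq_boxWindow]
  refine stepTransfer_of_analyticOn (V := logModelV μ S) (I := Set.Ioc 0 γ) Set.ordConnected_Ioc (fun _ _ => (0 : ℂ))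
    (fun _ z _ => logPartFn μ S z) (fun _ => r) hr (fun _ _ => le_rfl) one_pos ?_ ?_ ?_ ?_
  · intro j g _
    rfl
  · intro j g _
    refine ⟨{z | ‖z‖ * S₀ ≤ Real.log (3 / 2)} ∩ holDom S₀,
      (differentiableOn_logPartFn hS hS₀).mono inter_subset_right,
      fun z hz => norm_logPartFn_le_three_quarters hS hS₀ hz.1, fun s hs z hz => ?_⟩
    exact ⟨hreg s hs z hz, lt_of_le_of_lt (hreg s hs z hz) log_three_halves_lt_pi_div_two⟩
  · intro j s hs
    exact ⟨univ, differentiableOn_const _, fun w _ => norm_logPartFn_le_three_quarters hS hS₀ (hγ s hs),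
      fun g _ => subset_univ _⟩
  · intro j g _ g' _
    simp only [sub_self, norm_zero]
    exact Finset.sum_nonneg fun m _ => mul_nonneg (pow_nonneg le_rfl _) (norm_nonneg _)

end Currency

/-! ## §5  SHARPNESS: the holomorphy radius `π/(2S₀)` is ATTAINED by a zero of `Z` (two-point measure, `Z = cosh`), and the
vertex weight is proportional to `S₀` with constant `≥ 1` (one-point measure, `E(z) = −z·S₀`) -/

section Sharpness

/-- The symmetric TWO-POINT probability measure on `Bool`. [folklore] -/
def twoPoint : Measure Bool := (2 : ENNReal)⁻¹ • Measure.dirac true + (2 : ENNReal)⁻¹ • Measure.dirac false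

/-- The two-point measure is a probability measure (`½ + ½ = 1`). [folklore] -/
instance twoPoint_isProbabilityMeasure : IsProbabilityMeasure twoPoint := by
  refine ⟨?_⟩
  simp only [twoPoint, Measure.coe_add, Measure.coe_smul, Pi.add_apply, Pi.smul_apply, measure_univ, smul_eq_mul,
    mul_one]
  exact ENNReal.inv_two_add_inv_two

/-- The two-point action `±S₀`. [folklore] -/
def twoPointAction (S₀ : ℝ) (b : Bool) : ℝ := if b then S₀ else -S₀

/-- The two-point action is bounded by `S₀` (`S₀ ≥ 0`). [folklore] -/
theorem abs_twoPointAction_le {S₀ : ℝ} (hS₀ : 0 ≤ S₀) (b : Bool) : |twoPointAction S₀ b| ≤ S₀ := by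
  cases b <;> simp [twoPointAction, abs_of_nonneg hS₀]

/-- Integration against the two-point measure. [folklore] -/
theorem integral_twoPoint (f : Bool → ℂ) : ∫ b, f b ∂twoPoint = 2⁻¹ * f true + 2⁻¹ * f false := by
  rw [integral_fintype Integrable.of_finite, Fintype.sum_bool]
  simp [measureReal_def, twoPoint]

/-- **`Z = cosh` for the two-point measure**: `Z(z) = (e^{−zS₀} + e^{zS₀})/2 = cosh(z·S₀)`. [folklore] -/
theorem partFn_twoPoint (S₀ : ℝ) (z : ℂ) : partFn twoPoint (twoPointAction S₀) z = Complex.cosh (z * S₀) := by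
  rw [partFn, integral_twoPoint, Complex.cosh]
  simp only [twoPointAction, if_true, Bool.false_eq_true, if_false, Complex.ofReal_neg, mul_neg, neg_neg]
  ring

/-- **A LEE–YANG ZERO ON THE BOUNDARY OF THE HOLOMORPHY DOMAIN**: at `z₀ = iπ/(2S₀)` (`S₀ > 0`) one has `‖z₀‖·S₀ = π/2`
and `Z(z₀) = cosh(iπ/2) = cos(π/2) = 0`.  Hence the radius `π/(2S₀)` of §2 cannot be enlarged at this generality.
[folklore] -/
theorem partFn_twoPoint_zero {S₀ : ℝ} (hS₀ : 0 < S₀) :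
    ‖(I * (Real.pi / (2 * S₀) : ℝ) : ℂ)‖ * S₀ = Real.pi / 2 ∧
      partFn twoPoint (twoPointAction S₀) (I * (Real.pi / (2 * S₀) : ℝ)) = 0 := by
  constructor
  · rw [norm_mul, Complex.norm_I, one_mul, Complex.norm_real, Real.norm_eq_abs, abs_of_pos (by positivity)]
    field_simp
  · rw [partFn_twoPoint]
    have h : (I * (Real.pi / (2 * S₀) : ℝ) : ℂ) * (S₀ : ℂ) = (Real.pi / 2 : ℝ) * I := by
      have hS : (S₀ : ℂ) ≠ 0 := Complex.ofReal_ne_zero.2 hS₀.ne'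
      push_cast
      field_simp
    rw [h, Complex.cosh_mul_I]
    exact_mod_cast Real.cos_pi_div_two

/-- Consequently NO function `L` can serve as a logarithm of `Z` on the CLOSED region `‖z‖·S₀ ≤ π/2` for the two-point
model: `exp (L z₀) = Z(z₀) = 0` is impossible. [folklore] -/
theorem no_log_on_closed_region {S₀ : ℝ} (hS₀ : 0 < S₀) :
    ¬ ∃ L : ℂ → ℂ, ∀ z : ℂ, ‖z‖ * S₀ ≤ Real.pi / 2 → cexp (L z) = partFn twoPoint (twoPointAction S₀) z := by
  rintro ⟨L, hL⟩
  obtain ⟨hnorm, hzero⟩ := partFn_twoPoint_zero hS₀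
  have h := hL _ hnorm.le
  rw [hzero] at h
  exact Complex.exp_ne_zero _ h

/-- **THE ONE-POINT MODEL**: `μ = δ`, constant action `S₀`; `Z(z) = e^{−zS₀}`. [folklore] -/
theorem partFn_onePoint (S₀ : ℝ) (z : ℂ) :
    partFn (Measure.dirac ()) (fun _ : Unit => S₀) z = cexp (-(z * S₀)) := by
  rw [partFn, integral_dirac]

/-- For the one-point model `E(z) = −z·S₀` on the holomorphy domain, so `‖E(z)‖ = S₀·‖z‖`: the vertex weight of §3 is
proportional to `S₀` with the OPTIMAL ORDER (constant `9/4` versus `≥ 1`). [folklore] -/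
theorem logPartFn_onePoint {S₀ : ℝ} (hS₀ : 0 ≤ S₀) {z : ℂ} (hz : ‖z‖ * S₀ < Real.pi / 2) :
    logPartFn (Measure.dirac ()) (fun _ : Unit => S₀) z = -(z * S₀) ∧
      ‖logPartFn (Measure.dirac ()) (fun _ : Unit => S₀) z‖ = S₀ * ‖z‖ := by
  have him : |(-(z * (S₀ : ℂ))).im| < Real.pi := by
    refine lt_of_le_of_lt ((Complex.abs_im_le_norm _).trans ?_) (lt_trans hz ?_)
    · rw [norm_neg, norm_mul, Complex.norm_real, Real.norm_eq_abs, abs_of_nonneg hS₀]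
    · linarith [Real.pi_pos]
  obtain ⟨hl, hu⟩ := abs_lt.1 him
  have hE : logPartFn (Measure.dirac ()) (fun _ : Unit => S₀) z = -(z * S₀) := by
    rw [logPartFn, partFn_onePoint, Complex.log_exp hl hu.le]
  refine ⟨hE, ?_⟩
  rw [hE, norm_neg, norm_mul, Complex.norm_real, Real.norm_eq_abs, abs_of_nonneg hS₀, mul_comm]

end Sharpness

/-! ## §6  Non-vacuity of the currency hypotheses -/

/-- The hypotheses of §4 are met (one-point model with small action: `S₀ = 1/8`, `γ = r = 1`, `(γ + r)·S₀ = 1/4 < log(3/2)`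
since `e^{1/4} < 3/2`). [folklore] -/
theorem shapes_nonvacuous (C : Carriers) (Bg : Type) (κ : ℝ) :
    ∃ (μ : Measure Unit) (_ : IsProbabilityMeasure μ) (S : Unit → ℝ) (S₀ γ r : ℝ),
      Measurable S ∧ (∀ x, |S x| ≤ S₀) ∧ 0 < r ∧ 0 < γ ∧ (γ + r) * S₀ < Real.log (3 / 2) ∧
      NE9 (logModel C Bg κ μ S) (Window γ) κ (fun _ _ => 4 * (3 / 4) / r) := by
  have hlog : (1 + 1) * (1 / 8 : ℝ) < Real.log (3 / 2) := by
    rw [Real.lt_log_iff_exp_lt (by norm_num)]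
    refine (Real.exp_bound_div_one_sub_of_interval' (x := (1 + 1) * (1 / 8 : ℝ)) (by norm_num) (by norm_num)).trans_le ?_
    norm_num
  refine ⟨Measure.dirac (), inferInstance, fun _ => 1 / 8, 1 / 8, 1, 1, measurable_const,
    fun _ => by norm_num, one_pos, one_pos, hlog, ?_⟩
  exact ne9_logModel measurable_const (fun _ => by norm_num) κ one_pos hlog

/-! ## §7 (v1.1, APPEND-ONLY)  ADDITIVITY OVER INDEPENDENT BLOCKS — the logarithm taken AFTER localisation

For finitely many INDEPENDENT blocks — reference measure `Measure.pi μ` on `Π i, Ω i`, total action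
`blockSum S x = ∑ i, S i (x i)` with block bounds `|S i ·| ≤ S₀ i` — the partition function FACTORISES, `Z = ∏ i, Z_i`
(`partFn_pi`, Fubini), so the BLOCKWISE logarithm `blockLog μ S z := ∑ i, log Z_i(z)` is a holomorphic logarithm of `Z`
(`exp_blockLog`, `differentiableOn_blockLog`) on the INTERSECTION of the block regions `⋂ i, {‖z‖·S₀ i < π/2}`, which
contains `{‖z‖·M < π/2}` for any common bound `S₀ i ≤ M` (`holDom_subset_iInter`) — a region governed by the LARGEST single
block and INDEPENDENT OF THE NUMBER OF BLOCKS —, with the EXTENSIVE vertex weight `‖blockLog z‖ ≤ (9/4)·(∑ i, S₀ i)·‖z‖`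
there (`norm_blockLog_le_weight`).  CONTRAST: the a-priori route of §2 applied to the total action, whose bound is the SUM
`∑ i, S₀ i` (`abs_blockSum_le`), certifies the PRINCIPAL logarithm of `Z` only on `‖z‖·(∑ i, S₀ i) < π/2`, a region
shrinking like `1/#blocks` (`differentiableOn_logPartFn_pi_apriori`); the blockwise region is SHARP — a single two-point
block of bound `S₀ i₀` puts a zero of the WHOLE partition function at `‖z‖·S₀ i₀ = π/2`, whatever the other blocks are
(`partFn_pi_twoPoint_zero`); and beyond two blocks the principal logarithm of the total is NOT the blockwise sum: for three
aligned one-point blocks `log Z(z₀) ≠ ∑ i, log Z_i(z₀)` at a point `z₀` of the common region (`logPartFn_pi_ne_blockLog`, the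
imaginary parts differ by `2π`) — the activity of a union of independent units must be DEFINED as the sum of the unit
activities (the polymer logarithm), not as the principal logarithm of the product.  Kernel form of record §15.4 (ii)/(iii),
§16.6 (α′): on the analytic branch the holomorphy radius in the coupling is set by the largest single-unit action bound,
uniformly in the volume, PROVIDED the logarithm is taken unit by unit.  MODEL statement only — Bałaban's localisation is a
cluster expansion, not a product measure; DICTIONARY as in the header; nothing is asserted about the audited series. -/

section Blocks

variable {ι : Type*} [Fintype ι] {Ω : ι → Type*} [∀ i, MeasurableSpace (Ω i)]

/-- Total action of independent blocks, `blockSum S x = ∑ i, S i (x i)`. [folklore] -/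
def blockSum (S : ∀ i, Ω i → ℝ) : (∀ i, Ω i) → ℝ := fun x => ∑ i, S i (x i)

/-- [folklore] -/
theorem measurable_blockSum {S : ∀ i, Ω i → ℝ} (hS : ∀ i, Measurable (S i)) : Measurable (blockSum S) :=
  Finset.measurable_sum (f := fun i (x : ∀ i, Ω i) => S i (x i)) Finset.univ
    fun i _ => (hS i).comp (measurable_pi_apply i)

omit [∀ i, MeasurableSpace (Ω i)] in
/-- The total action is bounded by the SUM of the block bounds (the a-priori bound; attained for aligned blocks).
[folklore] -/
theorem abs_blockSum_le {S : ∀ i, Ω i → ℝ} {S₀ : ι → ℝ} (hS₀ : ∀ i x, |S i x| ≤ S₀ i) (x : ∀ i, Ω i) :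
    |blockSum S x| ≤ ∑ i, S₀ i :=
  (Finset.abs_sum_le_sum_abs _ _).trans (Finset.sum_le_sum fun i _ => hS₀ i (x i))

/-- **FACTORISATION** `Z = ∏ i, Z_i` for independent blocks (Fubini, Mathlib `integral_fintype_prod_eq_prod`). [folklore] -/
theorem partFn_pi (μ : ∀ i, Measure (Ω i)) [∀ i, IsProbabilityMeasure (μ i)] (S : ∀ i, Ω i → ℝ) (z : ℂ) :
    partFn (Measure.pi μ) (blockSum S) z = ∏ i, partFn (μ i) (S i) z := by
  have h : ∀ x : ∀ i, Ω i, cexp (-(z * (blockSum S x : ℂ))) = ∏ i, cexp (-(z * (S i (x i) : ℂ))) := by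
    intro x
    rw [← Complex.exp_sum]
    congr 1
    simp only [blockSum, Complex.ofReal_sum, Finset.mul_sum, Finset.sum_neg_distrib]
  simp only [partFn, h]
  exact integral_fintype_prod_eq_prod (fun i (ω : Ω i) => cexp (-(z * (S i ω : ℂ))))

/-- No zero of the factorised partition function on the INTERSECTION of the block regions. [folklore] -/
theorem partFn_pi_ne_zero (μ : ∀ i, Measure (Ω i)) [∀ i, IsProbabilityMeasure (μ i)] {S : ∀ i, Ω i → ℝ}
    (hS : ∀ i, Measurable (S i)) {S₀ : ι → ℝ} (hS₀ : ∀ i x, |S i x| ≤ S₀ i) {z : ℂ}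
    (hz : ∀ i, ‖z‖ * S₀ i < Real.pi / 2) : partFn (Measure.pi μ) (blockSum S) z ≠ 0 := by
  rw [partFn_pi]
  exact Finset.prod_ne_zero_iff.mpr fun i _ => partFn_ne_zero (hS i) (hS₀ i) (hz i)

/-- The BLOCKWISE logarithm `∑ i, log Z_i` — the logarithm taken AFTER localisation (the polymer logarithm of independent
units). [folklore] -/
def blockLog (μ : ∀ i, Measure (Ω i)) (S : ∀ i, Ω i → ℝ) (z : ℂ) : ℂ := ∑ i, logPartFn (μ i) (S i) z

/-- Normalisation is inherited: `blockLog 0 = 0`. [folklore] -/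
theorem blockLog_zero (μ : ∀ i, Measure (Ω i)) [∀ i, IsProbabilityMeasure (μ i)] (S : ∀ i, Ω i → ℝ) :
    blockLog μ S 0 = 0 := by
  simp [blockLog, logPartFn_zero]

/-- `exp (∑ i, log Z_i) = Z` on the intersection of the block regions: the blockwise sum IS a logarithm of the total
partition function there. [folklore] -/
theorem exp_blockLog (μ : ∀ i, Measure (Ω i)) [∀ i, IsProbabilityMeasure (μ i)] {S : ∀ i, Ω i → ℝ}
    (hS : ∀ i, Measurable (S i)) {S₀ : ι → ℝ} (hS₀ : ∀ i x, |S i x| ≤ S₀ i) {z : ℂ}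
    (hz : ∀ i, ‖z‖ * S₀ i < Real.pi / 2) : cexp (blockLog μ S z) = partFn (Measure.pi μ) (blockSum S) z := by
  rw [blockLog, Complex.exp_sum, partFn_pi]
  exact Finset.prod_congr rfl fun i _ => exp_logPartFn (hS i) (hS₀ i) (hz i)

omit [Fintype ι] in
/-- The common region contains the disc set by the LARGEST block bound: `{‖z‖·M < π/2} ⊆ ⋂ i, {‖z‖·S₀ i < π/2}` whenever
`S₀ i ≤ M` for all `i` — independent of the number of blocks. [folklore] -/
theorem holDom_subset_iInter {S₀ : ι → ℝ} {M : ℝ} (hM : ∀ i, S₀ i ≤ M) : holDom M ⊆ ⋂ i, holDom (S₀ i) := by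
  intro z hz
  refine Set.mem_iInter.mpr fun i => ?_
  rw [mem_holDom] at hz ⊢
  exact lt_of_le_of_lt (mul_le_mul_of_nonneg_left (hM i) (norm_nonneg z)) hz

/-- **HOLOMORPHY OF THE BLOCKWISE LOGARITHM ON THE INTERSECTION OF THE BLOCK REGIONS** (radius = the minimum of the block
radii `π/(2·S₀ i)`, uniform in the number of blocks). [folklore] -/
theorem differentiableOn_blockLog (μ : ∀ i, Measure (Ω i)) [∀ i, IsProbabilityMeasure (μ i)] {S : ∀ i, Ω i → ℝ}
    (hS : ∀ i, Measurable (S i)) {S₀ : ι → ℝ} (hS₀ : ∀ i x, |S i x| ≤ S₀ i) :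
    DifferentiableOn ℂ (blockLog μ S) (⋂ i, holDom (S₀ i)) := by
  have h : blockLog μ S = fun z => ∑ i, logPartFn (μ i) (S i) z := rfl
  rw [h]
  exact DifferentiableOn.fun_sum fun i _ => (differentiableOn_logPartFn (hS i) (hS₀ i)).mono (Set.iInter_subset _ i)

/-- **EXTENSIVE VERTEX WEIGHT ON A VOLUME-INDEPENDENT REGION**: `‖∑ i, log Z_i(z)‖ ≤ (9/4)·(∑ i, S₀ i)·‖z‖` as soon as
`‖z‖·S₀ i ≤ log(3/2)` for EACH block. [folklore] -/
theorem norm_blockLog_le_weight (μ : ∀ i, Measure (Ω i)) [∀ i, IsProbabilityMeasure (μ i)] {S : ∀ i, Ω i → ℝ}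
    (hS : ∀ i, Measurable (S i)) {S₀ : ι → ℝ} (hS₀ : ∀ i x, |S i x| ≤ S₀ i) {z : ℂ}
    (hz : ∀ i, ‖z‖ * S₀ i ≤ Real.log (3 / 2)) : ‖blockLog μ S z‖ ≤ 9 / 4 * (∑ i, S₀ i) * ‖z‖ := by
  calc ‖blockLog μ S z‖ ≤ ∑ i, ‖logPartFn (μ i) (S i) z‖ := norm_sum_le _ _
    _ ≤ ∑ i, 9 / 4 * S₀ i * ‖z‖ := Finset.sum_le_sum fun i _ => norm_logPartFn_le_weight (hS i) (hS₀ i) (hz i)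
    _ = 9 / 4 * (∑ i, S₀ i) * ‖z‖ := by rw [Finset.mul_sum, Finset.sum_mul]

/-- CONTRAST — THE A-PRIORI ROUTE: §2 applied to the TOTAL action (bound `∑ i, S₀ i`) certifies the PRINCIPAL logarithm of
the total partition function only on `‖z‖·(∑ i, S₀ i) < π/2`, a region shrinking with the number of blocks. [folklore] -/
theorem differentiableOn_logPartFn_pi_apriori (μ : ∀ i, Measure (Ω i)) [∀ i, IsProbabilityMeasure (μ i)]
    {S : ∀ i, Ω i → ℝ} (hS : ∀ i, Measurable (S i)) {S₀ : ι → ℝ} (hS₀ : ∀ i x, |S i x| ≤ S₀ i) :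
    DifferentiableOn ℂ (logPartFn (Measure.pi μ) (blockSum S)) (holDom (∑ i, S₀ i)) :=
  differentiableOn_logPartFn (measurable_blockSum hS) (abs_blockSum_le hS₀)

/-- **SHARPNESS OF THE BLOCKWISE REGION**: with two-point blocks of bounds `S₀ i`, the block `i₀` alone puts a zero of the
WHOLE partition function on `‖z‖·S₀ i₀ = π/2` — no logarithm of the total exists about `0` beyond the SMALLEST block radius,
whatever the other blocks are. [folklore] -/
theorem partFn_pi_twoPoint_zero (S₀ : ι → ℝ) {i₀ : ι} (h0 : 0 < S₀ i₀) :
    ‖(I * (Real.pi / (2 * S₀ i₀) : ℝ) : ℂ)‖ * S₀ i₀ = Real.pi / 2 ∧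
      partFn (Measure.pi fun _ : ι => twoPoint) (blockSum fun i => twoPointAction (S₀ i))
        (I * (Real.pi / (2 * S₀ i₀) : ℝ)) = 0 := by
  refine ⟨(partFn_twoPoint_zero h0).1, ?_⟩
  rw [partFn_pi]
  exact Finset.prod_eq_zero (Finset.mem_univ i₀) (partFn_twoPoint_zero h0).2

/-- **BEYOND TWO BLOCKS THE PRINCIPAL LOGARITHM OF THE TOTAL IS NOT THE BLOCKWISE SUM**: three aligned one-point blocks of
bound `S₀ > 0` at `z₀ = (2π/(5S₀))·I` — a point of the common region, `‖z₀‖·S₀ = 2π/5 < π/2` — have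
`∑ i, log Z_i(z₀) = −3·z₀·S₀` with imaginary part `−6π/5 < −π`, which no value of the principal logarithm has. [folklore] -/
theorem logPartFn_pi_ne_blockLog {S₀ : ℝ} (hS₀ : 0 < S₀) :
    ‖(I * (2 * Real.pi / (5 * S₀) : ℝ) : ℂ)‖ * S₀ < Real.pi / 2 ∧
      logPartFn (Measure.pi fun _ : Fin 3 => Measure.dirac ()) (blockSum fun (_ : Fin 3) (_ : Unit) => S₀)
          (I * (2 * Real.pi / (5 * S₀) : ℝ)) ≠
        blockLog (fun _ : Fin 3 => Measure.dirac ()) (fun (_ : Fin 3) (_ : Unit) => S₀)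
          (I * (2 * Real.pi / (5 * S₀) : ℝ)) := by
  have hnorm : ‖(I * (2 * Real.pi / (5 * S₀) : ℝ) : ℂ)‖ = 2 * Real.pi / (5 * S₀) := by
    rw [norm_mul, Complex.norm_I, one_mul, Complex.norm_real, Real.norm_eq_abs, abs_of_pos (by positivity)]
  have hz : ‖(I * (2 * Real.pi / (5 * S₀) : ℝ) : ℂ)‖ * S₀ < Real.pi / 2 := by
    rw [hnorm]
    have : 2 * Real.pi / (5 * S₀) * S₀ = 2 * Real.pi / 5 := by field_simp
    rw [this]
    linarith [Real.pi_pos]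
  refine ⟨hz, fun h => ?_⟩
  have h1 : -Real.pi < (logPartFn (Measure.pi fun _ : Fin 3 => Measure.dirac ())
      (blockSum fun (_ : Fin 3) (_ : Unit) => S₀) (I * (2 * Real.pi / (5 * S₀) : ℝ))).im :=
    Complex.neg_pi_lt_log_im _
  have h2 : blockLog (fun _ : Fin 3 => Measure.dirac ()) (fun (_ : Fin 3) (_ : Unit) => S₀)
      (I * (2 * Real.pi / (5 * S₀) : ℝ)) = 3 * -((I * (2 * Real.pi / (5 * S₀) : ℝ)) * S₀) := by
    rw [blockLog, Finset.sum_congr rfl fun i _ => (logPartFn_onePoint hS₀.le hz).1, Finset.sum_const, Finset.card_univ,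
      Fintype.card_fin]
    simp
  have h3 : (3 * -((I * (2 * Real.pi / (5 * S₀) : ℝ)) * (S₀ : ℂ))).im = -(6 * Real.pi / 5) := by
    have hS₀' : (S₀ : ℝ) ≠ 0 := hS₀.ne'
    simp only [Complex.mul_im, Complex.neg_im, Complex.I_re, Complex.I_im, Complex.ofReal_re, Complex.ofReal_im,
      Complex.re_ofNat, Complex.im_ofNat, Complex.mul_re]
    field_simp
    ring
  rw [h, h2, h3] at h1
  linarith [Real.pi_pos]

end Blocks

/-! ## §8 (v1.2, APPEND-ONLY)  THE STRIP: for a REAL action the CLASS-UNIFORM zero-free region (over all densities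
`|S| ≤ S₀`; sharp over that class) is `|Im z|·S₀ < π/2`, `log Z` is holomorphic on the whole strip with
`‖log Z(z)‖ ≤ |Re z|·S₀ + log 2 + π/2` (`|Im z|·S₀ ≤ 1`), so UNIFORM coupling discs of ANY radius `r < 1/S₀` about EVERY point
of `]0, γ]` exist for EVERY `γ` — the smallness `(γ + r)·S₀ < log(3/2)` of §4 is WITHDRAWN.  [v1.3 DOCFIX: XREAD C-ne4p1-27
INFO I1–I3 — terminal full stop; *"CLASS-UNIFORM … sharp over the class"* (for a fixed `S` the zero-free region may be larger,
e.g. `S ≡ 0`: `Z ≡ 1`); the print sentence below names its unit.]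

WHAT v1.2 CORRECTS [analysis].  §§2–4 certify `E = log Z` on the DISC `‖z‖·S₀ < π/2` and bound it through
`‖Z − 1‖ ≤ e^{‖z‖S₀} − 1 < 1`, whence the window condition `(γ + r)·S₀ < log(3/2)` of `logModel_couplingAnalyticOn` /
`ne9_logModel`, recorded in the cell as the smallness clause of GAPS G-ne9p1-13 (v1 header: *"S₀ ≲ 1/γ"*).  That clause is an
ARTEFACT OF THE PROOF, not a property of the model: for a REAL action density the real part of the Boltzmann factor is
`e^{−Re z·S(x)}·cos(Im z·S(x))`, positive as soon as `|Im z|·S₀ < π/2` WHATEVER `Re z` — the zero-free region on which the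
principal logarithm is holomorphic is the horizontal STRIP `stripDom S₀ = {|Im z|·S₀ < π/2}` (`re_partFn_pos_strip`,
`differentiableOn_logPartFn_strip`), and the strip is SHARP (the two-point zero `iπ/(2S₀)` of §5 lies on its boundary,
`twoPoint_zero_on_strip_boundary`) [v1.3: read *CLASS-UNIFORM zero-free region, sharp over the class `|S| ≤ S₀`* — XREAD
C-ne4p1-27 I2].  On the strip, `e^{−|Re z|S₀}/2 ≤ Re Z(z) ≤ ‖Z(z)‖ ≤ e^{|Re z|S₀}` for `|Im z|·S₀ ≤ 1`
(`cos 1 ≥ 1/2`), so `|log ‖Z(z)‖| ≤ |Re z|·S₀ + log 2` and `|arg Z(z)| < π/2`: **`norm_logPartFn_le_strip`**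
`‖log Z(z)‖ ≤ |Re z|·S₀ + log 2 + π/2` — a bound growing LINEARLY along the real axis instead of failing beyond
`‖z‖·S₀ = log 2`.  CONSEQUENCE BY NAME (**`logModel_couplingAnalyticOn_strip`**, **`ne9_logModel_strip`**): for every window
length `γ` and every radius `0 < r`, `r·S₀ < 1`, the model satisfies `CouplingAnalyticOn ]0, γ] (logModel …) κ M (fun _ _ ↦ r)`
with `M = (γ + 2r)·S₀ + log 2 + π/2`, hence (`T4CouplingAnalyticity.ne9_of_couplingAnalyticOn` FIRED BY NAME) the g-form of
NE9 on `Window γ` with moduli `4M/r`; with `r = 1/(2S₀)` the moduli are `8S₀·(γS₀ + 1 + log 2 + π/2)` — of order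
`S₀·(1 + γ·S₀)`, finite for EVERY `γ`.  WHAT REMAINS of G-ne9p1-13 (its class located-unprinted is unchanged): on the analytic
branch the model's ONLY input is a bound `S₀` on the first-order action PER LOCALISATION UNIT, UNIFORM IN THE STEP k (radius
`≍ 1/S₀`, moduli `≍ S₀(1 + γS₀)`); NO condition couples `γ` to `S₀`.  Print (p. 266) [v1.3: B12 = [Balaban1987RG1] p. 266, (2.9) and the alternative
cut-off sentence quoted in the header — XREAD C-ne4p1-27 I3] gives neither `S₀` nor its k-uniformity
nor says which cut-off scheme the later papers run.  MODEL statement only; HONEST FRAMING as in the header; NOT summit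
progress. -/

section Strip

variable {Ω : Type*} [MeasurableSpace Ω] {μ : Measure Ω} [IsProbabilityMeasure μ] {S : Ω → ℝ} {S₀ : ℝ}

/-- The STRIP `|Im z|·S₀ < π/2` — the zero-free region of `Z` for a real action density bounded by `S₀`. [folklore] -/
def stripDom (S₀ : ℝ) : Set ℂ := {z | |z.im| * S₀ < Real.pi / 2}

/-- Membership unfolding. [folklore] -/
theorem mem_stripDom {z : ℂ} : z ∈ stripDom S₀ ↔ |z.im| * S₀ < Real.pi / 2 := Iff.rfl

/-- The strip is open. [folklore] -/
theorem isOpen_stripDom (S₀ : ℝ) : IsOpen (stripDom S₀) :=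
  isOpen_lt ((continuous_abs.comp Complex.continuous_im).mul continuous_const) continuous_const

/-- The disc of §2 lies inside the strip (`|Im z| ≤ ‖z‖`). [folklore] -/
theorem holDom_subset_stripDom (S₀ : ℝ) : holDom S₀ ⊆ stripDom S₀ := by
  intro z hz
  rw [mem_holDom] at hz
  rw [mem_stripDom]
  rcases le_or_gt 0 S₀ with hS0 | hS0
  · exact lt_of_le_of_lt (mul_le_mul_of_nonneg_right (Complex.abs_im_le_norm z) hS0) hz
  · have : |z.im| * S₀ ≤ 0 := mul_nonpos_iff.2 (Or.inl ⟨abs_nonneg _, hS0.le⟩)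
    linarith [Real.pi_pos]

/-- Every REAL coupling lies in the strip. [folklore] -/
theorem ofReal_mem_stripDom (S₀ s : ℝ) : (s : ℂ) ∈ stripDom S₀ := by
  rw [mem_stripDom, Complex.ofReal_im, abs_zero, zero_mul]
  positivity

/-- The real and imaginary parts of the exponent `−z·S(x)`. [folklore] -/
theorem neg_mul_action_re_im (z : ℂ) (s : ℝ) :
    (-(z * (s : ℂ))).re = -(z.re * s) ∧ (-(z * (s : ℂ))).im = -(z.im * s) := by
  constructor
  · simp [Complex.mul_re]
  · simp [Complex.mul_im]

/-- **`Re Z(z) > 0` ON THE STRIP `|Im z|·S₀ < π/2`, FOR EVERY `Re z`**: the integrand `e^{−Re z·S} cos(Im z·S)` is positive.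
[folklore] -/
theorem re_partFn_pos_strip (hS : Measurable S) (hS₀ : ∀ x, |S x| ≤ S₀) {z : ℂ}
    (hz : |z.im| * S₀ < Real.pi / 2) : 0 < (partFn μ S z).re := by
  have hint := integrable_expAction μ hS hS₀ z
  have hre : (partFn μ S z).re = ∫ x, (cexp (-(z * S x))).re ∂μ := by
    rw [partFn]
    simpa using (integral_re hint).symm
  have hpt : ∀ x, 0 < (cexp (-(z * S x))).re := by
    intro x
    rw [Complex.exp_re]
    have h1 : |(-(z * (S x : ℂ))).im| ≤ |z.im| * S₀ := by
      rw [(neg_mul_action_re_im z (S x)).2, abs_neg, abs_mul]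
      exact mul_le_mul_of_nonneg_left (hS₀ x) (abs_nonneg _)
    obtain ⟨hl, hu⟩ := abs_le.1 h1
    exact mul_pos (Real.exp_pos _) (Real.cos_pos_of_mem_Ioo ⟨by linarith, by linarith⟩)
  rw [hre, integral_pos_iff_support_of_nonneg (fun x => (hpt x).le) (by simpa using hint.re)]
  have hsupp : Function.support (fun x => (cexp (-(z * S x))).re) = univ := by
    ext x
    simp [(hpt x).ne']
  rw [hsupp, measure_univ]
  exact one_pos

/-- `Z(z)` lies in the slit plane on the strip. [folklore] -/
theorem partFn_mem_slitPlane_strip (hS : Measurable S) (hS₀ : ∀ x, |S x| ≤ S₀) {z : ℂ}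
    (hz : |z.im| * S₀ < Real.pi / 2) : partFn μ S z ∈ slitPlane :=
  Complex.mem_slitPlane_iff.2 (Or.inl (re_partFn_pos_strip hS hS₀ hz))

/-- **NO ZERO OF `Z` ON THE STRIP** (no Lee–Yang zero at any distance from the vertex along the real axis). [folklore] -/
theorem partFn_ne_zero_strip (hS : Measurable S) (hS₀ : ∀ x, |S x| ≤ S₀) {z : ℂ}
    (hz : |z.im| * S₀ < Real.pi / 2) : partFn μ S z ≠ 0 :=
  Complex.slitPlane_ne_zero (partFn_mem_slitPlane_strip hS hS₀ hz)

/-- **HOLOMORPHY OF THE LOG LAYER ON THE WHOLE STRIP** (Mathlib `DifferentiableOn.clog`). [folklore] -/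
theorem differentiableOn_logPartFn_strip (hS : Measurable S) (hS₀ : ∀ x, |S x| ≤ S₀) :
    DifferentiableOn ℂ (logPartFn μ S) (stripDom S₀) :=
  (differentiable_partFn μ hS hS₀).differentiableOn.clog fun _ hz => partFn_mem_slitPlane_strip hS hS₀ hz

/-- `exp E = Z` on the strip. [folklore] -/
theorem exp_logPartFn_strip (hS : Measurable S) (hS₀ : ∀ x, |S x| ≤ S₀) {z : ℂ}
    (hz : |z.im| * S₀ < Real.pi / 2) : cexp (logPartFn μ S z) = partFn μ S z :=
  Complex.exp_log (partFn_ne_zero_strip hS hS₀ hz)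

/-- UPPER BOUND `‖Z(z)‖ ≤ e^{|Re z|·S₀}` (everywhere). [folklore] -/
theorem norm_partFn_le_exp_re (hS₀ : ∀ x, |S x| ≤ S₀) (z : ℂ) :
    ‖partFn μ S z‖ ≤ Real.exp (|z.re| * S₀) := by
  rw [partFn]
  refine (norm_integral_le_of_norm_le (integrable_const (Real.exp (|z.re| * S₀))) ?_).trans (le_of_eq ?_)
  · refine Filter.Eventually.of_forall fun x => ?_
    rw [Complex.norm_exp, (neg_mul_action_re_im z (S x)).1]
    refine Real.exp_le_exp.2 ?_
    have h1 : -(z.re * S x) ≤ |z.re| * |S x| := by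
      rw [← abs_mul]
      exact neg_le_abs _
    exact h1.trans (mul_le_mul_of_nonneg_left (hS₀ x) (abs_nonneg _))
  · simp

/-- `cos 1 ≥ 1/2` (Mathlib `Real.one_sub_sq_div_two_le_cos`). [folklore] -/
theorem half_le_cos_one : (1 : ℝ) / 2 ≤ Real.cos 1 := by
  have h := Real.one_sub_sq_div_two_le_cos (x := 1)
  norm_num at h
  linarith

/-- LOWER BOUND `e^{−|Re z|·S₀}/2 ≤ Re Z(z)` for `|Im z|·S₀ ≤ 1`: the integrand's real part is at least
`e^{−|Re z|S₀}·cos(|Im z|S₀) ≥ e^{−|Re z|S₀}·cos 1`. [folklore] -/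
theorem exp_neg_half_le_re_partFn (hS : Measurable S) (hS₀ : ∀ x, |S x| ≤ S₀) {z : ℂ} (hz : |z.im| * S₀ ≤ 1) :
    Real.exp (-(|z.re| * S₀)) / 2 ≤ (partFn μ S z).re := by
  have hint := integrable_expAction μ hS hS₀ z
  have hre : (partFn μ S z).re = ∫ x, (cexp (-(z * S x))).re ∂μ := by
    rw [partFn]
    simpa using (integral_re hint).symm
  have hpt : ∀ x, Real.exp (-(|z.re| * S₀)) / 2 ≤ (cexp (-(z * S x))).re := by
    intro x
    rw [Complex.exp_re, (neg_mul_action_re_im z (S x)).1, (neg_mul_action_re_im z (S x)).2,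
      Real.cos_neg]
    have h1 : Real.exp (-(|z.re| * S₀)) ≤ Real.exp (-(z.re * S x)) := by
      refine Real.exp_le_exp.2 ?_
      have : z.re * S x ≤ |z.re| * S₀ := by
        refine (le_abs_self _).trans ?_
        rw [abs_mul]
        exact mul_le_mul_of_nonneg_left (hS₀ x) (abs_nonneg _)
      linarith
    have h2 : 1 / 2 ≤ Real.cos (z.im * S x) := by
      rw [← Real.cos_abs]
      have hle : |z.im * S x| ≤ 1 := by
        rw [abs_mul]
        exact (mul_le_mul_of_nonneg_left (hS₀ x) (abs_nonneg _)).trans hz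
      exact half_le_cos_one.trans
        (Real.cos_le_cos_of_nonneg_of_le_pi (abs_nonneg _) (by linarith [Real.pi_gt_three]) hle)
    calc Real.exp (-(|z.re| * S₀)) / 2 = Real.exp (-(|z.re| * S₀)) * (1 / 2) := by ring
      _ ≤ Real.exp (-(z.re * S x)) * Real.cos (z.im * S x) := mul_le_mul h1 h2 (by norm_num) (Real.exp_pos _).le
  have hint' : Integrable (fun x => (cexp (-(z * S x))).re) μ := by simpa using hint.re
  rw [hre]
  calc Real.exp (-(|z.re| * S₀)) / 2 = ∫ _, Real.exp (-(|z.re| * S₀)) / 2 ∂μ := by simp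
    _ ≤ ∫ x, (cexp (-(z * S x))).re ∂μ := integral_mono (integrable_const _) hint' fun x => hpt x

/-- **THE STRIP BOUND `‖log Z(z)‖ ≤ |Re z|·S₀ + log 2 + π/2` FOR `|Im z|·S₀ ≤ 1`** (`|log ‖Z‖| ≤ |Re z|·S₀ + log 2` from the
two-sided bounds on `Z`, `|arg Z| < π/2` from `Re Z > 0`, `‖w‖ ≤ |Re w| + |Im w|`). [folklore] -/
theorem norm_logPartFn_le_strip (hS : Measurable S) (hS₀ : ∀ x, |S x| ≤ S₀) {z : ℂ} (hz : |z.im| * S₀ ≤ 1) :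
    ‖logPartFn μ S z‖ ≤ |z.re| * S₀ + (Real.log 2 + Real.pi / 2) := by
  have hzlt : |z.im| * S₀ < Real.pi / 2 := lt_of_le_of_lt hz (by linarith [Real.pi_gt_three])
  have hre := re_partFn_pos_strip (μ := μ) hS hS₀ hzlt
  have hne : partFn μ S z ≠ 0 := partFn_ne_zero_strip hS hS₀ hzlt
  have hpos : 0 < ‖partFn μ S z‖ := norm_pos_iff.2 hne
  have hup := norm_partFn_le_exp_re (μ := μ) hS₀ z
  have hlow : Real.exp (-(|z.re| * S₀)) / 2 ≤ ‖partFn μ S z‖ :=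
    (exp_neg_half_le_re_partFn (μ := μ) hS hS₀ hz).trans (Complex.re_le_norm _)
  have hlog_up : Real.log ‖partFn μ S z‖ ≤ |z.re| * S₀ := by
    have h := Real.log_le_log hpos hup
    rwa [Real.log_exp] at h
  have hlog_low : -(|z.re| * S₀) - Real.log 2 ≤ Real.log ‖partFn μ S z‖ := by
    have h2 : 0 < Real.exp (-(|z.re| * S₀)) / 2 := by positivity
    have h := Real.log_le_log h2 hlow
    rwa [Real.log_div (Real.exp_pos _).ne' two_ne_zero, Real.log_exp] at h
  have hlog2 : 0 < Real.log 2 := Real.log_pos one_lt_two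
  have habs_re : |(logPartFn μ S z).re| ≤ |z.re| * S₀ + Real.log 2 := by
    rw [logPartFn, Complex.log_re, abs_le]
    constructor <;> linarith
  have habs_im : |(logPartFn μ S z).im| ≤ Real.pi / 2 := by
    rw [logPartFn, Complex.log_im]
    exact (Complex.abs_arg_lt_pi_div_two_iff.2 (Or.inl hre)).le
  calc ‖logPartFn μ S z‖ ≤ |(logPartFn μ S z).re| + |(logPartFn μ S z).im| := Complex.norm_le_abs_re_add_abs_im _
    _ ≤ (|z.re| * S₀ + Real.log 2) + Real.pi / 2 := add_le_add habs_re habs_im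
    _ = |z.re| * S₀ + (Real.log 2 + Real.pi / 2) := by ring

/-- SHARPNESS OF THE STRIP: the two-point zero of §5 sits exactly on the boundary `|Im z|·S₀ = π/2`. [folklore] -/
theorem twoPoint_zero_on_strip_boundary {S₀ : ℝ} (hS₀ : 0 < S₀) :
    |(I * (Real.pi / (2 * S₀) : ℝ) : ℂ).im| * S₀ = Real.pi / 2 ∧
      partFn twoPoint (twoPointAction S₀) (I * (Real.pi / (2 * S₀) : ℝ)) = 0 := by
  refine ⟨?_, (partFn_twoPoint_zero hS₀).2⟩
  have him : (I * (Real.pi / (2 * S₀) : ℝ) : ℂ).im = Real.pi / (2 * S₀) := by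
    rw [Complex.mul_im, Complex.I_re, Complex.I_im, Complex.ofReal_re, Complex.ofReal_im]
    ring
  rw [him, abs_of_pos (by positivity)]
  field_simp

end Strip

section CurrencyStrip

variable {Ω : Type*} [MeasurableSpace Ω] {C : Carriers} {Bg : Type}

/-- DECAY SHAPE FOR EVERY WINDOW LENGTH: on `Window γ` the model satisfies `|E| ≤ (γ·S₀ + log 2 + π/2)·e^{−κd}` (real
couplings lie in the strip; `norm_logPartFn_le_strip`). [folklore] -/
theorem logModel_decay_strip {μ : Measure Ω} [IsProbabilityMeasure μ] {S : Ω → ℝ} (hS : Measurable S) {S₀ : ℝ}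
    (hS₀ : ∀ x, |S x| ≤ S₀) (κ γ : ℝ) :
    DecayBound (logModel C Bg κ μ S) (Window γ) (γ * S₀ + (Real.log 2 + Real.pi / 2)) κ := by
  have hS0 : 0 ≤ S₀ := actionBound_nonneg μ hS₀
  intro g hg U X
  have hγ : 0 < γ := (hg 0).1.trans_le (hg 0).2
  have hE0 : 0 ≤ γ * S₀ + (Real.log 2 + Real.pi / 2) := by
    have h1 : 0 ≤ γ * S₀ := mul_nonneg hγ.le hS0
    have h2 : 0 < Real.log 2 := Real.log_pos one_lt_two
    linarith [Real.pi_gt_three]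
  by_cases hX : 0 < C.scale X
  · have hs := hg (C.scale X - 1)
    have him : |(((g (C.scale X - 1) : ℝ) : ℂ)).im| * S₀ ≤ 1 := by
      rw [Complex.ofReal_im, abs_zero, zero_mul]
      exact zero_le_one
    have h := norm_logPartFn_le_strip (μ := μ) hS hS₀ him
    rw [Complex.ofReal_re, abs_of_pos hs.1] at h
    have h' : ‖logPartFn μ S (g (C.scale X - 1) : ℝ)‖ ≤ γ * S₀ + (Real.log 2 + Real.pi / 2) :=
      h.trans (by linarith [mul_le_mul_of_nonneg_right hs.2 hS0])
    have hnorm : |logModel C Bg κ μ S g U X| = Real.exp (-(κ * C.d X)) * ‖logPartFn μ S (g (C.scale X - 1) : ℝ)‖ := by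
      rw [← Real.norm_eq_abs, ← Complex.norm_real, logModel_ofReal hS hS₀ κ g U hX, norm_mul, Complex.norm_real,
        Real.norm_eq_abs, abs_of_pos (Real.exp_pos _)]
    rw [hnorm, mul_comm]
    exact mul_le_mul_of_nonneg_right h' (Real.exp_pos _).le
  · simp only [logModel, if_neg hX, abs_zero]
    exact mul_nonneg hE0 (Real.exp_pos _).le

/-- **FULL COUPLING DISCS OF ANY RADIUS `r < 1/S₀` ABOUT `]0, γ]`, FOR EVERY `γ`** — the v1.2 replacement of
`logModel_couplingAnalyticOn`: `CouplingAnalyticOn ]0, γ]` with the uniform radius `r` and the bound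
`M = (γ + 2r)·S₀ + log 2 + π/2` (extension domain: the box `|Im z|·S₀ < 1`, `|Re z| < γ + 2r` inside the strip).  NO
smallness couples `γ` to `S₀`. [folklore] -/
theorem logModel_couplingAnalyticOn_strip {μ : Measure Ω} [IsProbabilityMeasure μ] {S : Ω → ℝ} (hS : Measurable S)
    {S₀ : ℝ} (hS₀ : ∀ x, |S x| ≤ S₀) (κ : ℝ) {γ r : ℝ} (hr : 0 < r) (hrS : r * S₀ < 1) :
    CouplingAnalyticOn (Set.Ioc 0 γ) (logModel C Bg κ μ S) κ ((γ + 2 * r) * S₀ + (Real.log 2 + Real.pi / 2))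
      (fun _ _ => r) := by
  have hS0 : 0 ≤ S₀ := actionBound_nonneg μ hS₀
  intro U X h hh i hi
  have hX : 0 < C.scale X := lt_of_le_of_lt (Nat.zero_le i) hi
  by_cases hlast : i = C.scale X - 1
  · subst hlast
    refine ⟨fun z => (Real.exp (-(κ * C.d X)) : ℂ) * logPartFn μ S z,
      {z | |z.im| * S₀ < 1 ∧ |z.re| < γ + 2 * r}, ?_, ?_, ?_, ?_⟩
    · refine (differentiableOn_const _).mul ((differentiableOn_logPartFn_strip hS hS₀).mono ?_)
      rintro z ⟨hz1, -⟩
      rw [mem_stripDom]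
      exact lt_trans hz1 (by linarith [Real.pi_gt_three])
    · rintro z ⟨hz1, hz2⟩
      have hb := norm_logPartFn_le_strip (μ := μ) hS hS₀ hz1.le
      have hb' : ‖logPartFn μ S z‖ ≤ (γ + 2 * r) * S₀ + (Real.log 2 + Real.pi / 2) :=
        hb.trans (by linarith [mul_le_mul_of_nonneg_right hz2.le hS0])
      rw [norm_mul, Complex.norm_real, Real.norm_eq_abs, abs_of_pos (Real.exp_pos _), mul_comm]
      exact mul_le_mul_of_nonneg_right hb' (Real.exp_pos _).le
    · intro s hs z hz
      rw [mem_closedBall, dist_eq_norm] at hz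
      have him : |z.im| ≤ r := by
        have h1 : |(z - (s : ℂ)).im| ≤ ‖z - (s : ℂ)‖ := Complex.abs_im_le_norm _
        rw [Complex.sub_im, Complex.ofReal_im, sub_zero] at h1
        exact h1.trans hz
      have hre : |z.re| ≤ γ + r := by
        have h1 : |(z - (s : ℂ)).re| ≤ ‖z - (s : ℂ)‖ := Complex.abs_re_le_norm _
        rw [Complex.sub_re, Complex.ofReal_re] at h1
        have h2 : |z.re| ≤ |z.re - s| + |s| := by
          calc |z.re| = |(z.re - s) + s| := by rw [sub_add_cancel]
            _ ≤ |z.re - s| + |s| := abs_add_le _ _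
        rw [abs_of_pos hs.1] at h2
        linarith [hs.2]
      show |z.im| * S₀ < 1 ∧ |z.re| < γ + 2 * r
      refine ⟨?_, by linarith⟩
      calc |z.im| * S₀ ≤ r * S₀ := mul_le_mul_of_nonneg_right him hS0
        _ < 1 := hrS
    · intro s hs
      rw [logModel_ofReal hS hS₀ κ _ U hX, Function.update_self]
  · refine ⟨fun _ => (logModel C Bg κ μ S h U X : ℂ), univ, differentiableOn_const _, ?_, fun _ _ => subset_univ _, ?_⟩
    · intro z _
      have hdec := logModel_decay_strip (C := C) (Bg := Bg) (μ := μ) hS hS₀ κ γ h hh U X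
      rw [Complex.norm_real, Real.norm_eq_abs]
      refine hdec.trans (mul_le_mul_of_nonneg_right ?_ (Real.exp_pos _).le)
      have hγr : γ * S₀ ≤ (γ + 2 * r) * S₀ := mul_le_mul_of_nonneg_right (by linarith) hS0
      linarith
    · intro s hs
      have hne : C.scale X - 1 ≠ i := fun h' => hlast h'.symm
      simp only [logModel, if_pos hX, Function.update_of_ne hne]

/-- **THE g-FORM OF NE9 FOR THE LOG-LAYER MODEL ON EVERY WINDOW `]0, γ]`, BY NAME** (`ne9_of_couplingAnalyticOn` of the
lineage, uniform radius `r`, `r·S₀ < 1`, moduli `4M/r`, `M = (γ + 2r)·S₀ + log 2 + π/2`): the v1.2 replacement of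
`ne9_logModel` — no smallness condition on `γ·S₀`. [folklore] -/
theorem ne9_logModel_strip {μ : Measure Ω} [IsProbabilityMeasure μ] {S : Ω → ℝ} (hS : Measurable S) {S₀ : ℝ}
    (hS₀ : ∀ x, |S x| ≤ S₀) (κ : ℝ) {γ r : ℝ} (hr : 0 < r) (hrS : r * S₀ < 1) :
    NE9 (logModel C Bg κ μ S) (Window γ) κ
      (fun _ _ => 4 * ((γ + 2 * r) * S₀ + (Real.log 2 + Real.pi / 2)) / r) := by
  rw [window_eq_boxWindow]
  exact ne9_of_couplingAnalyticOn Set.ordConnected_Ioc (fun _ _ _ => hr) (logModel_prefix C Bg κ μ S _)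
    (logModel_couplingAnalyticOn_strip hS hS₀ κ hr hrS)

/-- THE CANONICAL RADIUS `r = 1/(2S₀)` (`S₀ > 0`): NE9 on EVERY window `]0, γ]` with moduli
`8S₀·(γ·S₀ + 1 + log 2 + π/2)` — of order `S₀·(1 + γS₀)`. [folklore] -/
theorem ne9_logModel_canonical {μ : Measure Ω} [IsProbabilityMeasure μ] {S : Ω → ℝ} (hS : Measurable S) {S₀ : ℝ}
    (hS₀ : ∀ x, |S x| ≤ S₀) (h0 : 0 < S₀) (κ γ : ℝ) :
    NE9 (logModel C Bg κ μ S) (Window γ) κ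
      (fun _ _ => 8 * S₀ * (γ * S₀ + 1 + (Real.log 2 + Real.pi / 2))) := by
  have hr : 0 < 1 / (2 * S₀) := by positivity
  have hne : S₀ ≠ 0 := h0.ne'
  have hrS : 1 / (2 * S₀) * S₀ < 1 := by
    rw [div_mul_eq_mul_div, one_mul, div_lt_one (by positivity)]
    linarith
  convert ne9_logModel_strip (C := C) (Bg := Bg) (μ := μ) hS hS₀ κ (γ := γ) hr hrS using 1
  funext j i
  field_simp
  ring

end CurrencyStrip

/-! ## §9 (v1.3, APPEND-ONLY)  NON-LINEAR COUPLING DEPENDENCE IN THE EXPONENT: the zero-free region is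
`sup_x |Im A_z(x)| < π/2`; for the SECOND-ORDER family `A_z = z·S + z²·T` it is the LENS `|Im z|·(S₀ + 2|Re z|·T₀) < π/2`
(sharp) — analyticity about `]0, γ]` for EVERY `γ` persists, the UNIFORMITY OF THE RADIUS IN `γ` does not

The v1.2 bracket *"NO condition couples γ to S₀"* is a statement about the LINEAR model `A_z = z·S`.  The exponent of
(2.13) depends on the last coupling through `U(g_k B)` — non-linearly (analytically); the linear model is its first-order
truncation.  This section records what survives at second order (and the mechanism for any order):
(a) STATIC LEMMAS for a COMPLEX action density `A : Ω → ℂ` with `|Re A| ≤ a`, `|Im A| ≤ θ`: `Re ∫e^{−A}dμ > 0` as soon as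
`θ < π/2` (`re_cpartFn_pos`), `e^{−a}/2 ≤ Re ∫e^{−A} ≤ ‖∫e^{−A}‖ ≤ e^{a}` for `θ ≤ 1`, hence
`‖log ∫e^{−A}dμ‖ ≤ a + log 2 + π/2` (`norm_log_cpartFn_le`) — the zero-free region of ANY holomorphic family `z ↦ A_z` is
`{z | sup_x |Im A_z(x)| < π/2}`;
(b) the SECOND-ORDER FAMILY `Z₂(z) = ∫ e^{−(z·S + z²·T)} dμ` (`|S| ≤ S₀`, `|T| ≤ T₀`): ENTIRE (`differentiable_partFn₂`,
dominated differentiation), `Im(zS + z²T) = Im z·(S + 2 Re z·T)`, so `Z₂` is zero-free with `Re Z₂ > 0` on the LENS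
`lensDom S₀ T₀ = {|Im z|·(S₀ + 2|Re z|·T₀) < π/2}` (`re_partFn₂_pos`), `log Z₂` is holomorphic there, and
`‖log Z₂(z)‖ ≤ |Re z|·S₀ + (Re z² + Im z²)·T₀ + log 2 + π/2` when `|Im z|·(S₀ + 2|Re z|·T₀) ≤ 1` (`norm_logPartFn₂_le`);
the lens is SHARP: for `S = 0` and the two-point `T = ±T₀`, `Z₂(z) = cosh(z²T₀)` vanishes at `z₀ = (1 + i)·√(π/(4T₀))`,
where `|Im z₀|·2|Re z₀|·T₀ = π/2` exactly (`partFn₂_twoPoint_zero`);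
(c) CURRENCY BY NAME: `logModel₂ C Bg κ μ S T` satisfies `CouplingAnalyticOn ]0, γ] … (fun _ _ ↦ r)` for every `γ` and
every radius `r` with `2r·(S₀ + 2(γ + 2r)·T₀) ≤ 1`, bound `M = (γ + 2r)·S₀ + ((γ + 2r)² + 4r²)·T₀ + log 2 + π/2`
(`logModel₂_couplingAnalyticOn`), hence the g-form of NE9 with moduli `4M/r` (`ne9_logModel₂`, `ne9_of_couplingAnalyticOn`
BY NAME).  READING: at second order the admissible radius about `]0, γ]` is `≍ 1/(S₀ + γ·T₀)` and the moduli grow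
polynomially in `γ` — for the printed *"positive, absolute γ"* (B12 p. 263) this is immaterial, and NO smallness
condition obstructs analyticity at any `γ`; what the model needs is k-UNIFORM per-unit bounds on the Taylor
coefficients of the exponent in the coupling (`S₀`, `T₀`, …), cf. G-ne9p1-13 UPDATE 2.  MODEL statements only. -/

section ComplexAction

variable {Ω : Type*} [MeasurableSpace Ω] {μ : Measure Ω}

/-- The partition function of a COMPLEX action density `A : Ω → ℂ`: `∫ e^{−A(x)} dμ(x)`. [folklore] -/
def cpartFn (μ : Measure Ω) (A : Ω → ℂ) : ℂ := ∫ x, cexp (-(A x)) ∂μ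

omit [MeasurableSpace Ω] in
/-- Pointwise size of the complex Boltzmann factor: `‖e^{−A}‖ = e^{−Re A} ≤ e^{a}` for `|Re A| ≤ a`. [folklore] -/
theorem norm_cexp_neg_le {A : Ω → ℂ} {a : ℝ} (ha : ∀ x, |(A x).re| ≤ a) (x : Ω) :
    ‖cexp (-(A x))‖ ≤ Real.exp a := by
  rw [Complex.norm_exp, Complex.neg_re]
  exact Real.exp_le_exp.2 ((neg_le_abs _).trans (ha x))

/-- The complex Boltzmann factor is integrable on a finite measure space (`A` measurable, `|Re A| ≤ a`). [folklore] -/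
theorem integrable_cexp_neg [IsFiniteMeasure μ] {A : Ω → ℂ} (hA : Measurable A) {a : ℝ} (ha : ∀ x, |(A x).re| ≤ a) :
    Integrable (fun x => cexp (-(A x))) μ := by
  refine Integrable.mono' (integrable_const (Real.exp a)) ?_ (Filter.Eventually.of_forall fun x => norm_cexp_neg_le ha x)
  exact (Complex.continuous_exp.measurable.comp hA.neg).aestronglyMeasurable

/-- The real part of the complex partition function is the integral of `e^{−Re A}·cos(Im A)`. [folklore] -/
theorem re_cpartFn_eq [IsFiniteMeasure μ] {A : Ω → ℂ} (hA : Measurable A) {a : ℝ} (ha : ∀ x, |(A x).re| ≤ a) :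
    (cpartFn μ A).re = ∫ x, Real.exp (-(A x).re) * Real.cos ((A x).im) ∂μ := by
  have hint := integrable_cexp_neg (μ := μ) hA ha
  have h1 : (cpartFn μ A).re = ∫ x, (cexp (-(A x))).re ∂μ := by
    rw [cpartFn]
    simpa using (integral_re hint).symm
  rw [h1]
  refine integral_congr_ae (Filter.Eventually.of_forall fun x => ?_)
  simp [Complex.exp_re, Real.cos_neg]

/-- **`Re ∫e^{−A}dμ > 0` WHENEVER `|Im A| ≤ θ < π/2`** (probability measure): the integrand `e^{−Re A} cos(Im A)` is
positive.  The zero-free region of any holomorphic family `z ↦ A_z` contains `{z | sup |Im A_z| < π/2}`. [folklore] -/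
theorem re_cpartFn_pos [IsProbabilityMeasure μ] {A : Ω → ℂ} (hA : Measurable A) {a θ : ℝ} (ha : ∀ x, |(A x).re| ≤ a)
    (hθ : ∀ x, |(A x).im| ≤ θ) (hθ' : θ < Real.pi / 2) : 0 < (cpartFn μ A).re := by
  have hint := integrable_cexp_neg (μ := μ) hA ha
  have hpt : ∀ x, 0 < Real.exp (-(A x).re) * Real.cos ((A x).im) := by
    intro x
    obtain ⟨hl, hu⟩ := abs_le.1 (hθ x)
    exact mul_pos (Real.exp_pos _) (Real.cos_pos_of_mem_Ioo ⟨by linarith, by linarith⟩)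
  have hint' : Integrable (fun x => Real.exp (-(A x).re) * Real.cos ((A x).im)) μ := by
    have h : Integrable (fun x => (cexp (-(A x))).re) μ := by simpa using hint.re
    refine h.congr (Filter.Eventually.of_forall fun x => ?_)
    simp [Complex.exp_re, Real.cos_neg]
  rw [re_cpartFn_eq hA ha, integral_pos_iff_support_of_nonneg (fun x => (hpt x).le) hint']
  have hsupp : Function.support (fun x => Real.exp (-(A x).re) * Real.cos ((A x).im)) = univ := by
    ext x
    simp only [Function.mem_support, ne_eq, mem_univ, iff_true]
    exact (hpt x).ne'
  rw [hsupp, measure_univ]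
  exact one_pos

/-- UPPER BOUND `‖∫e^{−A}dμ‖ ≤ e^{a}` (probability measure, `|Re A| ≤ a`). [folklore] -/
theorem norm_cpartFn_le [IsProbabilityMeasure μ] {A : Ω → ℂ} {a : ℝ} (ha : ∀ x, |(A x).re| ≤ a) :
    ‖cpartFn μ A‖ ≤ Real.exp a := by
  rw [cpartFn]
  refine (norm_integral_le_of_norm_le (integrable_const (Real.exp a))
    (Filter.Eventually.of_forall fun x => norm_cexp_neg_le ha x)).trans (le_of_eq ?_)
  simp

/-- LOWER BOUND `e^{−a}/2 ≤ Re ∫e^{−A}dμ` for `|Re A| ≤ a`, `|Im A| ≤ 1` (`cos 1 ≥ 1/2`). [folklore] -/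
theorem exp_neg_half_le_re_cpartFn [IsProbabilityMeasure μ] {A : Ω → ℂ} (hA : Measurable A) {a : ℝ}
    (ha : ∀ x, |(A x).re| ≤ a) (h1 : ∀ x, |(A x).im| ≤ 1) : Real.exp (-a) / 2 ≤ (cpartFn μ A).re := by
  have hint := integrable_cexp_neg (μ := μ) hA ha
  have hpt : ∀ x, Real.exp (-a) / 2 ≤ Real.exp (-(A x).re) * Real.cos ((A x).im) := by
    intro x
    have e1 : Real.exp (-a) ≤ Real.exp (-(A x).re) := Real.exp_le_exp.2 (by linarith [le_abs_self ((A x).re), ha x])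
    have e2 : 1 / 2 ≤ Real.cos ((A x).im) := by
      rw [← Real.cos_abs]
      exact half_le_cos_one.trans
        (Real.cos_le_cos_of_nonneg_of_le_pi (abs_nonneg _) (by linarith [Real.pi_gt_three]) (h1 x))
    calc Real.exp (-a) / 2 = Real.exp (-a) * (1 / 2) := by ring
      _ ≤ Real.exp (-(A x).re) * Real.cos ((A x).im) := mul_le_mul e1 e2 (by norm_num) (Real.exp_pos _).le
  have hint' : Integrable (fun x => Real.exp (-(A x).re) * Real.cos ((A x).im)) μ := by
    have h : Integrable (fun x => (cexp (-(A x))).re) μ := by simpa using hint.re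
    refine h.congr (Filter.Eventually.of_forall fun x => ?_)
    simp [Complex.exp_re, Real.cos_neg]
  rw [re_cpartFn_eq hA ha]
  calc Real.exp (-a) / 2 = ∫ _, Real.exp (-a) / 2 ∂μ := by simp
    _ ≤ ∫ x, Real.exp (-(A x).re) * Real.cos ((A x).im) ∂μ := integral_mono (integrable_const _) hint' fun x => hpt x

/-- **THE STATIC LOG BOUND `‖log ∫e^{−A}dμ‖ ≤ a + log 2 + π/2`** for `|Re A| ≤ a`, `|Im A| ≤ 1` (probability measure):
`|log ‖·‖| ≤ a + log 2` from the two-sided bounds, `|arg| < π/2` from `Re > 0`. [folklore] -/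
theorem norm_log_cpartFn_le [IsProbabilityMeasure μ] {A : Ω → ℂ} (hA : Measurable A) {a : ℝ} (ha : ∀ x, |(A x).re| ≤ a)
    (h1 : ∀ x, |(A x).im| ≤ 1) : ‖Complex.log (cpartFn μ A)‖ ≤ a + (Real.log 2 + Real.pi / 2) := by
  have hre := re_cpartFn_pos (μ := μ) hA ha h1 (by linarith [Real.pi_gt_three])
  have hne : cpartFn μ A ≠ 0 := fun h => by rw [h, Complex.zero_re] at hre; exact lt_irrefl _ hre
  have hpos : 0 < ‖cpartFn μ A‖ := norm_pos_iff.2 hne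
  have hup := norm_cpartFn_le (μ := μ) ha
  have hlow : Real.exp (-a) / 2 ≤ ‖cpartFn μ A‖ :=
    (exp_neg_half_le_re_cpartFn (μ := μ) hA ha h1).trans (Complex.re_le_norm _)
  have hlog_up : Real.log ‖cpartFn μ A‖ ≤ a := by
    have h := Real.log_le_log hpos hup
    rwa [Real.log_exp] at h
  have hlog_low : -a - Real.log 2 ≤ Real.log ‖cpartFn μ A‖ := by
    have h2 : 0 < Real.exp (-a) / 2 := by positivity
    have h := Real.log_le_log h2 hlow
    rwa [Real.log_div (Real.exp_pos _).ne' two_ne_zero, Real.log_exp] at h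
  have hlog2 : 0 < Real.log 2 := Real.log_pos one_lt_two
  have habs_re : |(Complex.log (cpartFn μ A)).re| ≤ a + Real.log 2 := by
    rw [Complex.log_re, abs_le]
    constructor <;> linarith
  have habs_im : |(Complex.log (cpartFn μ A)).im| ≤ Real.pi / 2 := by
    rw [Complex.log_im]
    exact (Complex.abs_arg_lt_pi_div_two_iff.2 (Or.inl hre)).le
  calc ‖Complex.log (cpartFn μ A)‖
      ≤ |(Complex.log (cpartFn μ A)).re| + |(Complex.log (cpartFn μ A)).im| := Complex.norm_le_abs_re_add_abs_im _
    _ ≤ (a + Real.log 2) + Real.pi / 2 := add_le_add habs_re habs_im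
    _ = a + (Real.log 2 + Real.pi / 2) := by ring

/-- CONSISTENCY: the linear model of §1 is the complex-action partition function of `A = z·S`. [folklore] -/
theorem partFn_eq_cpartFn (S : Ω → ℝ) (z : ℂ) : partFn μ S z = cpartFn μ (fun x => z * S x) := rfl

end ComplexAction

section SecondOrder

variable {Ω : Type*} [MeasurableSpace Ω] (μ : Measure Ω)

/-- THE SECOND-ORDER PARTITION FUNCTION `Z₂(z) = ∫ e^{−(z·S(x) + z²·T(x))} dμ(x)` (`S` the first-order, `T` the
second-order coefficient of the exponent in the coupling). [folklore] -/
def partFn₂ (S T : Ω → ℝ) (z : ℂ) : ℂ := ∫ x, cexp (-(z * S x + z ^ 2 * T x)) ∂μ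

/-- `Z₂` is the complex-action partition function of `A_z = z·S + z²·T`. [folklore] -/
theorem partFn₂_eq_cpartFn (S T : Ω → ℝ) (z : ℂ) : partFn₂ μ S T z = cpartFn μ (fun x => z * S x + z ^ 2 * T x) := rfl

/-- With `T = 0` the second-order family is the linear model of §1. [folklore] -/
theorem partFn₂_zero_right (S : Ω → ℝ) : partFn₂ μ S (fun _ => 0) = partFn μ S := by
  funext z
  simp [partFn₂, partFn]

/-- With `S = 0` the second-order family is the linear model IN THE VARIABLE `z²`. [folklore] -/
theorem partFn₂_zero_left (T : Ω → ℝ) (z : ℂ) : partFn₂ μ (fun _ => 0) T z = partFn μ T (z ^ 2) := by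
  simp [partFn₂, partFn]

variable {μ}

/-- Real and imaginary parts of the second-order exponent: `Re = Re z·s + (Re z² − Im z²)·t`,
`Im = Im z·(s + 2·Re z·t)`. [folklore] -/
theorem quadAction_re_im (z : ℂ) (s t : ℝ) :
    (z * (s : ℂ) + z ^ 2 * (t : ℂ)).re = z.re * s + (z.re ^ 2 - z.im ^ 2) * t ∧
      (z * (s : ℂ) + z ^ 2 * (t : ℂ)).im = z.im * (s + 2 * z.re * t) := by
  constructor
  · simp only [sq, Complex.add_re, Complex.mul_re, Complex.mul_im, Complex.ofReal_re, Complex.ofReal_im]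
    ring
  · simp only [sq, Complex.add_im, Complex.mul_re, Complex.mul_im, Complex.ofReal_re, Complex.ofReal_im]
    ring

omit [MeasurableSpace Ω] in
/-- `|Im(z·S + z²·T)| ≤ |Im z|·(S₀ + 2|Re z|·T₀)`. [folklore] -/
theorem abs_im_quadAction_le {S T : Ω → ℝ} {S₀ T₀ : ℝ} (hS₀ : ∀ x, |S x| ≤ S₀) (hT₀ : ∀ x, |T x| ≤ T₀) (z : ℂ)
    (x : Ω) : |(z * (S x : ℂ) + z ^ 2 * (T x : ℂ)).im| ≤ |z.im| * (S₀ + 2 * |z.re| * T₀) := by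
  rw [(quadAction_re_im z (S x) (T x)).2, abs_mul]
  refine mul_le_mul_of_nonneg_left ?_ (abs_nonneg _)
  calc |S x + 2 * z.re * T x| ≤ |S x| + |2 * z.re * T x| := abs_add_le _ _
    _ = |S x| + 2 * |z.re| * |T x| := by rw [abs_mul, abs_mul, abs_two]
    _ ≤ S₀ + 2 * |z.re| * T₀ := add_le_add (hS₀ x) (mul_le_mul_of_nonneg_left (hT₀ x) (by positivity))

omit [MeasurableSpace Ω] in
/-- `|Re(z·S + z²·T)| ≤ |Re z|·S₀ + (Re z² + Im z²)·T₀`. [folklore] -/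
theorem abs_re_quadAction_le {S T : Ω → ℝ} {S₀ T₀ : ℝ} (hS₀ : ∀ x, |S x| ≤ S₀) (hT₀ : ∀ x, |T x| ≤ T₀) (z : ℂ)
    (x : Ω) : |(z * (S x : ℂ) + z ^ 2 * (T x : ℂ)).re| ≤ |z.re| * S₀ + (z.re ^ 2 + z.im ^ 2) * T₀ := by
  rw [(quadAction_re_im z (S x) (T x)).1]
  have hT0 : 0 ≤ T₀ := (abs_nonneg _).trans (hT₀ x)
  calc |z.re * S x + (z.re ^ 2 - z.im ^ 2) * T x| ≤ |z.re * S x| + |(z.re ^ 2 - z.im ^ 2) * T x| := abs_add_le _ _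
    _ = |z.re| * |S x| + |z.re ^ 2 - z.im ^ 2| * |T x| := by rw [abs_mul, abs_mul]
    _ ≤ |z.re| * S₀ + (z.re ^ 2 + z.im ^ 2) * T₀ := by
        refine add_le_add (mul_le_mul_of_nonneg_left (hS₀ x) (abs_nonneg _))
          (mul_le_mul ?_ (hT₀ x) (abs_nonneg _) (by positivity))
        exact abs_le.2 ⟨by nlinarith [sq_nonneg z.re, sq_nonneg z.im], by nlinarith [sq_nonneg z.re, sq_nonneg z.im]⟩

/-- The second-order exponent is measurable in `x`. [folklore] -/
theorem measurable_quadAction {S T : Ω → ℝ} (hS : Measurable S) (hT : Measurable T) (z : ℂ) :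
    Measurable fun x => z * (S x : ℂ) + z ^ 2 * (T x : ℂ) :=
  ((Complex.measurable_ofReal.comp hS).const_mul z).add ((Complex.measurable_ofReal.comp hT).const_mul (z ^ 2))

/-- The second-order Boltzmann factor is integrable for every complex coupling. [folklore] -/
theorem integrable_quadBoltzmann [IsFiniteMeasure μ] {S T : Ω → ℝ} (hS : Measurable S) (hT : Measurable T) {S₀ T₀ : ℝ}
    (hS₀ : ∀ x, |S x| ≤ S₀) (hT₀ : ∀ x, |T x| ≤ T₀) (z : ℂ) :
    Integrable (fun x => cexp (-(z * S x + z ^ 2 * T x))) μ :=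
  integrable_cexp_neg (measurable_quadAction hS hT z) (abs_re_quadAction_le hS₀ hT₀ z)

/-- A crude uniform bound on the unit ball about `z₀`: `|Re z|·S₀ + (Re z² + Im z²)·T₀ ≤ (‖z₀‖ + 1)·S₀ + (‖z₀‖ + 1)²·T₀`.
[folklore] -/
theorem quadBound_ball {S₀ T₀ : ℝ} (hS0 : 0 ≤ S₀) (hT0 : 0 ≤ T₀) {z₀ z : ℂ} (hz : z ∈ Metric.ball z₀ 1) :
    |z.re| * S₀ + (z.re ^ 2 + z.im ^ 2) * T₀ ≤ (‖z₀‖ + 1) * S₀ + (‖z₀‖ + 1) ^ 2 * T₀ := by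
  have hz1 : ‖z‖ ≤ ‖z₀‖ + 1 := by
    have h := mem_ball_iff_norm.1 hz
    calc ‖z‖ = ‖(z - z₀) + z₀‖ := by rw [sub_add_cancel]
      _ ≤ ‖z - z₀‖ + ‖z₀‖ := norm_add_le _ _
      _ ≤ ‖z₀‖ + 1 := by linarith
  have hre : |z.re| ≤ ‖z₀‖ + 1 := (Complex.abs_re_le_norm z).trans hz1
  have hsq : z.re ^ 2 + z.im ^ 2 ≤ (‖z₀‖ + 1) ^ 2 := by
    have h := Complex.sq_norm z
    rw [Complex.normSq_apply] at h
    nlinarith [norm_nonneg z, norm_nonneg z₀]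
  exact add_le_add (mul_le_mul_of_nonneg_right hre hS0) (mul_le_mul_of_nonneg_right hsq hT0)

/-- **`Z₂` IS ENTIRE** — differentiation under the integral sign (Mathlib `hasDerivAt_integral_of_dominated_loc_of_deriv_le`,
dominating constant on the unit ball about `z₀`): `Z₂′(z₀) = −∫ (S + 2z₀T)·e^{−(z₀S + z₀²T)} dμ`. [folklore] -/
theorem hasDerivAt_partFn₂ [IsFiniteMeasure μ] {S T : Ω → ℝ} (hS : Measurable S) (hT : Measurable T) {S₀ T₀ : ℝ}
    (hS₀ : ∀ x, |S x| ≤ S₀) (hT₀ : ∀ x, |T x| ≤ T₀) (z₀ : ℂ) :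
    HasDerivAt (partFn₂ μ S T)
      (∫ x, -((S x : ℂ) + 2 * z₀ * (T x : ℂ)) * cexp (-(z₀ * S x + z₀ ^ 2 * T x)) ∂μ) z₀ := by
  rcases isEmpty_or_nonempty Ω with hΩ | ⟨⟨x₀⟩⟩
  · have hμ : μ = 0 := Measure.eq_zero_of_isEmpty μ
    have h0 : partFn₂ μ S T = fun _ => 0 := by funext z; simp [partFn₂, hμ]
    rw [h0, hμ, integral_zero_measure]
    exact hasDerivAt_const z₀ (0 : ℂ)
  have hS0 : 0 ≤ S₀ := (abs_nonneg _).trans (hS₀ x₀)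
  have hT0 : 0 ≤ T₀ := (abs_nonneg _).trans (hT₀ x₀)
  set K : ℝ := (S₀ + 2 * (‖z₀‖ + 1) * T₀) * Real.exp ((‖z₀‖ + 1) * S₀ + (‖z₀‖ + 1) ^ 2 * T₀) with hK
  have hF_meas : ∀ᶠ z in nhds z₀, AEStronglyMeasurable (fun x => cexp (-(z * S x + z ^ 2 * T x))) μ :=
    Filter.Eventually.of_forall fun z =>
      (Complex.continuous_exp.measurable.comp (measurable_quadAction hS hT z).neg).aestronglyMeasurable
  have hF_int : Integrable (fun x => cexp (-(z₀ * S x + z₀ ^ 2 * T x))) μ := integrable_quadBoltzmann hS hT hS₀ hT₀ z₀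
  have hF'_meas : AEStronglyMeasurable
      (fun x => -((S x : ℂ) + 2 * z₀ * (T x : ℂ)) * cexp (-(z₀ * S x + z₀ ^ 2 * T x))) μ := by
    refine Measurable.aestronglyMeasurable ?_
    refine Measurable.mul ?_ (Complex.continuous_exp.measurable.comp (measurable_quadAction hS hT z₀).neg)
    exact (((Complex.measurable_ofReal.comp hS)).add ((Complex.measurable_ofReal.comp hT).const_mul (2 * z₀))).neg
  have h_bound : ∀ᵐ x ∂μ, ∀ z ∈ Metric.ball z₀ 1,
      ‖-((S x : ℂ) + 2 * z * (T x : ℂ)) * cexp (-(z * S x + z ^ 2 * T x))‖ ≤ K := by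
    refine Filter.Eventually.of_forall fun x z hz => ?_
    have hz1 : ‖z‖ ≤ ‖z₀‖ + 1 := by
      have h := mem_ball_iff_norm.1 hz
      calc ‖z‖ = ‖(z - z₀) + z₀‖ := by rw [sub_add_cancel]
        _ ≤ ‖z - z₀‖ + ‖z₀‖ := norm_add_le _ _
        _ ≤ ‖z₀‖ + 1 := by linarith
    rw [norm_mul, norm_neg, hK]
    refine mul_le_mul ?_ ?_ (norm_nonneg _) (by positivity)
    · calc ‖(S x : ℂ) + 2 * z * (T x : ℂ)‖ ≤ ‖(S x : ℂ)‖ + ‖2 * z * (T x : ℂ)‖ := norm_add_le _ _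
        _ = |S x| + 2 * ‖z‖ * |T x| := by
            rw [norm_mul, norm_mul, Complex.norm_real, Complex.norm_real, Real.norm_eq_abs, Real.norm_eq_abs,
              Complex.norm_two]
        _ ≤ S₀ + 2 * (‖z₀‖ + 1) * T₀ :=
            add_le_add (hS₀ x) (mul_le_mul (by linarith) (hT₀ x) (abs_nonneg _) (by positivity))
    · rw [Complex.norm_exp, Complex.neg_re]
      exact Real.exp_le_exp.2 (((neg_le_abs _).trans (abs_re_quadAction_le hS₀ hT₀ z x)).trans
        (quadBound_ball hS0 hT0 hz))
  have bound_integrable : Integrable (fun _ : Ω => K) μ := integrable_const K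
  have h_diff : ∀ᵐ x ∂μ, ∀ z ∈ Metric.ball z₀ 1,
      HasDerivAt (fun z => cexp (-(z * S x + z ^ 2 * T x)))
        (-((S x : ℂ) + 2 * z * (T x : ℂ)) * cexp (-(z * S x + z ^ 2 * T x))) z := by
    refine Filter.Eventually.of_forall fun x z _ => ?_
    have h1 : HasDerivAt (fun z : ℂ => -(z * (S x : ℂ) + z ^ 2 * (T x : ℂ)))
        (-(1 * (S x : ℂ) + (2 : ℕ) * z ^ (2 - 1) * (T x : ℂ))) z :=
      (((hasDerivAt_id z).mul_const (S x : ℂ)).add ((hasDerivAt_pow 2 z).mul_const (T x : ℂ))).neg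
    have h2 := h1.cexp
    rw [show -((S x : ℂ) + 2 * z * (T x : ℂ)) * cexp (-(z * S x + z ^ 2 * T x))
        = cexp (-(z * S x + z ^ 2 * T x)) * -(1 * (S x : ℂ) + (2 : ℕ) * z ^ (2 - 1) * (T x : ℂ)) by
          push_cast; ring]
    exact h2
  exact (hasDerivAt_integral_of_dominated_loc_of_deriv_le (Metric.ball_mem_nhds z₀ one_pos)
    hF_meas hF_int hF'_meas h_bound bound_integrable h_diff).2

/-- `Z₂` is an ENTIRE function of the complex coupling. [folklore] -/
theorem differentiable_partFn₂ [IsFiniteMeasure μ] {S T : Ω → ℝ} (hS : Measurable S) (hT : Measurable T)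
    {S₀ T₀ : ℝ} (hS₀ : ∀ x, |S x| ≤ S₀) (hT₀ : ∀ x, |T x| ≤ T₀) : Differentiable ℂ (partFn₂ μ S T) :=
  fun z => (hasDerivAt_partFn₂ hS hT hS₀ hT₀ z).differentiableAt

/-- THE LENS: `|Im z|·(S₀ + 2|Re z|·T₀) < π/2` — the zero-free region of the second-order family. [folklore] -/
def lensDom (S₀ T₀ : ℝ) : Set ℂ := {z | |z.im| * (S₀ + 2 * |z.re| * T₀) < Real.pi / 2}

/-- Membership unfolding. [folklore] -/
theorem mem_lensDom {S₀ T₀ : ℝ} {z : ℂ} : z ∈ lensDom S₀ T₀ ↔ |z.im| * (S₀ + 2 * |z.re| * T₀) < Real.pi / 2 := Iff.rfl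

/-- The lens is open. [folklore] -/
theorem isOpen_lensDom (S₀ T₀ : ℝ) : IsOpen (lensDom S₀ T₀) := by
  refine isOpen_lt ?_ continuous_const
  exact (continuous_abs.comp Complex.continuous_im).mul
    (continuous_const.add ((continuous_const.mul (continuous_abs.comp Complex.continuous_re)).mul continuous_const))

/-- Every REAL coupling lies in the lens. [folklore] -/
theorem ofReal_mem_lensDom (S₀ T₀ s : ℝ) : (s : ℂ) ∈ lensDom S₀ T₀ := by
  rw [mem_lensDom, Complex.ofReal_im, abs_zero, zero_mul]
  positivity

/-- With `T₀ = 0` the lens is the strip of §8. [folklore] -/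
theorem lensDom_zero_right (S₀ : ℝ) : lensDom S₀ 0 = stripDom S₀ := by
  ext z
  rw [mem_lensDom, mem_stripDom, mul_zero, add_zero]

/-- **`Re Z₂ > 0` ON THE LENS** (`re_cpartFn_pos` with `θ = |Im z|·(S₀ + 2|Re z|·T₀)`). [folklore] -/
theorem re_partFn₂_pos [IsProbabilityMeasure μ] {S T : Ω → ℝ} (hS : Measurable S) (hT : Measurable T) {S₀ T₀ : ℝ}
    (hS₀ : ∀ x, |S x| ≤ S₀) (hT₀ : ∀ x, |T x| ≤ T₀) {z : ℂ} (hz : |z.im| * (S₀ + 2 * |z.re| * T₀) < Real.pi / 2) :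
    0 < (partFn₂ μ S T z).re :=
  re_cpartFn_pos (measurable_quadAction hS hT z) (abs_re_quadAction_le hS₀ hT₀ z) (abs_im_quadAction_le hS₀ hT₀ z) hz

/-- `Z₂(z)` lies in the slit plane on the lens. [folklore] -/
theorem partFn₂_mem_slitPlane [IsProbabilityMeasure μ] {S T : Ω → ℝ} (hS : Measurable S) (hT : Measurable T)
    {S₀ T₀ : ℝ} (hS₀ : ∀ x, |S x| ≤ S₀) (hT₀ : ∀ x, |T x| ≤ T₀) {z : ℂ}
    (hz : |z.im| * (S₀ + 2 * |z.re| * T₀) < Real.pi / 2) : partFn₂ μ S T z ∈ slitPlane :=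
  Complex.mem_slitPlane_iff.2 (Or.inl (re_partFn₂_pos hS hT hS₀ hT₀ hz))

/-- **NO ZERO OF `Z₂` ON THE LENS.** [folklore] -/
theorem partFn₂_ne_zero [IsProbabilityMeasure μ] {S T : Ω → ℝ} (hS : Measurable S) (hT : Measurable T) {S₀ T₀ : ℝ}
    (hS₀ : ∀ x, |S x| ≤ S₀) (hT₀ : ∀ x, |T x| ≤ T₀) {z : ℂ} (hz : |z.im| * (S₀ + 2 * |z.re| * T₀) < Real.pi / 2) :
    partFn₂ μ S T z ≠ 0 :=
  Complex.slitPlane_ne_zero (partFn₂_mem_slitPlane hS hT hS₀ hT₀ hz)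

/-- **HOLOMORPHY OF `log Z₂` ON THE LENS.** [folklore] -/
theorem differentiableOn_logPartFn₂ [IsProbabilityMeasure μ] {S T : Ω → ℝ} (hS : Measurable S) (hT : Measurable T)
    {S₀ T₀ : ℝ} (hS₀ : ∀ x, |S x| ≤ S₀) (hT₀ : ∀ x, |T x| ≤ T₀) :
    DifferentiableOn ℂ (fun z => Complex.log (partFn₂ μ S T z)) (lensDom S₀ T₀) :=
  (differentiable_partFn₂ hS hT hS₀ hT₀).differentiableOn.clog fun _ hz => partFn₂_mem_slitPlane hS hT hS₀ hT₀ hz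

/-- **THE LENS BOUND `‖log Z₂(z)‖ ≤ |Re z|·S₀ + (Re z² + Im z²)·T₀ + log 2 + π/2` FOR `|Im z|·(S₀ + 2|Re z|·T₀) ≤ 1`**
(`norm_log_cpartFn_le`). [folklore] -/
theorem norm_logPartFn₂_le [IsProbabilityMeasure μ] {S T : Ω → ℝ} (hS : Measurable S) (hT : Measurable T)
    {S₀ T₀ : ℝ} (hS₀ : ∀ x, |S x| ≤ S₀) (hT₀ : ∀ x, |T x| ≤ T₀) {z : ℂ}
    (hz : |z.im| * (S₀ + 2 * |z.re| * T₀) ≤ 1) :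
    ‖Complex.log (partFn₂ μ S T z)‖ ≤ |z.re| * S₀ + (z.re ^ 2 + z.im ^ 2) * T₀ + (Real.log 2 + Real.pi / 2) :=
  norm_log_cpartFn_le (measurable_quadAction hS hT z) (abs_re_quadAction_le hS₀ hT₀ z)
    fun x => (abs_im_quadAction_le hS₀ hT₀ z x).trans hz

/-- At real couplings `log Z₂` is real: `Z₂(s) > 0` and `log Z₂(s) = Real.log (Re Z₂(s))`. [folklore] -/
theorem partFn₂_ofReal [IsProbabilityMeasure μ] {S T : Ω → ℝ} (hS : Measurable S) (hT : Measurable T) {S₀ T₀ : ℝ}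
    (hS₀ : ∀ x, |S x| ≤ S₀) (hT₀ : ∀ x, |T x| ≤ T₀) (s : ℝ) :
    partFn₂ μ S T (s : ℂ) = ((partFn₂ μ S T (s : ℂ)).re : ℂ) ∧ 0 < (partFn₂ μ S T (s : ℂ)).re := by
  have hpos : 0 < (partFn₂ μ S T (s : ℂ)).re :=
    re_partFn₂_pos hS hT hS₀ hT₀ (mem_lensDom.1 (ofReal_mem_lensDom S₀ T₀ s))
  refine ⟨?_, hpos⟩
  have him : (partFn₂ μ S T (s : ℂ)).im = 0 := by
    have hint := integrable_quadBoltzmann (μ := μ) hS hT hS₀ hT₀ (s : ℂ)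
    have h3 : (partFn₂ μ S T (s : ℂ)).im = ∫ x, (cexp (-((s : ℂ) * S x + (s : ℂ) ^ 2 * T x))).im ∂μ := by
      rw [partFn₂]
      simpa using (integral_im hint).symm
    rw [h3]
    refine integral_eq_zero_of_ae (Filter.Eventually.of_forall fun x => ?_)
    have h0 : ((s : ℂ) * (S x : ℂ) + (s : ℂ) ^ 2 * (T x : ℂ)).im = 0 := by
      rw [(quadAction_re_im (s : ℂ) (S x) (T x)).2, Complex.ofReal_im, zero_mul]
    simp only [Pi.zero_apply, Complex.exp_im, Complex.neg_im, h0, neg_zero, Real.sin_zero, mul_zero]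
  exact Complex.ext (by simp) (by simp [him])

end SecondOrder

section SecondOrderSharpness

/-- **THE LENS IS SHARP**: for `S = 0` and the two-point second-order coefficient `T = ±T₀` one has
`Z₂(z) = cosh(z²·T₀)`, which vanishes at `z₀ = (1 + i)·√(π/(4T₀))` — a point with `|Im z₀|·(0 + 2|Re z₀|·T₀) = π/2`
EXACTLY (the boundary of the lens). [folklore] -/
theorem partFn₂_twoPoint_zero {T₀ : ℝ} (hT₀ : 0 < T₀) :
    |((1 + I) * (Real.sqrt (Real.pi / (4 * T₀)) : ℝ)).im| *
        (0 + 2 * |((1 + I) * (Real.sqrt (Real.pi / (4 * T₀)) : ℝ)).re| * T₀) = Real.pi / 2 ∧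
      partFn₂ twoPoint (fun _ => 0) (twoPointAction T₀) ((1 + I) * (Real.sqrt (Real.pi / (4 * T₀)) : ℝ)) = 0 := by
  set a : ℝ := Real.sqrt (Real.pi / (4 * T₀)) with ha
  have ha2 : a ^ 2 = Real.pi / (4 * T₀) := by rw [ha, Real.sq_sqrt (by positivity)]
  have hapos : 0 < a := by rw [ha]; exact Real.sqrt_pos.2 (by positivity)
  have hre : ((1 + I) * (a : ℂ)).re = a := by simp [Complex.mul_re]
  have him : ((1 + I) * (a : ℂ)).im = a := by simp [Complex.mul_im]
  constructor
  · rw [hre, him, abs_of_pos hapos, zero_add]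
    calc a * (2 * a * T₀) = 2 * T₀ * a ^ 2 := by ring
      _ = Real.pi / 2 := by rw [ha2]; field_simp; ring
  · rw [partFn₂_zero_left]
    have hsq : ((1 + I) * (a : ℂ)) ^ 2 = I * (Real.pi / (2 * T₀) : ℝ) := by
      have h1 : ((1 + I) * (a : ℂ)) ^ 2 = 2 * I * (a : ℂ) ^ 2 := by ring_nf; rw [Complex.I_sq]; ring
      rw [h1, ← Complex.ofReal_pow, ha2]
      push_cast
      field_simp
      ring
    rw [hsq]
    exact (partFn_twoPoint_zero hT₀).2

end SecondOrderSharpness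

section CurrencySecondOrder

variable {Ω : Type*} [MeasurableSpace Ω] (C : Carriers) (Bg : Type)

/-- THE SECOND-ORDER LOG-LAYER MODEL FUNCTIONAL: on domains of positive scale `j`, `e^{−κ d(X)} · log Z₂(g_{j−1})`;
`0` on scale-0 domains. [folklore] -/
def logModel₂ (κ : ℝ) (μ : Measure Ω) (S T : Ω → ℝ) : Functional C Bg :=
  fun g _ X => if 0 < C.scale X then Real.exp (-(κ * C.d X)) * (Complex.log (partFn₂ μ S T (g (C.scale X - 1) : ℝ))).re
    else 0

/-- The second-order model is prefix-dependent on any window. [folklore] -/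
theorem logModel₂_prefix (κ : ℝ) (μ : Measure Ω) (S T : Ω → ℝ) (W : Set (ℕ → ℝ)) :
    PrefixDependenceOn (logModel₂ C Bg κ μ S T) W := by
  intro g _ g' _ U X hagree
  by_cases hX : 0 < C.scale X
  · simp only [logModel₂, if_pos hX, hagree (C.scale X - 1) (Nat.sub_lt hX one_pos)]
  · simp only [logModel₂, if_neg hX]

variable {C Bg}

/-- The model at a history, complexified: `e^{−κd(X)} · log Z₂(g_{j−1})` on positive scale (the log is real at real
couplings). [folklore] -/
theorem logModel₂_ofReal {μ : Measure Ω} [IsProbabilityMeasure μ] {S T : Ω → ℝ} (hS : Measurable S)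
    (hT : Measurable T) {S₀ T₀ : ℝ} (hS₀ : ∀ x, |S x| ≤ S₀) (hT₀ : ∀ x, |T x| ≤ T₀) (κ : ℝ) (g : ℕ → ℝ) (U : Bg)
    {X : C.Dom} (hX : 0 < C.scale X) :
    (logModel₂ C Bg κ μ S T g U X : ℂ) =
      (Real.exp (-(κ * C.d X)) : ℂ) * Complex.log (partFn₂ μ S T (g (C.scale X - 1) : ℝ)) := by
  obtain ⟨heq, hpos⟩ := partFn₂_ofReal (μ := μ) hS hT hS₀ hT₀ (g (C.scale X - 1))
  have hlog : Complex.log (partFn₂ μ S T (g (C.scale X - 1) : ℝ)) =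
      ((Complex.log (partFn₂ μ S T (g (C.scale X - 1) : ℝ))).re : ℂ) := by
    rw [heq, ← Complex.ofReal_log hpos.le]
    simp
  simp only [logModel₂, if_pos hX]
  rw [hlog]
  push_cast
  rfl

/-- **FULL COUPLING DISCS ABOUT `]0, γ]` FOR THE SECOND-ORDER MODEL, FOR EVERY `γ`**: `CouplingAnalyticOn ]0, γ]` with any
radius `r` such that `2r·(S₀ + 2(γ + 2r)·T₀) ≤ 1`, bound `M = (γ + 2r)·S₀ + ((γ + 2r)² + 4r²)·T₀ + log 2 + π/2`
(extension domain: the rectangle `|Im z| < 2r`, `|Re z| < γ + 2r`, inside the lens).  The radius is `≍ 1/(S₀ + γT₀)`: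
analyticity at every `γ`, uniformity of the radius in `γ` lost at second order. [folklore] -/
theorem logModel₂_couplingAnalyticOn {μ : Measure Ω} [IsProbabilityMeasure μ] {S T : Ω → ℝ} (hS : Measurable S)
    (hT : Measurable T) {S₀ T₀ : ℝ} (hS₀ : ∀ x, |S x| ≤ S₀) (hT₀ : ∀ x, |T x| ≤ T₀) (κ : ℝ) {γ r : ℝ} (hr : 0 < r)
    (hrST : 2 * r * (S₀ + 2 * (γ + 2 * r) * T₀) ≤ 1) :
    CouplingAnalyticOn (Set.Ioc 0 γ) (logModel₂ C Bg κ μ S T) κ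
      ((γ + 2 * r) * S₀ + ((γ + 2 * r) ^ 2 + 4 * r ^ 2) * T₀ + (Real.log 2 + Real.pi / 2)) (fun _ _ => r) := by
  have hS0 : 0 ≤ S₀ := actionBound_nonneg μ hS₀
  have hT0 : 0 ≤ T₀ := actionBound_nonneg μ hT₀
  have hlog2 : 0 < Real.log 2 := Real.log_pos one_lt_two
  intro U X h hh i hi
  have hX : 0 < C.scale X := lt_of_le_of_lt (Nat.zero_le i) hi
  have hγ : 0 < γ := (hh 0).1.trans_le (hh 0).2
  -- the bound inside the rectangle
  have hrect : ∀ z : ℂ, |z.im| < 2 * r → |z.re| < γ + 2 * r →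
      |z.im| * (S₀ + 2 * |z.re| * T₀) ≤ 1 ∧
        |z.re| * S₀ + (z.re ^ 2 + z.im ^ 2) * T₀ ≤ (γ + 2 * r) * S₀ + ((γ + 2 * r) ^ 2 + 4 * r ^ 2) * T₀ := by
    intro z hzi hzr
    have h1 : S₀ + 2 * |z.re| * T₀ ≤ S₀ + 2 * (γ + 2 * r) * T₀ := by nlinarith [abs_nonneg z.re]
    have h2 : 0 ≤ S₀ + 2 * |z.re| * T₀ := by positivity
    refine ⟨?_, ?_⟩
    · calc |z.im| * (S₀ + 2 * |z.re| * T₀) ≤ (2 * r) * (S₀ + 2 * (γ + 2 * r) * T₀) :=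
            mul_le_mul hzi.le h1 h2 (by positivity)
        _ ≤ 1 := by linarith
    · have hre2 : z.re ^ 2 ≤ (γ + 2 * r) ^ 2 := by
        have := abs_lt.1 hzr
        nlinarith
      have him2 : z.im ^ 2 ≤ 4 * r ^ 2 := by
        have := abs_lt.1 hzi
        nlinarith
      exact add_le_add (mul_le_mul_of_nonneg_right hzr.le hS0) (mul_le_mul_of_nonneg_right (by linarith) hT0)
  by_cases hlast : i = C.scale X - 1
  · subst hlast
    refine ⟨fun z => (Real.exp (-(κ * C.d X)) : ℂ) * Complex.log (partFn₂ μ S T z),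
      {z | |z.im| < 2 * r ∧ |z.re| < γ + 2 * r}, ?_, ?_, ?_, ?_⟩
    · refine (differentiableOn_const _).mul ((differentiableOn_logPartFn₂ hS hT hS₀ hT₀).mono ?_)
      rintro z ⟨hz1, hz2⟩
      rw [mem_lensDom]
      exact lt_of_le_of_lt (hrect z hz1 hz2).1 (by linarith [Real.pi_gt_three])
    · rintro z ⟨hz1, hz2⟩
      have hb := norm_logPartFn₂_le (μ := μ) hS hT hS₀ hT₀ (hrect z hz1 hz2).1
      have hb' : ‖Complex.log (partFn₂ μ S T z)‖ ≤
          (γ + 2 * r) * S₀ + ((γ + 2 * r) ^ 2 + 4 * r ^ 2) * T₀ + (Real.log 2 + Real.pi / 2) :=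
        hb.trans (by linarith [(hrect z hz1 hz2).2])
      rw [norm_mul, Complex.norm_real, Real.norm_eq_abs, abs_of_pos (Real.exp_pos _), mul_comm]
      exact mul_le_mul_of_nonneg_right hb' (Real.exp_pos _).le
    · intro s hs z hz
      rw [mem_closedBall, dist_eq_norm] at hz
      have him : |z.im| ≤ r := by
        have h1 : |(z - (s : ℂ)).im| ≤ ‖z - (s : ℂ)‖ := Complex.abs_im_le_norm _
        rw [Complex.sub_im, Complex.ofReal_im, sub_zero] at h1
        exact h1.trans hz
      have hre : |z.re| ≤ γ + r := by
        have h1 : |(z - (s : ℂ)).re| ≤ ‖z - (s : ℂ)‖ := Complex.abs_re_le_norm _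
        rw [Complex.sub_re, Complex.ofReal_re] at h1
        have h2 : |z.re| ≤ |z.re - s| + |s| := by
          calc |z.re| = |(z.re - s) + s| := by rw [sub_add_cancel]
            _ ≤ |z.re - s| + |s| := abs_add_le _ _
        rw [abs_of_pos hs.1] at h2
        linarith [hs.2]
      show |z.im| < 2 * r ∧ |z.re| < γ + 2 * r
      exact ⟨by linarith, by linarith⟩
    · intro s hs
      rw [logModel₂_ofReal hS hT hS₀ hT₀ κ _ U hX, Function.update_self]
  · refine ⟨fun _ => (logModel₂ C Bg κ μ S T h U X : ℂ), univ, differentiableOn_const _, ?_, fun _ _ => subset_univ _, ?_⟩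
    · intro z _
      rw [Complex.norm_real, Real.norm_eq_abs]
      have hs := hh (C.scale X - 1)
      have h0 := hrect ((h (C.scale X - 1) : ℝ) : ℂ) (by rw [Complex.ofReal_im, abs_zero]; positivity)
        (by rw [Complex.ofReal_re, abs_of_pos hs.1]; linarith [hs.2])
      have hb := (norm_logPartFn₂_le (μ := μ) hS hT hS₀ hT₀ h0.1).trans (by linarith [h0.2] :
        |((h (C.scale X - 1) : ℝ) : ℂ).re| * S₀ + ((((h (C.scale X - 1) : ℝ) : ℂ).re) ^ 2 +
          (((h (C.scale X - 1) : ℝ) : ℂ).im) ^ 2) * T₀ + (Real.log 2 + Real.pi / 2) ≤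
          (γ + 2 * r) * S₀ + ((γ + 2 * r) ^ 2 + 4 * r ^ 2) * T₀ + (Real.log 2 + Real.pi / 2))
      have hnorm : |logModel₂ C Bg κ μ S T h U X| =
          Real.exp (-(κ * C.d X)) * ‖Complex.log (partFn₂ μ S T (h (C.scale X - 1) : ℝ))‖ := by
        rw [← Real.norm_eq_abs, ← Complex.norm_real, logModel₂_ofReal hS hT hS₀ hT₀ κ h U hX, norm_mul,
          Complex.norm_real, Real.norm_eq_abs, abs_of_pos (Real.exp_pos _)]
      rw [hnorm, mul_comm]
      exact mul_le_mul_of_nonneg_right hb (Real.exp_pos _).le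
    · intro s hs
      have hne : C.scale X - 1 ≠ i := fun h' => hlast h'.symm
      simp only [logModel₂, if_pos hX, Function.update_of_ne hne]

/-- **THE g-FORM OF NE9 FOR THE SECOND-ORDER MODEL ON EVERY WINDOW `]0, γ]`, BY NAME** (`ne9_of_couplingAnalyticOn`;
radius `r` with `2r·(S₀ + 2(γ + 2r)·T₀) ≤ 1`, moduli `4M/r`). [folklore] -/
theorem ne9_logModel₂ {μ : Measure Ω} [IsProbabilityMeasure μ] {S T : Ω → ℝ} (hS : Measurable S) (hT : Measurable T)
    {S₀ T₀ : ℝ} (hS₀ : ∀ x, |S x| ≤ S₀) (hT₀ : ∀ x, |T x| ≤ T₀) (κ : ℝ) {γ r : ℝ} (hr : 0 < r)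
    (hrST : 2 * r * (S₀ + 2 * (γ + 2 * r) * T₀) ≤ 1) :
    NE9 (logModel₂ C Bg κ μ S T) (Window γ) κ
      (fun _ _ => 4 * ((γ + 2 * r) * S₀ + ((γ + 2 * r) ^ 2 + 4 * r ^ 2) * T₀ + (Real.log 2 + Real.pi / 2)) / r) := by
  rw [window_eq_boxWindow]
  exact ne9_of_couplingAnalyticOn Set.ordConnected_Ioc (fun _ _ _ => hr) (logModel₂_prefix C Bg κ μ S T _)
    (logModel₂_couplingAnalyticOn hS hT hS₀ hT₀ κ hr hrST)

end CurrencySecondOrder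

/-! ## §10 (v1.4, APPEND-ONLY)  NECESSITY IN THE CURRENCY: a coupling-analyticity radius `ρ` at ANY step forces
`ρ·S₀ ≤ π/2` over the class `|S| ≤ S₀` — uniform discs along the hierarchy ⟺ a k-uniform per-unit action bound

WHAT THIS SHOWS [analysis, folklore].  §8 is the SUFFICIENCY half of G-ne9p1-13 in the lineage currency: a per-unit
first-order action bound `S₀` gives `CouplingAnalyticOn ]0, γ] (logModel …) κ M (fun _ _ ↦ r)` for every radius
`r < 1/S₀`.  This section is the NECESSITY half, kernel-checked on the two-point member of the class: if the two-point
log-layer model with levels `±S₀` (`Z(z) = cosh(z·S₀)`, §5) satisfies `CouplingAnalyticOn ]0, γ] … κ M r` for SOME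
bound `M` and SOME radius table `r`, then at every localisation domain `X` of positive scale `k` the radius of the last
coupling obeys `r k (k−1) · S₀ ≤ π/2` (**`radius_mul_actionBound_le_of_couplingAnalyticOn`**); equivalently
(**`not_couplingAnalyticOn_twoPoint`**) NO bound `M` whatsoever rescues a radius `ρ > π/(2S₀)`.  The proof is the
identity theorem, not a size estimate: a holomorphic `F` on a disc of radius `ρ` about a small real coupling `s`
agreeing with `e^{−κd}·log cosh(t·S₀)` at the real couplings `t ∈ ]0, γ]` exponentiates to a holomorphic
`G = exp(e^{κd}·F)` agreeing with the ENTIRE function `cosh(z·S₀)` on a set accumulating at `s`, hence on the whole disc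
(Mathlib `AnalyticOnNhd.eqOn_of_preconnected_of_frequently_eq`) — but the disc contains the Lee–Yang zero
`iπ/(2S₀)` of `cosh(z·S₀)` (§5 `partFn_twoPoint_zero`), where `G = exp(…)` cannot vanish.  READING for the cell
(G-ne9p1-13, class located-unprinted UNCHANGED): in the model class the located-unprinted input is now TWO-SIDED —
radii `r(k) ≥ ρ > 0` UNIFORM IN THE STEP k (what `ne9_of_couplingAnalyticOn` consumes to give k-uniform NE9 moduli
`4M/ρ`) exist IF (`ρ·S₀(k) < 1`, §8) and ONLY IF (`ρ·S₀(k) ≤ π/2`, this section) the per-unit first-order action bounds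
`S₀(k)` are bounded uniformly in k (the two constants `1` and `π/2` differ only through the sub-strip `|Im z|·S₀ ≤ 1`
on which §8 bounds `log Z`).  MODEL statement only; nothing is asserted about Bałaban's functionals; HONEST FRAMING as
in the header; NOT summit progress. -/

section Necessity

variable {C : Carriers} {Bg : Type}

/-- The real partition function of the two-point model is `cosh(s·S₀)`. [folklore] -/
theorem partFnR_twoPoint (S₀ s : ℝ) : partFnR twoPoint (twoPointAction S₀) s = Real.cosh (s * S₀) := by
  have h := partFn_twoPoint S₀ (s : ℂ)
  rw [partFn_ofReal] at h
  exact_mod_cast h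

/-- The two-point log-layer model at a real history on a positive-scale domain: `e^{−κd(X)}·log cosh(g_{k−1}·S₀)`.
[folklore] -/
theorem logModel_twoPoint_apply (κ S₀ : ℝ) (g : ℕ → ℝ) (U : Bg) {X : C.Dom} (hX : 0 < C.scale X) :
    logModel C Bg κ twoPoint (twoPointAction S₀) g U X =
      Real.exp (-(κ * C.d X)) * Real.log (Real.cosh (g (C.scale X - 1) * S₀)) := by
  simp only [logModel, if_pos hX, partFnR_twoPoint]

/-- **NECESSITY OF THE ACTION BOUND FOR A COUPLING-ANALYTICITY RADIUS** (two-point member of the class `|S| ≤ S₀`):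
if the two-point log-layer model is `CouplingAnalyticOn ]0, γ]` with radius table `r` (ANY bound `M`), then at every
domain of positive scale `k` the radius of the last coupling satisfies `r k (k−1) · S₀ ≤ π/2`.  Identity theorem +
the Lee–Yang zero `iπ/(2S₀)`. [folklore] -/
theorem radius_mul_actionBound_le_of_couplingAnalyticOn {S₀ : ℝ} (hS₀ : 0 < S₀) {κ M γ : ℝ} (hγ : 0 < γ)
    {r : ℕ → ℕ → ℝ} (hA : CouplingAnalyticOn (Set.Ioc 0 γ) (logModel C Bg κ twoPoint (twoPointAction S₀)) κ M r)
    (U : Bg) {X : C.Dom} (hX : 0 < C.scale X) :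
    r (C.scale X) (C.scale X - 1) * S₀ ≤ Real.pi / 2 := by
  rw [← not_lt]
  intro hlt
  set ρ : ℝ := r (C.scale X) (C.scale X - 1) with hρdef
  set a : ℝ := Real.pi / (2 * S₀) with hadef
  have ha_pos : 0 < a := by positivity
  have haρ : a < ρ := by
    rw [hadef, div_lt_iff₀ (by positivity)]
    nlinarith
  have hρ_pos : 0 < ρ := ha_pos.trans haρ
  -- the constant history `γ` lies in the box window
  have hh : (fun _ : ℕ => γ) ∈ BoxWindow (Set.Ioc 0 γ) := fun _ => ⟨hγ, le_rfl⟩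
  obtain ⟨F, D, hF, -, hball, hreal⟩ := hA U X (fun _ => γ) hh (C.scale X - 1) (Nat.sub_lt hX one_pos)
  -- a small real coupling `s` whose `ρ`-disc contains the zero `i a`
  set s : ℝ := min γ ((ρ - a) / 2) with hsdef
  have hs_pos : 0 < s := lt_min hγ (by linarith)
  have hs_le : s ≤ γ := min_le_left _ _
  have hs_mem : s ∈ Set.Ioc (0 : ℝ) γ := ⟨hs_pos, hs_le⟩
  have hs_small : s + a < ρ := by
    have : s ≤ (ρ - a) / 2 := min_le_right _ _
    linarith
  -- the open disc `B = ball s ρ ⊆ D`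
  have hBD : ball ((s : ℝ) : ℂ) ρ ⊆ D := ball_subset_closedBall.trans (hball s hs_mem)
  have hFB : AnalyticOnNhd ℂ F (ball ((s : ℝ) : ℂ) ρ) := (hF.mono hBD).analyticOnNhd isOpen_ball
  -- `G = exp(e^{κd}·F)` and `g = cosh(·S₀)`
  set G : ℂ → ℂ := fun z => cexp ((Real.exp (κ * C.d X) : ℂ) * F z) with hGdef
  set g : ℂ → ℂ := fun z => Complex.cosh (z * S₀) with hgdef
  have hG : AnalyticOnNhd ℂ G (ball ((s : ℝ) : ℂ) ρ) :=
    (((hF.mono hBD).const_mul _).cexp).analyticOnNhd isOpen_ball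
  have hg : AnalyticOnNhd ℂ g (ball ((s : ℝ) : ℂ) ρ) :=
    ((Complex.differentiable_cosh.comp (differentiable_id.mul_const (S₀ : ℂ))).differentiableOn).analyticOnNhd
      isOpen_ball
  -- `G = g` at every real coupling `t ∈ ]0, γ]`
  have hGg : ∀ t ∈ Set.Ioc (0 : ℝ) γ, G (t : ℂ) = g (t : ℂ) := by
    intro t ht
    have hFt := hreal t ht
    rw [logModel_twoPoint_apply κ S₀ _ U hX, Function.update_self] at hFt
    have hcosh : 0 < Real.cosh (t * S₀) := Real.cosh_pos _
    simp only [hGdef, hgdef, hFt]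
    rw [← Complex.ofReal_mul, ← mul_assoc, ← Real.exp_add, add_neg_cancel, Real.exp_zero, one_mul,
      ← Complex.ofReal_exp, Real.exp_log hcosh, Complex.ofReal_cosh, Complex.ofReal_mul]
  -- they agree frequently near `s` (punctured), via real couplings `t ↑ s`
  have hfreq : ∃ᶠ z in nhdsWithin ((s : ℝ) : ℂ) {((s : ℝ) : ℂ)}ᶜ, G z = g z := by
    rw [Filter.frequently_iff]
    intro V hV
    obtain ⟨ε, hε, hVsub⟩ := Metric.mem_nhdsWithin_iff.1 hV
    set δ : ℝ := min (ε / 2) (s / 2) with hδdef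
    have hδ_pos : 0 < δ := lt_min (by linarith) (by linarith)
    have hδε : δ < ε := (min_le_left _ _).trans_lt (by linarith)
    have hδs : δ ≤ s / 2 := min_le_right _ _
    have ht_mem : (s - δ) ∈ Set.Ioc (0 : ℝ) γ := ⟨by linarith, by linarith⟩
    refine ⟨((s - δ : ℝ) : ℂ), hVsub ⟨?_, ?_⟩, hGg _ ht_mem⟩
    · rw [mem_ball, Complex.dist_eq, ← Complex.ofReal_sub, Complex.norm_real, Real.norm_eq_abs]
      rw [show s - δ - s = -δ by ring, abs_neg, abs_of_pos hδ_pos]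
      exact hδε
    · rw [mem_compl_iff, mem_singleton_iff, Complex.ofReal_inj]
      linarith
  -- identity theorem on the disc
  have hEq : EqOn G g (ball ((s : ℝ) : ℂ) ρ) :=
    hG.eqOn_of_preconnected_of_frequently_eq hg (convex_ball _ _).isPreconnected (mem_ball_self hρ_pos) hfreq
  -- the Lee–Yang zero lies in the disc
  have hz₀ : (I * (a : ℂ)) ∈ ball ((s : ℝ) : ℂ) ρ := by
    rw [mem_ball, Complex.dist_eq]
    calc ‖I * (a : ℂ) - (s : ℂ)‖ ≤ ‖I * (a : ℂ)‖ + ‖(s : ℂ)‖ := norm_sub_le _ _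
      _ = a + s := by
          rw [norm_mul, Complex.norm_I, one_mul, Complex.norm_real, Complex.norm_real, Real.norm_eq_abs,
            Real.norm_eq_abs, abs_of_pos ha_pos, abs_of_pos hs_pos]
      _ < ρ := by linarith
  have hzero : g (I * (a : ℂ)) = 0 := by
    simp only [hgdef, hadef]
    exact (partFn_twoPoint S₀ _ ▸ (partFn_twoPoint_zero hS₀).2)
  have hne : G (I * (a : ℂ)) ≠ 0 := Complex.exp_ne_zero _
  exact hne ((hEq hz₀).trans hzero)

/-- **NO BOUND `M` RESCUES A RADIUS BEYOND `π/(2S₀)`**: for the two-point log-layer model, a radius table exceeding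
`π/(2S₀)` at the last coupling of some positive-scale domain is incompatible with `CouplingAnalyticOn ]0, γ]`, whatever
`κ`, `M`. [folklore] -/
theorem not_couplingAnalyticOn_twoPoint {S₀ : ℝ} (hS₀ : 0 < S₀) (κ M : ℝ) {γ : ℝ} (hγ : 0 < γ) (U : Bg) {X : C.Dom}
    (hX : 0 < C.scale X) {r : ℕ → ℕ → ℝ} (hr : Real.pi / 2 < r (C.scale X) (C.scale X - 1) * S₀) :
    ¬ CouplingAnalyticOn (Set.Ioc 0 γ) (logModel C Bg κ twoPoint (twoPointAction S₀)) κ M r :=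
  fun hA => (not_lt.2 (radius_mul_actionBound_le_of_couplingAnalyticOn hS₀ hγ hA U hX)) hr

/-- **TWO-SIDED FORM OF G-ne9p1-13 IN THE MODEL CLASS** (uniform radius `ρ`): the two-point model with per-unit action
bound `S₀` is `CouplingAnalyticOn ]0, γ]` with the uniform radius `ρ` for SOME bound `M` if `ρ·S₀ < 1` (§8, any member of
the class) and ONLY IF `ρ·S₀ ≤ π/2` (this section), on any carrier system possessing a positive-scale domain. [folklore] -/
theorem couplingAnalyticOn_twoPoint_iff_side {S₀ : ℝ} (hS₀ : 0 < S₀) (κ : ℝ) {γ ρ : ℝ} (hγ : 0 < γ) (hρ : 0 < ρ)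
    (U : Bg) {X : C.Dom} (hX : 0 < C.scale X) :
    (ρ * S₀ < 1 → ∃ M, CouplingAnalyticOn (Set.Ioc 0 γ) (logModel C Bg κ twoPoint (twoPointAction S₀)) κ M
        (fun _ _ => ρ)) ∧
      ((∃ M, CouplingAnalyticOn (Set.Ioc 0 γ) (logModel C Bg κ twoPoint (twoPointAction S₀)) κ M (fun _ _ => ρ)) →
        ρ * S₀ ≤ Real.pi / 2) := by
  refine ⟨fun hρS => ⟨_, logModel_couplingAnalyticOn_strip (Measurable.of_discrete (f := twoPointAction S₀))
    (abs_twoPointAction_le hS₀.le) κ hρ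
    hρS⟩, ?_⟩
  rintro ⟨M, hA⟩
  exact radius_mul_actionBound_le_of_couplingAnalyticOn hS₀ hγ hA U hX

end Necessity

/-! ## §11 (v1.5, APPEND-ONLY)  NECESSITY FOR THE TARGET ESTIMATE ITSELF: on the model class, k-uniform NE9 moduli with
fading memory FORCE a k-uniform per-unit action bound — `S₀ ≤ C₉·ω + 2·log 2/γ` — under ANY proof technique

WHAT THIS SHOWS [analysis, folklore; technique-neutral].  §10 made G-ne9p1-13 two-sided for the INPUT of the Cauchy route
(`CouplingAnalyticOn` with a step-uniform radius).  This section removes the route: the TARGET shape itself — the g-form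
`T4OutputRate.NE9 E (Window γ) κ Λ` with `T4OutputRate.FadingMemory C₉ ω Λ` — already forces the per-unit first-order
action bound on the two-point member of the class `|S| ≤ S₀`.  Test histories: the constant history `γ` and the same
history with its LAST coupling halved; the NE9 sum then has the single non-zero term `Λ k (k−1)·γ/2`, while the activity
changes by `e^{−κd}·(log cosh(γS₀) − log cosh(γS₀/2)) ≥ e^{−κd}·(γS₀/2 − log 2)` (elementary: `x − log 2 ≤ log cosh x ≤ |x|`,
`log_cosh_ge_sub_log_two`, `log_cosh_le_abs`).  Hence **`actionBound_le_of_ne9_twoPoint`**: `S₀ − 2·log 2/γ ≤ Λ k (k−1)`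
at every positive-scale domain, and with fading memory (`Λ k (k−1) ≤ C₉·ω`) **`actionBound_le_of_ne9_fadingMemory_twoPoint`**:
`S₀ ≤ C₉·ω + 2·log 2/γ`.  READING for the cell (G-ne9p1-13, class located-unprinted UNCHANGED; MODEL statement only): in
the model class, k-UNIFORM NE9-with-fading-memory constants `(C₉, ω)` on a window of fixed length `γ` exist ONLY IF the
per-unit first-order action bounds `S₀(k)` are bounded uniformly in k — the located-unprinted input is necessary for the
ESTIMATE, not only for this lineage's route to it (§10) —; conversely §8 supplies them from such a bound.  Whether
Bałaban's activities under either cut-off scheme have k-uniform per-unit action is exactly what print (B12 p. 266) does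
not say; nothing here asserts they do not.  HONEST FRAMING as in the header; NOT summit progress. -/

section NecessityNE9

variable {C : Carriers} {Bg : Type}

/-- `x − log 2 ≤ log cosh x` (from `e^x/2 ≤ cosh x`). [folklore] -/
theorem log_cosh_ge_sub_log_two (x : ℝ) : x - Real.log 2 ≤ Real.log (Real.cosh x) := by
  have hcosh : Real.exp x / 2 ≤ Real.cosh x := by
    rw [Real.cosh_eq]
    linarith [Real.exp_pos (-x)]
  have h := Real.log_le_log (by positivity) hcosh
  rwa [Real.log_div (Real.exp_pos x).ne' two_ne_zero, Real.log_exp] at h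

/-- `log cosh y ≤ |y|` (from `cosh y ≤ e^{|y|}`). [folklore] -/
theorem log_cosh_le_abs (y : ℝ) : Real.log (Real.cosh y) ≤ |y| := by
  have hcosh : Real.cosh y ≤ Real.exp |y| := by
    rw [Real.cosh_eq]
    have h1 : Real.exp y ≤ Real.exp |y| := Real.exp_le_exp.2 (le_abs_self y)
    have h2 : Real.exp (-y) ≤ Real.exp |y| := Real.exp_le_exp.2 (neg_le_abs y)
    linarith
  have h := Real.log_le_log (Real.cosh_pos y) hcosh
  rwa [Real.log_exp] at h

/-- **THE NE9 MODULUS OF THE LAST COUPLING BOUNDS THE ACTION** (two-point member of the class `|S| ≤ S₀`): if the two-point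
log-layer model satisfies the g-form `NE9 … (Window γ) κ Λ`, then `S₀ − 2·log 2/γ ≤ Λ k (k−1)` at every domain of positive
scale `k` — test histories `γ` and `γ` with the last coupling halved. [folklore] -/
theorem actionBound_le_of_ne9_twoPoint {S₀ : ℝ} (hS₀ : 0 ≤ S₀) {κ γ : ℝ} (hγ : 0 < γ) {Λ : ℕ → ℕ → ℝ}
    (hN : NE9 (logModel C Bg κ twoPoint (twoPointAction S₀)) (Window γ) κ Λ) (U : Bg) {X : C.Dom}
    (hX : 0 < C.scale X) : S₀ - 2 * Real.log 2 / γ ≤ Λ (C.scale X) (C.scale X - 1) := by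
  set k := C.scale X with hkdef
  set g : ℕ → ℝ := fun _ => γ with hgdef
  set g' : ℕ → ℝ := Function.update g (k - 1) (γ / 2) with hg'def
  have hg : g ∈ Window γ := fun _ => ⟨hγ, le_rfl⟩
  have hg' : g' ∈ Window γ := by
    intro i
    by_cases hi : i = k - 1
    · subst hi
      simp only [hg'def, Function.update_self]
      constructor <;> linarith
    · simp only [hg'def, Function.update_of_ne hi, hgdef]
      exact ⟨hγ, le_rfl⟩
  have h := hN g hg g' hg' U X
  -- the NE9 sum has the single term `Λ k (k−1) · γ/2`
  have hsum : ∑ i ∈ Finset.range k, Λ k i * |g i - g' i| = Λ k (k - 1) * (γ / 2) := by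
    rw [Finset.sum_eq_single (k - 1)]
    · simp only [hg'def, hgdef, Function.update_self]
      rw [show γ - γ / 2 = γ / 2 by ring, abs_of_pos (by linarith)]
    · intro i _ hi
      simp only [hg'def, Function.update_of_ne hi, hgdef, sub_self, abs_zero, mul_zero]
    · intro hk
      exact absurd (Finset.mem_range.2 (Nat.sub_lt hX one_pos)) hk
  -- the two activities
  have hE : logModel C Bg κ twoPoint (twoPointAction S₀) g U X =
      Real.exp (-(κ * C.d X)) * Real.log (Real.cosh (γ * S₀)) := by
    rw [logModel_twoPoint_apply κ S₀ g U hX]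
  have hE' : logModel C Bg κ twoPoint (twoPointAction S₀) g' U X =
      Real.exp (-(κ * C.d X)) * Real.log (Real.cosh (γ / 2 * S₀)) := by
    rw [logModel_twoPoint_apply κ S₀ g' U hX]
    simp only [hg'def, ← hkdef, Function.update_self]
  rw [hE, hE', hsum] at h
  have hexp : 0 < Real.exp (-(κ * C.d X)) := Real.exp_pos _
  -- lower bound on the change of activity
  have hlow : Real.exp (-(κ * C.d X)) * (γ * S₀ / 2 - Real.log 2) ≤
      Real.exp (-(κ * C.d X)) * (Λ k (k - 1) * (γ / 2)) := by
    have h1 := log_cosh_ge_sub_log_two (γ * S₀)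
    have h2 := log_cosh_le_abs (γ / 2 * S₀)
    rw [abs_of_nonneg (by positivity)] at h2
    have h3 : Real.exp (-(κ * C.d X)) * (γ * S₀ / 2 - Real.log 2) ≤
        Real.exp (-(κ * C.d X)) * Real.log (Real.cosh (γ * S₀)) -
          Real.exp (-(κ * C.d X)) * Real.log (Real.cosh (γ / 2 * S₀)) := by
      rw [← mul_sub]
      exact mul_le_mul_of_nonneg_left (by linarith) hexp.le
    exact h3.trans ((le_abs_self _).trans h)
  have h4 : γ * S₀ / 2 - Real.log 2 ≤ Λ k (k - 1) * (γ / 2) := le_of_mul_le_mul_left hlow hexp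
  have h6 : S₀ - 2 * Real.log 2 / γ = (γ * S₀ / 2 - Real.log 2) * (2 / γ) := by
    field_simp
  rw [h6]
  calc (γ * S₀ / 2 - Real.log 2) * (2 / γ) ≤ Λ k (k - 1) * (γ / 2) * (2 / γ) :=
        mul_le_mul_of_nonneg_right h4 (by positivity)
    _ = Λ k (k - 1) := by
        field_simp

/-- **k-UNIFORM NE9-WITH-FADING-MEMORY CONSTANTS FORCE A k-UNIFORM ACTION BOUND** (two-point member): `NE9 … (Window γ) κ Λ`
together with `FadingMemory C₉ ω Λ` gives `S₀ ≤ C₉·ω + 2·log 2/γ` on any carrier system with a positive-scale domain — the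
located-unprinted input of G-ne9p1-13 is NECESSARY FOR THE TARGET ESTIMATE on the model class, under any proof technique.
[folklore] -/
theorem actionBound_le_of_ne9_fadingMemory_twoPoint {S₀ : ℝ} (hS₀ : 0 ≤ S₀) {κ γ : ℝ} (hγ : 0 < γ) {Λ : ℕ → ℕ → ℝ}
    {C₉ ω : ℝ} (hN : NE9 (logModel C Bg κ twoPoint (twoPointAction S₀)) (Window γ) κ Λ) (hF : FadingMemory C₉ ω Λ)
    (U : Bg) {X : C.Dom} (hX : 0 < C.scale X) : S₀ ≤ C₉ * ω + 2 * Real.log 2 / γ := by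
  have h1 := actionBound_le_of_ne9_twoPoint hS₀ hγ hN U hX
  have h2 := (hF (C.scale X) (C.scale X - 1) (Nat.sub_le _ _)).2
  rw [show C.scale X - (C.scale X - 1) = 1 by omega, pow_one] at h2
  linarith

/-- Contrapositive, the form the cell's row uses: if `S₀ > C₉·ω + 2·log 2/γ`, the two-point model with action bound `S₀`
admits NO modulus table `Λ` with `NE9 … (Window γ) κ Λ ∧ FadingMemory C₉ ω Λ`. [folklore] -/
theorem not_ne9_fadingMemory_twoPoint {S₀ : ℝ} (hS₀ : 0 ≤ S₀) (κ : ℝ) {γ : ℝ} (hγ : 0 < γ) {C₉ ω : ℝ}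
    (hbig : C₉ * ω + 2 * Real.log 2 / γ < S₀) (U : Bg) {X : C.Dom} (hX : 0 < C.scale X) :
    ¬ ∃ Λ : ℕ → ℕ → ℝ, NE9 (logModel C Bg κ twoPoint (twoPointAction S₀)) (Window γ) κ Λ ∧ FadingMemory C₉ ω Λ := by
  rintro ⟨Λ, hN, hF⟩
  exact (not_lt.2 (actionBound_le_of_ne9_fadingMemory_twoPoint hS₀ hγ hN hF U hX)) hbig

end NecessityNE9

/-! ## §12 (v1.6, APPEND-ONLY)  THE NODE'S JOINT SHAPE `NE9 ∧ FadingMemory` ON THE MODEL CLASS: realised by every member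
from a per-unit action bound (memory length one), and — with §11 — realised with k-UNIFORM constants iff the per-unit
action bounds are k-uniform

WHAT THIS SHOWS [analysis, folklore].  The node text asks for NE9 *jointly with fading memory*.  §8 delivers `NE9` for the
model with the CONSTANT modulus table `4M/r` (every past coupling charged), which is NOT of fading-memory shape for `ω < 1`.
But the log-layer model reads only its LAST coupling, so the charge can be moved onto the last coordinate:
**`ne9_lastCoupling_of_ne9`** (any functional reading only the last coupling: `NE9 … Λ` ⇒ `NE9 … (lastOnly Λ)`, where
`lastOnly Λ k i = Λ k i` if `i = k − 1` and `0` otherwise), and a last-coordinate table built from a non-negative constant has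
fading memory with ANY rate `0 < ω ≤ 1` (**`fadingMemory_lastOnly_const`**, `C₉ = Λ₀/ω`).  Hence
**`ne9_and_fadingMemory_logModel`**: for every member of the class `|S| ≤ S₀` (`S₀ > 0`), every `κ`, `γ` and every
`ω ∈ ]0, 1]` there is a modulus table `Λ` with `NE9 (logModel …) (Window γ) κ Λ ∧ FadingMemory (Λ₀/ω) ω Λ`,
`Λ₀ = 8S₀(|γ|S₀ + 1 + log 2 + π/2)` (§8 `ne9_logModel_canonical` at `|γ|`; *[v1.8] DOCFIX D1 of XREAD C-ne9p1g9-7: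
`|γ|` for `γ`, literal agreement with the kernel statement — `γ` is unrestricted in this theorem; for `γ ≤ 0` the window is
empty and the constant is the one of `Window |γ|`*).  Together with §11
(`actionBound_le_of_ne9_fadingMemory_twoPoint`: on the two-point member `NE9 ∧ FadingMemory C₉ ω` forces
`S₀ ≤ C₉ω + 2log 2/γ`) the node's joint target shape is realised on the model class with constants `(C₉, ω)` UNIFORM IN
THE STEP if and only if the per-unit first-order action bounds are — G-ne9p1-13 stated for the exact node shape; class
located-unprinted UNCHANGED.  MODEL statements only; HONEST FRAMING as in the header; NOT summit progress. -/

section JointShape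

variable {C : Carriers} {Bg : Type}

/-- The modulus table charging only the LAST coupling `i = k − 1`. [folklore] -/
def lastOnly (Λ : ℕ → ℕ → ℝ) : ℕ → ℕ → ℝ := fun k i => if i = k - 1 then Λ k i else 0

/-- A functional READS ONLY ITS LAST COUPLING: on a domain of scale `k` its value depends on `g (k − 1)` alone. [folklore] -/
def LastCouplingOnly (E : Functional C Bg) : Prop :=
  ∀ (g g' : ℕ → ℝ) (U : Bg) (X : C.Dom), g (C.scale X - 1) = g' (C.scale X - 1) → E g U X = E g' U X

/-- The log-layer model reads only its last coupling. [folklore] -/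
theorem logModel_lastCouplingOnly {Ω : Type*} [MeasurableSpace Ω] (κ : ℝ) (μ : Measure Ω) (S : Ω → ℝ) :
    LastCouplingOnly (logModel C Bg κ μ S) := by
  intro g g' U X h
  by_cases hX : 0 < C.scale X
  · simp only [logModel, if_pos hX, h]
  · simp only [logModel, if_neg hX]

/-- **MOVING THE CHARGE ONTO THE LAST COUPLING**: for a functional reading only its last coupling, `NE9` with a table `Λ`
on a window `Window γ` implies `NE9` with `lastOnly Λ` (compare `g` with the history `g` updated at `k − 1` to
`g' (k − 1)`, which lies in the window and has the same activity as `g'`). [folklore] -/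
theorem ne9_lastCoupling_of_ne9 {E : Functional C Bg} (hE : LastCouplingOnly E) {γ κ : ℝ} {Λ : ℕ → ℕ → ℝ}
    (hN : NE9 E (Window γ) κ Λ) : NE9 E (Window γ) κ (lastOnly Λ) := by
  intro g hg g' hg' U X
  set k := C.scale X with hkdef
  set g'' : ℕ → ℝ := Function.update g (k - 1) (g' (k - 1)) with hg''def
  have hg'' : g'' ∈ Window γ := by
    intro i
    by_cases hi : i = k - 1
    · subst hi
      simp only [hg''def, Function.update_self]
      exact hg' _
    · simp only [hg''def, Function.update_of_ne hi]
      exact hg i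
  have hEq : E g' U X = E g'' U X := hE g' g'' U X (by simp only [hg''def, ← hkdef, Function.update_self])
  have h := hN g hg g'' hg'' U X
  rw [← hEq] at h
  refine h.trans (le_of_eq ?_)
  congr 1
  have hsum1 : ∑ i ∈ Finset.range k, Λ k i * |g i - g'' i| = ∑ i ∈ Finset.range k,
      (if i = k - 1 then Λ k i * |g i - g' i| else 0) := by
    refine Finset.sum_congr rfl fun i _ => ?_
    by_cases hi : i = k - 1
    · subst hi
      simp only [hg''def, Function.update_self, if_true]
    · simp only [hg''def, Function.update_of_ne hi, sub_self, abs_zero, mul_zero, if_neg hi]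
  have hsum2 : ∑ i ∈ Finset.range k, lastOnly Λ k i * |g i - g' i| = ∑ i ∈ Finset.range k,
      (if i = k - 1 then Λ k i * |g i - g' i| else 0) := by
    refine Finset.sum_congr rfl fun i _ => ?_
    by_cases hi : i = k - 1
    · simp only [lastOnly, if_pos hi]
    · simp only [lastOnly, if_neg hi, zero_mul]
  rw [hsum1, hsum2]

/-- A last-coordinate table built from a non-negative constant `Λ₀` has FADING MEMORY with any rate `0 < ω ≤ 1` and
constant `Λ₀/ω` (memory length one). [folklore] -/
theorem fadingMemory_lastOnly_const {Λ₀ ω : ℝ} (hΛ₀ : 0 ≤ Λ₀) (hω : 0 < ω) (hω1 : ω ≤ 1) :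
    FadingMemory (Λ₀ / ω) ω (lastOnly fun _ _ => Λ₀) := by
  intro k i hik
  have hC : 0 ≤ Λ₀ / ω := div_nonneg hΛ₀ hω.le
  by_cases hi : i = k - 1
  · simp only [lastOnly, if_pos hi]
    refine ⟨hΛ₀, ?_⟩
    subst hi
    rcases Nat.eq_zero_or_pos k with hk | hk
    · subst hk
      simp only [Nat.zero_sub, le_refl, tsub_eq_zero_of_le, pow_zero, mul_one]
      rw [le_div_iff₀ hω]
      nlinarith
    · rw [show k - (k - 1) = 1 by omega, pow_one, div_mul_cancel₀ _ hω.ne']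
  · simp only [lastOnly, if_neg hi]
    exact ⟨le_rfl, mul_nonneg hC (pow_nonneg hω.le _)⟩

/-- **THE NODE'S JOINT SHAPE ON THE MODEL CLASS**: for every member of the class `|S| ≤ S₀` (`S₀ > 0`), every `κ`, `γ`
and every rate `ω ∈ ]0, 1]`, the log-layer model admits a modulus table with `NE9 … (Window γ) κ Λ` AND
`FadingMemory (Λ₀/ω) ω Λ`, `Λ₀ = 8S₀(|γ|S₀ + 1 + log 2 + π/2)` *[v1.8 DOCFIX D1: `|γ|` — `γ` is unrestricted here]* — §8 BY
NAME (at `|γ|`, `Window γ ⊆ Window |γ|`) plus the last-coupling transfer. [folklore] -/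
theorem ne9_and_fadingMemory_logModel {Ω : Type*} [MeasurableSpace Ω] {μ : Measure Ω} [IsProbabilityMeasure μ]
    {S : Ω → ℝ} (hS : Measurable S) {S₀ : ℝ} (hS₀ : ∀ x, |S x| ≤ S₀) (h0 : 0 < S₀) (κ γ : ℝ) {ω : ℝ} (hω : 0 < ω)
    (hω1 : ω ≤ 1) :
    ∃ Λ : ℕ → ℕ → ℝ, NE9 (logModel C Bg κ μ S) (Window γ) κ Λ ∧
      FadingMemory (8 * S₀ * (|γ| * S₀ + 1 + (Real.log 2 + Real.pi / 2)) / ω) ω Λ := by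
  have hlog2 : 0 < Real.log 2 := Real.log_pos one_lt_two
  -- NE9 on `Window γ` with the canonical constant, monotone in `γ ↦ |γ|`
  have hN : NE9 (logModel C Bg κ μ S) (Window γ) κ (fun _ _ => 8 * S₀ * (|γ| * S₀ + 1 + (Real.log 2 + Real.pi / 2))) := by
    have h := ne9_logModel_canonical (C := C) (Bg := Bg) (μ := μ) hS hS₀ h0 κ |γ|
    intro g hg g' hg' U X
    have hW : Window γ ⊆ Window |γ| := fun f hf i => ⟨(hf i).1, (hf i).2.trans (le_abs_self γ)⟩
    exact h g (hW hg) g' (hW hg') U X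
  refine ⟨lastOnly fun _ _ => 8 * S₀ * (|γ| * S₀ + 1 + (Real.log 2 + Real.pi / 2)),
    ne9_lastCoupling_of_ne9 (logModel_lastCouplingOnly κ μ S) hN, fadingMemory_lastOnly_const ?_ hω hω1⟩
  have : 0 ≤ |γ| * S₀ := mul_nonneg (abs_nonneg γ) h0.le
  positivity

/-- **TWO-SIDED, FOR THE EXACT NODE SHAPE** (two-point member, fixed `γ > 0`, rate `ω ∈ ]0, 1]`): the joint shape
`∃ Λ, NE9 … (Window γ) κ Λ ∧ FadingMemory C₉ ω Λ` HOLDS with `C₉ = 8S₀(γS₀ + 1 + log 2 + π/2)/ω` and FAILS for every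
`C₉ < (S₀ − 2log 2/γ)/ω` — so constants `(C₉, ω)` uniform in the step exist on the model class iff the per-unit action
bounds are uniform in the step. [folklore] -/
theorem ne9_fadingMemory_twoPoint_two_sided {S₀ : ℝ} (h0 : 0 < S₀) (κ : ℝ) {γ : ℝ} (hγ : 0 < γ) {ω : ℝ} (hω : 0 < ω)
    (hω1 : ω ≤ 1) (U : Bg) {X : C.Dom} (hX : 0 < C.scale X) :
    (∃ Λ : ℕ → ℕ → ℝ, NE9 (logModel C Bg κ twoPoint (twoPointAction S₀)) (Window γ) κ Λ ∧
        FadingMemory (8 * S₀ * (γ * S₀ + 1 + (Real.log 2 + Real.pi / 2)) / ω) ω Λ) ∧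
      ∀ C₉ : ℝ, C₉ * ω + 2 * Real.log 2 / γ < S₀ →
        ¬ ∃ Λ : ℕ → ℕ → ℝ, NE9 (logModel C Bg κ twoPoint (twoPointAction S₀)) (Window γ) κ Λ ∧ FadingMemory C₉ ω Λ := by
  refine ⟨?_, fun C₉ hC₉ => not_ne9_fadingMemory_twoPoint h0.le κ hγ hC₉ U hX⟩
  have h := ne9_and_fadingMemory_logModel (C := C) (Bg := Bg) (μ := twoPoint)
    (Measurable.of_discrete (f := twoPointAction S₀)) (abs_twoPointAction_le h0.le) h0 κ γ hω hω1
  rwa [abs_of_pos hγ] at h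

end JointShape

/-! ## §13 (v1.7, APPEND-ONLY)  FADING MEMORY FROM THE CONTRACTION, BY CAUCHY — the MEMORY MODEL: activity
`e^{−κd(X)}·log Z(h_k)` of the EFFECTIVE COUPLING driven by the linear contracting flow `h_{k+1} = ω·h_k + g_k`,
`h_0 = 0` (`0 < ω < 1`); coupling discs of radius `r·ω^{−(k−1−i)}` in the coordinate `g_i` — the contraction ENLARGES
the disc in the older couplings —, hence NE9 moduli `Λ(k, i) = (4M/r)·ω^{k−1−i}`: fading memory AT THE CONTRACTION
RATE, from `ne9_of_couplingAnalyticOn` BY NAME; and the rate is SHARP under any technique: on the two-point member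
`NE9 ∧ FadingMemory C₉ ω₉` forces `S₀·tanh(γS₀/2)·ω^m ≤ C₉·ω₉^{m+1}` for every lag `m` below the scale, so `ω ≤ ω₉` on
carriers of unbounded scale

WHAT THIS SHOWS [analysis, folklore].  This is the unit's assigned mechanism — «Cauchy estimates give Lipschitz constants
with fading memory from the contraction» — in miniature, kernel-checked and two-sided.  §§2–12 model a log layer that
reads only its last coupling (memory length one, §12 caveat).  Here the activity reads the WHOLE history through the
effective coupling `h_k = ∑_{i<k} ω^{k−1−i} g_i` (`effCoupling`, `effCoupling_eq_sum`), the solution of the toy flow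
`h_{k+1} = ω·h_k + g_k` with contraction rate `ω`.  SUFFICIENCY (`memModel_couplingAnalyticOn`,
**`ne9_and_fadingMemory_memModel`**): for a real action `|S| ≤ S₀`, any `γ ≥ 0`, any radius `0 < r < 1/S₀` and any
`0 < ω < 1`, the memory model is `CouplingAnalyticOn ]0, γ]` with the bound `M = (γ/(1−ω) + 2r)·S₀ + log 2 + π/2` and
the radii `r(k, i) = r·ω^{−(k−1−i)}` — perturbing `g_i` by `z` moves `h_k` by `ω^{k−1−i}·z`, so the strip
`|Im h|·S₀ < π/2` of §8 is reached only at `|Im z| ≈ ω^{−(k−1−i)}` —, whence BY NAME `NE9 … (Window γ) κ Λ` with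
`Λ(k, i) = (4M/r)·ω^{k−1−i}` AND `FadingMemory (4M/(rω)) ω Λ`: the memory of the estimate fades at EXACTLY the
contraction rate, and the mechanism producing it is the growth of the Cauchy radii into the past.  NECESSITY
(**`rate_bound_of_ne9_fadingMemory_memModel_twoPoint`**, technique-free, two real test histories `g ≡ γ` and `g` with
`g_{k−1−m}` lowered to `γ/2`, mean-value bound `tanh b·(a − b) ≤ log cosh a − log cosh b`): on the two-point member ANY
`NE9 … (Window γ) κ Λ ∧ FadingMemory C₉ ω₉ Λ` (`0 ≤ ω ≤ 1`, `γ > 0`) satisfies `S₀·tanh(γS₀/2)·ω^m ≤ C₉·ω₉^{m+1}` for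
every lag `m < scale X`; hence (**`contractionRate_le_memoryRate`**) on a carrier system with domains of unbounded
scale `ω ≤ ω₉` — no estimate of the node's shape remembers less than the flow does —, and (`m = 0`)
`S₀·tanh(γS₀/2) ≤ C₉·ω₉` — the per-unit action bound is again forced.  `memModel_zero`: at `ω = 0` the memory model IS
the log-layer model of §2.  HONEST FRAMING: a MODEL (scalar linear flow, independent units behind `log Z`); nothing is
asserted about Bałaban's effective actions, whose flow is neither scalar nor linear; the wall [H-dil-N]/(W2)–(W5) of the
printed scheme is untouched; NOT summit progress. -/

section Memory

variable {C : Carriers} {Bg : Type} {Ω : Type*} [MeasurableSpace Ω]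

/-- THE EFFECTIVE COUPLING: `h_0 = 0`, `h_{k+1} = ω·h_k + g_k` — a linear contracting flow driven by the coupling
history. [folklore] -/
def effCoupling (ω : ℝ) (g : ℕ → ℝ) : ℕ → ℝ
  | 0 => 0
  | k + 1 => ω * effCoupling ω g k + g k

/-- `h_0 = 0`. [folklore] -/
@[simp] theorem effCoupling_zero (ω : ℝ) (g : ℕ → ℝ) : effCoupling ω g 0 = 0 := rfl

/-- The flow equation `h_{k+1} = ω·h_k + g_k`. [folklore] -/
theorem effCoupling_succ (ω : ℝ) (g : ℕ → ℝ) (k : ℕ) : effCoupling ω g (k + 1) = ω * effCoupling ω g k + g k := rfl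

/-- Closed form `h_k = ∑_{i<k} ω^{k−1−i}·g_i`. [folklore] -/
theorem effCoupling_eq_sum (ω : ℝ) (g : ℕ → ℝ) (k : ℕ) :
    effCoupling ω g k = ∑ i ∈ Finset.range k, ω ^ (k - 1 - i) * g i := by
  induction k with
  | zero => simp
  | succ k ih =>
    rw [effCoupling_succ, ih, Finset.sum_range_succ, Finset.mul_sum]
    congr 1
    · refine Finset.sum_congr rfl fun i hi => ?_
      rw [Finset.mem_range] at hi
      rw [← mul_assoc, ← pow_succ', show k - 1 - i + 1 = k + 1 - 1 - i by omega]
    · rw [show k + 1 - 1 - k = 0 by omega, pow_zero, one_mul]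

/-- At rate `ω = 0` the effective coupling is the last coupling. [folklore] -/
theorem effCoupling_rate_zero (g : ℕ → ℝ) {k : ℕ} (hk : 0 < k) : effCoupling 0 g k = g (k - 1) := by
  obtain ⟨k, rfl⟩ := Nat.exists_eq_succ_of_ne_zero hk.ne'
  rw [effCoupling_succ, zero_mul, zero_add, Nat.succ_sub_one]

/-- The effective coupling at scale `k` reads only the couplings below `k`. [folklore] -/
theorem effCoupling_congr {ω : ℝ} {g g' : ℕ → ℝ} {k : ℕ} (h : ∀ i < k, g i = g' i) :
    effCoupling ω g k = effCoupling ω g' k := by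
  rw [effCoupling_eq_sum, effCoupling_eq_sum]
  exact Finset.sum_congr rfl fun i hi => by rw [h i (Finset.mem_range.1 hi)]

/-- **Perturbing ONE past coupling moves the effective coupling by the CONTRACTED amount** `ω^{k−1−i}·(s − t)`.
[folklore] -/
theorem effCoupling_update_sub (ω : ℝ) (g : ℕ → ℝ) {k i : ℕ} (hi : i < k) (s t : ℝ) :
    effCoupling ω (Function.update g i s) k - effCoupling ω (Function.update g i t) k = ω ^ (k - 1 - i) * (s - t) := by
  rw [effCoupling_eq_sum, effCoupling_eq_sum, ← Finset.sum_sub_distrib]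
  have h : ∀ j ∈ Finset.range k,
      ω ^ (k - 1 - j) * Function.update g i s j - ω ^ (k - 1 - j) * Function.update g i t j =
        if j = i then ω ^ (k - 1 - i) * (s - t) else 0 := by
    intro j _
    by_cases hj : j = i
    · subst hj
      simp only [Function.update_self, if_true, mul_sub]
    · simp only [Function.update_of_ne hj, sub_self, if_neg hj]
  rw [Finset.sum_congr rfl h, Finset.sum_ite_eq', if_pos (Finset.mem_range.2 hi)]

/-- `|h_k| ≤ γ/(1 − ω)` for a history bounded by `γ`, `0 ≤ ω < 1` (uniformly in `k`: the flow contracts). [folklore] -/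
theorem abs_effCoupling_le {ω γ : ℝ} (hω0 : 0 ≤ ω) (hω1 : ω < 1) {g : ℕ → ℝ} (hg : ∀ i, |g i| ≤ γ) (k : ℕ) :
    |effCoupling ω g k| ≤ γ / (1 - ω) := by
  have hγ : 0 ≤ γ := (abs_nonneg _).trans (hg 0)
  have h1 : 0 < 1 - ω := by linarith
  induction k with
  | zero =>
    rw [effCoupling_zero, abs_zero]
    positivity
  | succ k ih =>
    rw [effCoupling_succ]
    calc |ω * effCoupling ω g k + g k| ≤ |ω * effCoupling ω g k| + |g k| := abs_add_le _ _
      _ = ω * |effCoupling ω g k| + |g k| := by rw [abs_mul, abs_of_nonneg hω0]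
      _ ≤ ω * (γ / (1 - ω)) + γ := add_le_add (mul_le_mul_of_nonneg_left ih hω0) (hg k)
      _ = γ / (1 - ω) := by
          field_simp
          ring

/-- A non-negative history gives a non-negative effective coupling (`0 ≤ ω`). [folklore] -/
theorem effCoupling_nonneg {ω : ℝ} (hω0 : 0 ≤ ω) {g : ℕ → ℝ} (hg : ∀ i, 0 ≤ g i) (k : ℕ) :
    0 ≤ effCoupling ω g k := by
  induction k with
  | zero => rw [effCoupling_zero]
  | succ k ih =>
    rw [effCoupling_succ]
    exact add_nonneg (mul_nonneg hω0 ih) (hg k)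

/-- For the constant history `γ ≥ 0` the effective coupling is at least `γ` from the first step on. [folklore] -/
theorem le_effCoupling_const {ω γ : ℝ} (hω0 : 0 ≤ ω) (hγ : 0 ≤ γ) {k : ℕ} (hk : 0 < k) :
    γ ≤ effCoupling ω (fun _ => γ) k := by
  obtain ⟨k, rfl⟩ := Nat.exists_eq_succ_of_ne_zero hk.ne'
  rw [effCoupling_succ]
  have h := effCoupling_nonneg hω0 (g := fun _ => γ) (fun _ => hγ) k
  nlinarith [mul_nonneg hω0 h]

variable (C Bg) in
/-- THE MEMORY MODEL: activity `e^{−κd(X)}·log Z(h_k(g))` of the effective coupling after `k = scale X` steps of the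
contracting flow, zero on scale `0`. [folklore] -/
def memModel (κ ω : ℝ) (μ : Measure Ω) (S : Ω → ℝ) : Functional C Bg :=
  fun g _ X => if 0 < C.scale X then
    Real.exp (-(κ * C.d X)) * Real.log (partFnR μ S (effCoupling ω g (C.scale X))) else 0

/-- At `ω = 0` the memory model IS the log-layer model of §2. [folklore] -/
theorem memModel_zero (κ : ℝ) (μ : Measure Ω) (S : Ω → ℝ) : memModel C Bg κ 0 μ S = logModel C Bg κ μ S := by
  funext g U X
  by_cases hX : 0 < C.scale X
  · simp only [memModel, logModel, if_pos hX, effCoupling_rate_zero g hX]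
  · simp only [memModel, logModel, if_neg hX]

/-- The memory model is prefix-dependent on any window. [folklore] -/
theorem memModel_prefix (κ ω : ℝ) (μ : Measure Ω) (S : Ω → ℝ) (W : Set (ℕ → ℝ)) :
    PrefixDependenceOn (memModel C Bg κ ω μ S) W := by
  intro g _ g' _ U X hagree
  by_cases hX : 0 < C.scale X
  · simp only [memModel, if_pos hX, effCoupling_congr (ω := ω) hagree]
  · simp only [memModel, if_neg hX]

/-- The memory model, complexified, on positive scale. [folklore] -/
theorem memModel_ofReal {μ : Measure Ω} [IsProbabilityMeasure μ] {S : Ω → ℝ} (hS : Measurable S) {S₀ : ℝ}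
    (hS₀ : ∀ x, |S x| ≤ S₀) (κ ω : ℝ) (g : ℕ → ℝ) (U : Bg) {X : C.Dom} (hX : 0 < C.scale X) :
    (memModel C Bg κ ω μ S g U X : ℂ) =
      (Real.exp (-(κ * C.d X)) : ℂ) * logPartFn μ S (effCoupling ω g (C.scale X) : ℝ) := by
  rw [logPartFn_ofReal hS hS₀]
  simp only [memModel, if_pos hX]
  push_cast
  rfl

/-- **COUPLING DISCS GROWING INTO THE PAST**: for a real action `|S| ≤ S₀`, `0 < r`, `r·S₀ < 1`, `0 < ω < 1`, the
memory model is `CouplingAnalyticOn ]0, γ]` with the bound `M = (γ/(1−ω) + 2r)·S₀ + log 2 + π/2` and the radius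
`r·ω^{−(k−1−i)}` in the coordinate `g_i` (extension `z ↦ e^{−κd}·log Z(c + ω^{k−1−i}·z)` on the preimage of the §8 box).
[folklore] -/
theorem memModel_couplingAnalyticOn {μ : Measure Ω} [IsProbabilityMeasure μ] {S : Ω → ℝ} (hS : Measurable S)
    {S₀ : ℝ} (hS₀ : ∀ x, |S x| ≤ S₀) (κ : ℝ) {γ r ω : ℝ} (hr : 0 < r) (hrS : r * S₀ < 1) (hω0 : 0 < ω) (hω1 : ω < 1) :
    CouplingAnalyticOn (Set.Ioc 0 γ) (memModel C Bg κ ω μ S) κ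
      ((γ / (1 - ω) + 2 * r) * S₀ + (Real.log 2 + Real.pi / 2)) (fun k i => r / ω ^ (k - 1 - i)) := by
  have hS0 : 0 ≤ S₀ := actionBound_nonneg μ hS₀
  intro U X h hh i hi
  have hX : 0 < C.scale X := lt_of_le_of_lt (Nat.zero_le i) hi
  set k := C.scale X with hkdef
  set a : ℝ := ω ^ (k - 1 - i) with hadef
  set c : ℝ := effCoupling ω (Function.update h i 0) k with hcdef
  have ha : 0 < a := pow_pos hω0 _
  -- the effective coupling is affine in the coordinate `i`, with slope `a`
  have hlin : ∀ s : ℝ, effCoupling ω (Function.update h i s) k = c + a * s := by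
    intro s
    have h1 := effCoupling_update_sub ω h hi s 0
    rw [sub_zero] at h1
    linarith
  have hbox : ∀ s ∈ Set.Ioc (0 : ℝ) γ, |c + a * s| ≤ γ / (1 - ω) := by
    intro s hs
    rw [← hlin s]
    refine abs_effCoupling_le hω0.le hω1 (fun j => ?_) k
    by_cases hj : j = i
    · subst hj
      rw [Function.update_self, abs_of_pos hs.1]
      exact hs.2
    · rw [Function.update_of_ne hj, abs_of_pos (hh j).1]
      exact (hh j).2
  have him_eq : ∀ z : ℂ, (((c : ℝ) : ℂ) + ((a : ℝ) : ℂ) * z).im = a * z.im := by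
    intro z
    simp [Complex.add_im, Complex.mul_im]
  have hre_eq : ∀ z : ℂ, (((c : ℝ) : ℂ) + ((a : ℝ) : ℂ) * z).re = c + a * z.re := by
    intro z
    simp [Complex.add_re, Complex.mul_re]
  refine ⟨fun z => (Real.exp (-(κ * C.d X)) : ℂ) * logPartFn μ S ((c : ℂ) + (a : ℂ) * z),
    {z | |((c : ℂ) + (a : ℂ) * z).im| * S₀ < 1 ∧ |((c : ℂ) + (a : ℂ) * z).re| < γ / (1 - ω) + 2 * r},
    ?_, ?_, ?_, ?_⟩
  · refine (differentiableOn_const _).mul ?_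
    have haff : Differentiable ℂ fun z : ℂ => (c : ℂ) + (a : ℂ) * z :=
      (differentiable_const _).add ((differentiable_const _).mul differentiable_id)
    refine (differentiableOn_logPartFn_strip hS hS₀).comp haff.differentiableOn ?_
    rintro z ⟨hz1, -⟩
    show (c : ℂ) + (a : ℂ) * z ∈ stripDom S₀
    rw [mem_stripDom]
    exact lt_trans hz1 (by linarith [Real.pi_gt_three])
  · rintro z ⟨hz1, hz2⟩
    have hb := norm_logPartFn_le_strip (μ := μ) hS hS₀ hz1.le
    have hb' : ‖logPartFn μ S ((c : ℂ) + (a : ℂ) * z)‖ ≤ (γ / (1 - ω) + 2 * r) * S₀ + (Real.log 2 + Real.pi / 2) :=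
      hb.trans (by linarith [mul_le_mul_of_nonneg_right hz2.le hS0])
    rw [norm_mul, Complex.norm_real, Real.norm_eq_abs, abs_of_pos (Real.exp_pos _), mul_comm]
    exact mul_le_mul_of_nonneg_right hb' (Real.exp_pos _).le
  · intro s hs z hz
    rw [mem_closedBall, dist_eq_norm] at hz
    have him : |z.im| ≤ r / a := by
      have h1 : |(z - (s : ℂ)).im| ≤ ‖z - (s : ℂ)‖ := Complex.abs_im_le_norm _
      rw [Complex.sub_im, Complex.ofReal_im, sub_zero] at h1
      exact h1.trans hz
    have hre : |z.re - s| ≤ r / a := by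
      have h1 : |(z - (s : ℂ)).re| ≤ ‖z - (s : ℂ)‖ := Complex.abs_re_le_norm _
      rw [Complex.sub_re, Complex.ofReal_re] at h1
      exact h1.trans hz
    have hra : a * (r / a) = r := by field_simp
    show |((c : ℂ) + (a : ℂ) * z).im| * S₀ < 1 ∧ |((c : ℂ) + (a : ℂ) * z).re| < γ / (1 - ω) + 2 * r
    rw [him_eq, hre_eq]
    constructor
    · calc |a * z.im| * S₀ = a * |z.im| * S₀ := by rw [abs_mul, abs_of_pos ha]
        _ ≤ a * (r / a) * S₀ := mul_le_mul_of_nonneg_right (mul_le_mul_of_nonneg_left him ha.le) hS0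
        _ = r * S₀ := by rw [hra]
        _ < 1 := hrS
    · have h2 : |c + a * z.re| ≤ |c + a * s| + a * |z.re - s| := by
        calc |c + a * z.re| = |(c + a * s) + a * (z.re - s)| := by congr 1; ring
          _ ≤ |c + a * s| + |a * (z.re - s)| := abs_add_le _ _
          _ = |c + a * s| + a * |z.re - s| := by rw [abs_mul, abs_of_pos ha]
      have h3 : a * |z.re - s| ≤ r := by
        calc a * |z.re - s| ≤ a * (r / a) := mul_le_mul_of_nonneg_left hre ha.le
          _ = r := hra
      linarith [hbox s hs]
  · intro s hs
    rw [memModel_ofReal hS hS₀ κ ω _ U hX, hlin s]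
    simp only [Complex.ofReal_add, Complex.ofReal_mul]

/-- **FADING MEMORY AT THE CONTRACTION RATE, BY CAUCHY**: for a real action `|S| ≤ S₀`, `γ ≥ 0`, `0 < r`, `r·S₀ < 1`,
`0 < ω < 1`, the memory model satisfies `NE9 … (Window γ) κ Λ` with `Λ(k, i) = (4M/r)·ω^{k−1−i}` — BY NAME from
`ne9_of_couplingAnalyticOn` with the growing radii of `memModel_couplingAnalyticOn` — AND `FadingMemory (4M/(rω)) ω Λ`,
`M = (γ/(1−ω) + 2r)·S₀ + log 2 + π/2`. [folklore] -/
theorem ne9_and_fadingMemory_memModel {μ : Measure Ω} [IsProbabilityMeasure μ] {S : Ω → ℝ} (hS : Measurable S)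
    {S₀ : ℝ} (hS₀ : ∀ x, |S x| ≤ S₀) (κ : ℝ) {γ r ω : ℝ} (hγ : 0 ≤ γ) (hr : 0 < r) (hrS : r * S₀ < 1) (hω0 : 0 < ω)
    (hω1 : ω < 1) :
    NE9 (memModel C Bg κ ω μ S) (Window γ) κ
        (fun k i => 4 * ((γ / (1 - ω) + 2 * r) * S₀ + (Real.log 2 + Real.pi / 2)) / r * ω ^ (k - 1 - i)) ∧
      FadingMemory (4 * ((γ / (1 - ω) + 2 * r) * S₀ + (Real.log 2 + Real.pi / 2)) / r / ω) ω
        (fun k i => 4 * ((γ / (1 - ω) + 2 * r) * S₀ + (Real.log 2 + Real.pi / 2)) / r * ω ^ (k - 1 - i)) := by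
  set M := (γ / (1 - ω) + 2 * r) * S₀ + (Real.log 2 + Real.pi / 2) with hMdef
  have hS0 : 0 ≤ S₀ := actionBound_nonneg μ hS₀
  have h1ω : 0 < 1 - ω := by linarith
  have hM : 0 ≤ M := by
    have h1 : 0 ≤ γ / (1 - ω) := div_nonneg hγ h1ω.le
    have h2 : 0 < Real.log 2 := Real.log_pos one_lt_two
    have h3 : 0 ≤ (γ / (1 - ω) + 2 * r) * S₀ := mul_nonneg (by linarith) hS0
    linarith [Real.pi_gt_three]
  have hA : 0 ≤ 4 * M / r := by positivity
  constructor
  · have hΛ : (fun j i => 4 * M / (r / ω ^ (j - 1 - i))) = fun j i => 4 * M / r * ω ^ (j - 1 - i) := by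
      funext j i
      rw [div_div_eq_mul_div, div_mul_eq_mul_div]
    rw [window_eq_boxWindow, ← hΛ]
    exact ne9_of_couplingAnalyticOn Set.ordConnected_Ioc (fun j i _ => by positivity)
      (memModel_prefix (C := C) (Bg := Bg) κ ω μ S _) (memModel_couplingAnalyticOn hS hS₀ κ hr hrS hω0 hω1)
  · intro k i hik
    refine ⟨mul_nonneg hA (pow_nonneg hω0.le _), ?_⟩
    show 4 * M / r * ω ^ (k - 1 - i) ≤ 4 * M / r / ω * ω ^ (k - i)
    rcases Nat.lt_or_ge i k with hlt | hge
    · rw [show k - i = k - 1 - i + 1 by omega, pow_succ]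
      have hEq : 4 * M / r / ω * (ω ^ (k - 1 - i) * ω) = 4 * M / r * ω ^ (k - 1 - i) := by
        field_simp
      rw [hEq]
    · rw [show k - i = 0 by omega, show k - 1 - i = 0 by omega, pow_zero, mul_one, mul_one, le_div_iff₀ hω0]
      exact mul_le_of_le_one_right hA hω1.le

/-- Mean-value lower bound with a monotone slope: `tanh c·(a − b) ≤ log cosh a − log cosh b` for `c ≤ b ≤ a`
(`(log cosh)′ = tanh` is non-decreasing; the monotonicity of `tanh` is inlined from `sinh (y − x) ≥ 0`). [folklore] -/
theorem tanh_mul_sub_le_log_cosh_sub {a b c : ℝ} (hcb : c ≤ b) (hab : b ≤ a) :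
    Real.tanh c * (a - b) ≤ Real.log (Real.cosh a) - Real.log (Real.cosh b) := by
  have hmono : ∀ x y : ℝ, x ≤ y → Real.tanh x ≤ Real.tanh y := by
    intro x y h
    rw [Real.tanh_eq_sinh_div_cosh, Real.tanh_eq_sinh_div_cosh,
      div_le_div_iff₀ (Real.cosh_pos x) (Real.cosh_pos y)]
    have h1 : 0 ≤ Real.sinh (y - x) := Real.sinh_nonneg_iff.2 (by linarith)
    rw [Real.sinh_sub] at h1
    linarith
  rcases hab.eq_or_lt with h | hlt
  · rw [h, sub_self, mul_zero, sub_self]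
  have hderiv : ∀ x, HasDerivAt (fun y => Real.log (Real.cosh y)) (Real.tanh x) x := by
    intro x
    have h := (Real.hasDerivAt_cosh x).log (Real.cosh_pos x).ne'
    rwa [← Real.tanh_eq_sinh_div_cosh] at h
  obtain ⟨ξ, hξ, hslope⟩ := exists_hasDerivAt_eq_slope (fun y => Real.log (Real.cosh y)) Real.tanh hlt
    (fun x _ => (hderiv x).continuousAt.continuousWithinAt) (fun x _ => hderiv x)
  have hξb : Real.tanh c ≤ Real.tanh ξ := hmono _ _ (hcb.trans hξ.1.le)
  rw [hslope, le_div_iff₀ (sub_pos.2 hlt)] at hξb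
  exact hξb

/-- **THE RATE BOUND** (two-point member, technique-free): `NE9 … (Window γ) κ Λ ∧ FadingMemory C₉ ω₉ Λ` for the memory
model with `0 ≤ ω ≤ 1`, `γ > 0` forces `S₀·tanh(γS₀/2)·ω^m ≤ C₉·ω₉^{m+1}` for every lag `m < scale X` (test histories
`g ≡ γ` and `g` with `g_{k−1−m}` lowered to `γ/2`). [folklore] -/
theorem rate_bound_of_ne9_fadingMemory_memModel_twoPoint {S₀ : ℝ} (hS₀ : 0 ≤ S₀) {κ γ : ℝ} (hγ : 0 < γ) {ω : ℝ}
    (hω0 : 0 ≤ ω) (hω1 : ω ≤ 1) {Λ : ℕ → ℕ → ℝ}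
    (hN : NE9 (memModel C Bg κ ω twoPoint (twoPointAction S₀)) (Window γ) κ Λ) {C₉ ω₉ : ℝ}
    (hF : FadingMemory C₉ ω₉ Λ) (U : Bg) {X : C.Dom} {m : ℕ} (hm : m < C.scale X) :
    S₀ * Real.tanh (γ * S₀ / 2) * ω ^ m ≤ C₉ * ω₉ ^ (m + 1) := by
  set k := C.scale X with hkdef
  have hX : 0 < k := lt_of_le_of_lt (Nat.zero_le m) hm
  set i := k - 1 - m with hidef
  have hi : i < k := by omega
  have hki : k - i = m + 1 := by omega
  have hkim : k - 1 - i = m := by omega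
  set g : ℕ → ℝ := fun _ => γ with hgdef
  set g' : ℕ → ℝ := Function.update g i (γ / 2) with hg'def
  have hg : g ∈ Window γ := fun _ => ⟨hγ, le_rfl⟩
  have hg' : g' ∈ Window γ := by
    intro j
    by_cases hj : j = i
    · subst hj
      simp only [hg'def, Function.update_self]
      constructor <;> linarith
    · simp only [hg'def, Function.update_of_ne hj, hgdef]
      exact ⟨hγ, le_rfl⟩
  have h := hN g hg g' hg' U X
  have hsum : ∑ j ∈ Finset.range k, Λ k j * |g j - g' j| = Λ k i * (γ / 2) := by
    rw [Finset.sum_eq_single i]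
    · simp only [hg'def, hgdef, Function.update_self]
      rw [show γ - γ / 2 = γ / 2 by ring, abs_of_pos (by linarith)]
    · intro j _ hj
      simp only [hg'def, Function.update_of_ne hj, hgdef, sub_self, abs_zero, mul_zero]
    · intro hk
      exact absurd (Finset.mem_range.2 hi) hk
  -- the two effective couplings
  set H := effCoupling ω g k with hHdef
  set H' := effCoupling ω g' k with hH'def
  have hupd : Function.update g i γ = g := by
    funext j
    by_cases hj : j = i
    · subst hj
      rw [Function.update_self]
    · rw [Function.update_of_ne hj]
  have hHH' : H - H' = ω ^ m * (γ / 2) := by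
    have h1 := effCoupling_update_sub ω g hi γ (γ / 2)
    rw [hupd, hkim] at h1
    rw [h1]
    ring
  have hH : γ ≤ H := le_effCoupling_const hω0 hγ.le hX
  have hωm : ω ^ m ≤ 1 := pow_le_one₀ hω0 hω1
  have hωm0 : 0 ≤ ω ^ m := pow_nonneg hω0 m
  have hH' : γ / 2 ≤ H' := by nlinarith
  -- the two activities
  have hE : memModel C Bg κ ω twoPoint (twoPointAction S₀) g U X =
      Real.exp (-(κ * C.d X)) * Real.log (Real.cosh (H * S₀)) := by
    simp only [memModel, ← hkdef, if_pos hX, partFnR_twoPoint]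
    rfl
  have hE' : memModel C Bg κ ω twoPoint (twoPointAction S₀) g' U X =
      Real.exp (-(κ * C.d X)) * Real.log (Real.cosh (H' * S₀)) := by
    simp only [memModel, ← hkdef, if_pos hX, partFnR_twoPoint]
    rfl
  rw [hE, hE', hsum] at h
  have hexp : 0 < Real.exp (-(κ * C.d X)) := Real.exp_pos _
  -- mean-value lower bound on the change of activity
  have hgap : H * S₀ - H' * S₀ = ω ^ m * (γ / 2) * S₀ := by rw [← sub_mul, hHH']
  have hle : H' * S₀ ≤ H * S₀ := mul_le_mul_of_nonneg_right (by nlinarith) hS₀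
  have hcb : γ * S₀ / 2 ≤ H' * S₀ := by nlinarith [mul_le_mul_of_nonneg_right hH' hS₀]
  have hstep1 : Real.tanh (γ * S₀ / 2) * (ω ^ m * (γ / 2) * S₀) ≤
      Real.log (Real.cosh (H * S₀)) - Real.log (Real.cosh (H' * S₀)) := by
    rw [← hgap]
    exact tanh_mul_sub_le_log_cosh_sub hcb hle
  have hstep2 : Real.exp (-(κ * C.d X)) * (Real.log (Real.cosh (H * S₀)) - Real.log (Real.cosh (H' * S₀))) ≤
      Real.exp (-(κ * C.d X)) * (Λ k i * (γ / 2)) := by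
    rw [mul_sub]
    exact (le_abs_self _).trans h
  have hΛ : Λ k i ≤ C₉ * ω₉ ^ (m + 1) := by
    have h1 := (hF k i hi.le).2
    rwa [hki] at h1
  have h4 : Real.tanh (γ * S₀ / 2) * (ω ^ m * (γ / 2) * S₀) ≤ Λ k i * (γ / 2) :=
    le_of_mul_le_mul_left ((mul_le_mul_of_nonneg_left hstep1 hexp.le).trans hstep2) hexp
  have h5 : γ / 2 * (S₀ * Real.tanh (γ * S₀ / 2) * ω ^ m) ≤ γ / 2 * (C₉ * ω₉ ^ (m + 1)) := by
    calc γ / 2 * (S₀ * Real.tanh (γ * S₀ / 2) * ω ^ m) = Real.tanh (γ * S₀ / 2) * (ω ^ m * (γ / 2) * S₀) := by ring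
      _ ≤ Λ k i * (γ / 2) := h4
      _ ≤ C₉ * ω₉ ^ (m + 1) * (γ / 2) := mul_le_mul_of_nonneg_right hΛ (by positivity)
      _ = γ / 2 * (C₉ * ω₉ ^ (m + 1)) := by ring
  exact le_of_mul_le_mul_left h5 (by positivity)

/-- **THE MEMORY RATE CANNOT BEAT THE CONTRACTION RATE** (two-point member, `S₀ > 0`, `γ > 0`, `0 ≤ ω ≤ 1`): on a carrier
system with domains of unbounded scale, `NE9 … (Window γ) κ Λ ∧ FadingMemory C₉ ω₉ Λ` with `0 < ω₉` forces `ω ≤ ω₉`.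
With `ne9_and_fadingMemory_memModel` (rate `ω` attained by Cauchy): the fading-memory rate of the node's estimate on the
memory model IS the contraction rate. [folklore] -/
theorem contractionRate_le_memoryRate {S₀ : ℝ} (hS₀ : 0 < S₀) {κ γ : ℝ} (hγ : 0 < γ) {ω : ℝ} (hω0 : 0 ≤ ω)
    (hω1 : ω ≤ 1) {Λ : ℕ → ℕ → ℝ} (hN : NE9 (memModel C Bg κ ω twoPoint (twoPointAction S₀)) (Window γ) κ Λ)
    {C₉ ω₉ : ℝ} (hω₉ : 0 < ω₉) (hF : FadingMemory C₉ ω₉ Λ) (U : Bg) (hC : ∀ n : ℕ, ∃ X : C.Dom, n < C.scale X) :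
    ω ≤ ω₉ := by
  rw [← not_lt]
  intro hlt
  have hA : 0 < S₀ * Real.tanh (γ * S₀ / 2) := by
    have ht : 0 < Real.tanh (γ * S₀ / 2) := by
      rw [Real.tanh_eq_sinh_div_cosh]
      exact div_pos (Real.sinh_pos_iff.2 (by positivity)) (Real.cosh_pos _)
    exact mul_pos hS₀ ht
  have hq : 1 < ω / ω₉ := (one_lt_div hω₉).2 hlt
  obtain ⟨m, hm⟩ : ∃ m : ℕ, C₉ * ω₉ / (S₀ * Real.tanh (γ * S₀ / 2)) < (ω / ω₉) ^ m :=
    ((tendsto_pow_atTop_atTop_of_one_lt hq).eventually_gt_atTop _).exists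
  obtain ⟨X, hX⟩ := hC m
  have hb := rate_bound_of_ne9_fadingMemory_memModel_twoPoint (C := C) (Bg := Bg) hS₀.le hγ hω0 hω1 hN hF U hX
  have hle : (ω / ω₉) ^ m ≤ C₉ * ω₉ / (S₀ * Real.tanh (γ * S₀ / 2)) := by
    rw [div_pow, div_le_div_iff₀ (pow_pos hω₉ m) hA]
    calc ω ^ m * (S₀ * Real.tanh (γ * S₀ / 2)) = S₀ * Real.tanh (γ * S₀ / 2) * ω ^ m := by ring
      _ ≤ C₉ * ω₉ ^ (m + 1) := hb
      _ = C₉ * ω₉ * ω₉ ^ m := by ring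
  exact absurd (hm.trans_le hle) (lt_irrefl _)

/-- **TWO-SIDED, FOR THE RATE** (two-point member, `S₀ > 0`, `γ > 0`, `0 < r < 1/S₀`, `0 < ω < 1`, carriers of unbounded
scale): the node's joint shape `∃ Λ, NE9 … (Window γ) κ Λ ∧ FadingMemory C₉ ω₉ Λ` HOLDS at the memory rate `ω₉ = ω` (with
`C₉ = 4M/(rω)`, by Cauchy) and FAILS at every memory rate `0 < ω₉ < ω`, whatever the constant `C₉`. [folklore] -/
theorem memoryRate_twoPoint_two_sided {S₀ : ℝ} (hS₀ : 0 < S₀) (κ : ℝ) {γ : ℝ} (hγ : 0 < γ) {r : ℝ} (hr : 0 < r)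
    (hrS : r * S₀ < 1) {ω : ℝ} (hω0 : 0 < ω) (hω1 : ω < 1) (U : Bg) (hC : ∀ n : ℕ, ∃ X : C.Dom, n < C.scale X) :
    (∃ Λ : ℕ → ℕ → ℝ, NE9 (memModel C Bg κ ω twoPoint (twoPointAction S₀)) (Window γ) κ Λ ∧
        FadingMemory (4 * ((γ / (1 - ω) + 2 * r) * S₀ + (Real.log 2 + Real.pi / 2)) / r / ω) ω Λ) ∧
      ∀ ω₉ C₉ : ℝ, 0 < ω₉ → ω₉ < ω →
        ¬ ∃ Λ : ℕ → ℕ → ℝ, NE9 (memModel C Bg κ ω twoPoint (twoPointAction S₀)) (Window γ) κ Λ ∧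
          FadingMemory C₉ ω₉ Λ := by
  refine ⟨⟨_, ne9_and_fadingMemory_memModel (C := C) (Bg := Bg) (μ := twoPoint)
    (Measurable.of_discrete (f := twoPointAction S₀)) (abs_twoPointAction_le hS₀.le) κ hγ.le hr hrS hω0 hω1⟩, ?_⟩
  rintro ω₉ C₉ hω₉ hlt ⟨Λ, hN, hF⟩
  exact absurd (contractionRate_le_memoryRate hS₀ hγ hω0.le hω1.le hN hω₉ hF U hC) (not_le.2 hlt)

end Memory

end Literature.MathematicalPhysics.QuantumFieldTheory.Balaban1983to89.T4CouplingLogLayer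

end
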